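import Mathlib
import Literature.Analysis.FluidPDE.GigaMiura2011ScaledAlignmentBlowupLimitHolds
import Literature.Analysis.FluidPDE.SteadyNSBoundedMild
import Literature.Analysis.FluidPDE.SteadyNSBoundedAnalytic
import Literature.Analysis.FluidPDE.EnstrophySplitting
import Literature.Analysis.FluidPDE.WholeSpaceIBP
import Literature.Analysis.FluidPDE.KNSSLineInvariantLiouville
import Literature.Analysis.FluidPDE.SteadyHelicalLiouville
import Literature.Analysis.FluidPDE.SteadyNSLiouvilleLpDirichlet
import Literature.Analysis.FluidPDE.HomogeneousEulerProofs
import Literature.Analysis.FluidPDE.SteadyNSLocalEnergy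
import Literature.Analysis.FluidPDE.PlanarCircleWirtinger
import Literature.Analysis.FluidPDE.CylindricalCutoff
import Literature.Analysis.FluidPDE.SteadyPeriodicSlabLiouvilleTools
import HarnessLib

/-!
# Steady Navier–Stokes Liouville theorems in the periodic slab, file 2 of 4: the dyadic Saint-Venant estimate, the small period–Reynolds Liouville theorem (Thm 1.4 (d)), periodic pressure and the helical Liouville theorem — `HanWangXie2023_helical_liouville` HOLDS (re-homed proofs)

**Two Liouville theorems for bounded smooth steady Navier–Stokes flows on `ℝ³` that are periodic in the axial variable.**
(1) Q. Han, Y. Wang, C. Xie, *Liouville-type theorems for steady Navier–Stokes system under helical symmetry or Navier boundary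
conditions*, arXiv:2312.10382 = Sci. China Math. (2025), Theorem 1.1 [HanWangXie2023]: for every viscosity `ν > 0` and pitch
`κ ≠ 0`, a bounded smooth helically symmetric steady solution on `ℝ³` is an axial constant `C e₃` — the named fact
`Literature.Analysis.FluidPDE.HanWangXie2023_helical_liouville` (`SteadyHelicalLiouville.lean`).  (2) J. Bang, C. Gui, Y. Wang,
C. Xie, *Liouville-type theorems for steady solutions to the Navier–Stokes system in a slab*, arXiv:2205.13259 = J. Fluid Mech.
1005 (2025) A6, Theorem 1.4 [BangGuiWangXie2025]: a bounded smooth steady solution on `ℝ³`, `L`-periodic in `x₃`, is an axial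
constant as soon as (a) its swirl velocity is axisymmetric, or (b) its radial velocity is axisymmetric, or (c) `r u^r → 0`
uniformly as `r → ∞`; and (d) it is constant when `sup ‖U‖ < 2πν/L` — the named fact
`Literature.Analysis.FluidPDE.BangGuiWangXie2025_periodicSlab_liouville` (`PeriodicSlabSteadyLiouville.lean`).  Both facts are
PROVED in the tree by the Navier–Stokes blow-up-scenario census cell (`pub/ns-census`, rows S6/S7: periodic pressure, the
Poincaré–Wirtinger inequality on vertical periods, the helical / axisymmetric zero-flux of the radial velocity, foot-point
splitting of the pressure, a stream-function corrector in case (c), weighted dyadic energy (Saint-Venant) estimates) — until now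
Summits-side only (`Summits/NavierStokesRegularity/NavierStokesRegularity/Theorems/ScenarioCensusSteadyS6.lean`, `…S7.lean`).
RE-HOMED into `Literature/` by the Hodge foundations lane (`lit-hodgefound`, prover p20, generation 39) as FOUR files: verbatim
DECLARATION-LEVEL ports (the 135 declarations the two discharges need, in dependency order; each Part header lists the
declarations of its source module that are NOT carried) of 29 Summits modules
`Summits/NavierStokesRegularity/NavierStokesRegularity/Theorems/ScenarioCensus{PeriodicSlab,HelicalSlab}*.lean`, namespaces
`Summit.NavierStokesRegularity.NavierStokesRegularity.Theorems.ScenarioCensus{,.PeriodicSlab,.HelicalSlab}` re-rooted to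
`Literature.Analysis.SteadySlabLiouville{,.PeriodicSlab,.HelicalSlab}` (a root outside `Literature.Analysis.FluidPDE` on purpose:
namespace-prefix resolution would otherwise shadow the cone's lemmas by same-named `FluidPDE` lemmas); imports from `Literature/`
and Mathlib only; no `sorry`, no new axiom, NO named fact (D-0026); the census-row aliases `Row_S6`, `Row_S7`, `Row_S7c` and
`row_S*_excluded` of `ScenarioCensusSteady{,S6,S7}.lean` are Summits bookkeeping and are not carried.  PROVENANCE CONVENTION:
docstrings are carried byte-for-byte; declarations the cell cites keep their cites; `[folklore]`-tagged and untagged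
declarations (the cell's own lemmas) carry the Part's tag `[cite: <Key>, <loc> (source of the ARGUMENT this module implements;
this declaration is the cell's own lemma or plumbing, NOT a printed statement)]`, because the gate does not admit a public
Literature theorem without a cite tag.

THIS FILE (2 of 4) ports: ScenarioCensusPeriodicSlabTerms, ScenarioCensusPeriodicSlabEstimate, ScenarioCensusPeriodicSlabRegularity, ScenarioCensusPeriodicSlabLiouville, ScenarioCensusHelicalSlabPressure, ScenarioCensusHelicalSlabPeriodicPressure, ScenarioCensusPeriodicSlabHelical, ScenarioCensusHelicalSlabLiouville.
-/

noncomputable section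

/-!
## Part 1 — port of `Summits/NavierStokesRegularity/NavierStokesRegularity/Theorems/ScenarioCensusPeriodicSlabTerms.lean` (1 declarations kept)

# Census row S7 (bounded steady flows in the periodic slab, case (d)): the weighted dyadic
# energy inequality

Support file for the scenario census of `NavierStokesRegularity` (cell `pub/ns-census`, row S7 =
Bang–Gui–Wang–Xie 2025, Thm 1.4 (d); tree FACT
`Literature.Analysis.FluidPDE.BangGuiWangXie2025_periodicSlab_liouville`, second conjunct).
Printed proof, arXiv:2205.13259 §5 Step 4: in the energy identity for `w = ∂₃u` tested with the
horizontal cut-off `φ_R`, the convection term `∫ φ ⟪u, (w·∇)w⟫` is absorbed by the Wirtinger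
inequality when `‖u‖_∞ < 2π`, and the cut-off terms live on the annulus where `∇φ_R ≠ 0`. Here:
`dyadic_weighted_estimate`, that inequality on the dyadic annulus `{r ≤ ρ < 2r}` with
`φ = cylCutoff r (2r)`, for every `r ≥ 1` and every splitting parameter `λ > 0` of the pressure
term. Inputs by name: `window_identity` (`…PeriodicSlabWindow`), `slab_wirtinger`
(`…PeriodicSlabTools`), `volume_zSlab_inter_cyl_le`, `partial_bounds` (`…PeriodicSlabBounds`).
Sequel: `…PeriodicSlabEstimate`. No summit statement and no census row is proved in this file.

## References

* J. Bang, C. Gui, Y. Wang, C. Xie, J. Fluid Mech. 1005 (2025) A6 = arXiv:2205.13259, §5 Step 4.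
  [BangGuiWangXie2025]
-/

section Part1

open _root_.MeasureTheory _root_.Set _root_.Function _root_.Filter _root_.InnerProductSpace
open scoped _root_.Topology _root_.ENNReal _root_.NNReal RealInnerProductSpace Laplacian _root_.ContDiff

namespace Literature.Analysis.SteadySlabLiouville.PeriodicSlab

open Literature.Analysis Literature.Analysis.FluidPDE

/-- **The weighted dyadic energy inequality** (Bang–Gui–Wang–Xie, §5 Step 4, on the dyadic
annulus `{r ≤ ρ < 2r}`). Let `U` be smooth, axially `L`-periodic, divergence free, `‖U‖ ≤ M`,
`‖DU‖ ≤ K₁`, `‖D²U‖ ≤ K₂`; let `w = DU(·)e₃` be divergence free and solve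
`ν Δw = (w·∇)U + (U·∇)w + ∇q` with an axially periodic `q ∈ C¹`, `|q| ≤ K₃`; assume
`M L/(2π) ≤ ν`; let `C₀` be the gradient constant of the tree's cylindrical cut-offs. Then for
`r ≥ 1`, `λ > 0`, with `φ = cylCutoff r (2r)`, `χ = 𝟙{r ≤ ρ < 2r}` and `S = zSlab L 0`:
`(ν − M L/(2π)) ∫_S φ|Dw|² ≤ γ (∫_S χ|Dw|²)/r + a λ r + c (∫_S χ|Dw|²)/(λ r)` with the explicit
constants displayed in the statement (`κ = (L/(2π))²`).
[cite: BangGuiWangXie2025, Thm 1.4 (d), proof §5 (Poincaré inequality in the vertical period, localised energy identity, dyadic Saint-Venant estimate) (source of the ARGUMENT this module implements; this declaration is the cell’s own lemma or plumbing, NOT a printed statement)] -/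
theorem dyadic_weighted_estimate {ν L M K₁ K₂ K₃ C₀ : ℝ} (hν : 0 < ν) (hL : 0 < L)
    (hML : M * L / (2 * Real.pi) ≤ ν)
    {U : EuclideanSpace ℝ (Fin 3) → EuclideanSpace ℝ (Fin 3)} {q : EuclideanSpace ℝ (Fin 3) → ℝ}
    (hU : ContDiff ℝ (⊤ : ℕ∞) U) (hq : ContDiff ℝ 1 q) (hdivU : VectorCalculus.IsDivFree U)
    (hdivw : VectorCalculus.IsDivFree (fun y => fderiv ℝ U y eZ))
    (hpde : ∀ x, ν • (Δ (fun y => fderiv ℝ U y eZ)) x =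
      convect (fun y => fderiv ℝ U y eZ) U x + convect U (fun y => fderiv ℝ U y eZ) x +
        gradient q x)
    (hUper : IsAxiallyPeriodic L U) (hqper : IsAxiallyPeriodic L q)
    (hM : ∀ x, ‖U x‖ ≤ M) (hK₁ : ∀ x, ‖fderiv ℝ U x‖ ≤ K₁)
    (hK₂ : ∀ x, ‖iteratedFDeriv ℝ 2 U x‖ ≤ K₂) (hK₃ : ∀ x, |q x| ≤ K₃)
    (hC₀0 : 0 ≤ C₀) (hC₀ : ∀ (ρ₂ ρ₁ : ℝ), 0 ≤ ρ₂ → ρ₂ < ρ₁ → ∀ x : EuclideanSpace ℝ (Fin 3),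
      ‖fderiv ℝ (cylCutoff ρ₂ ρ₁) x‖ ≤ C₀ / (ρ₁ - ρ₂))
    {r : ℝ} (hr : 1 ≤ r) {lam : ℝ} (hlam : 0 < lam) :
    (ν - M * L / (2 * Real.pi)) *
        ∫ x in zSlab L 0, cylCutoff r (2 * r) x *
          frobeniusNormSq (fderiv ℝ (fun y => fderiv ℝ U y eZ) x) ≤
      C₀ * (3 * ν * (1 + (L / (2 * Real.pi)) ^ 2) / 2 + 3 * M * (L / (2 * Real.pi)) ^ 2 / 2) *
          (∫ x in zSlab L 0,
            {x | r ≤ cylRadius x ∧ cylRadius x < 2 * r}.indicator (fun _ => (1 : ℝ)) x *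
              frobeniusNormSq (fderiv ℝ (fun y => fderiv ℝ U y eZ) x)) / r +
        16 * C₀ * K₃ ^ 2 * L * lam * r +
        C₀ * (L / (2 * Real.pi)) ^ 2 / 2 *
          (∫ x in zSlab L 0,
            {x | r ≤ cylRadius x ∧ cylRadius x < 2 * r}.indicator (fun _ => (1 : ℝ)) x *
              frobeniusNormSq (fderiv ℝ (fun y => fderiv ℝ U y eZ) x)) / (lam * r) := by
  set w : EuclideanSpace ℝ (Fin 3) → EuclideanSpace ℝ (Fin 3) := fun y => fderiv ℝ U y eZ with hw
  set b := EuclideanSpace.basisFun (Fin 3) ℝ with hb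
  have hU1 : ContDiff ℝ 1 U := contDiff_infty.1 hU 1
  have hU2 : ContDiff ℝ 2 U := contDiff_infty.1 hU 2
  have hwS : ContDiff ℝ ∞ w := (hU.fderiv_right (m := ∞) le_rfl).clm_apply contDiff_const
  have hw2 : ContDiff ℝ 2 w := contDiff_infty.1 hwS 2
  have hw1 : ContDiff ℝ 1 w := contDiff_infty.1 hwS 1
  have hUc : Continuous U := hU1.continuous
  have hwc : Continuous w := hw1.continuous
  have hqc : Continuous q := hq.continuous
  have hDwc : Continuous (fderiv ℝ w) := hw1.continuous_fderiv one_ne_zero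
  have hFc : Continuous fun x => frobeniusNormSq (fderiv ℝ w x) :=
    continuous_frobeniusNormSq_fderiv hw1 one_ne_zero
  have hwper : IsAxiallyPeriodic L w := fun y => by
    show fderiv ℝ U (y + L • EuclideanSpace.single 2 1) eZ = fderiv ℝ U y eZ
    rw [isAxiallyPeriodic_fderiv hUper y]
  have hDwper : IsAxiallyPeriodic L (fderiv ℝ w) := isAxiallyPeriodic_fderiv hwper
  have hM0 : 0 ≤ M := (norm_nonneg _).trans (hM 0)
  have hK₁0 : 0 ≤ K₁ := (norm_nonneg _).trans (hK₁ 0)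
  have hK₃0 : 0 ≤ K₃ := (abs_nonneg _).trans (hK₃ 0)
  have heZ : ‖(eZ : EuclideanSpace ℝ (Fin 3))‖ = 1 := by simp [eZ]
  have hb2 : b 2 = eZ := by simp [hb, eZ]
  have hw_bd : ∀ x, ‖w x‖ ≤ K₁ := fun x => ((partial_bounds hU2 hK₂ x).2.2).trans (hK₁ x)
  have hDw_op : ∀ x, ‖fderiv ℝ w x‖ ≤ K₂ := fun x => (partial_bounds hU2 hK₂ x).1
  have hF_bd : ∀ x, frobeniusNormSq (fderiv ℝ w x) ≤ 3 * K₂ ^ 2 := fun x => (partial_bounds hU2 hK₂ x).2.1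
  have hF0 : ∀ x, 0 ≤ frobeniusNormSq (fderiv ℝ w x) := fun x => frobeniusNormSq_nonneg _
  have hd3 : ∀ x, ‖fderiv ℝ w x eZ‖ ^ 2 ≤ frobeniusNormSq (fderiv ℝ w x) := fun x => by
    rw [← hb2]; exact norm_apply_sq_le_frobeniusNormSq b _ 2
  have hdi : ∀ x i, ‖fderiv ℝ w x (b i)‖ ^ 2 ≤ frobeniusNormSq (fderiv ℝ w x) := fun x i =>
    norm_apply_sq_le_frobeniusNormSq b _ i
  have hop : ∀ x, ‖fderiv ℝ w x‖ ^ 2 ≤ frobeniusNormSq (fderiv ℝ w x) := fun x =>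
    sq_opNorm_le_frobeniusNormSq _
  set κ : ℝ := (L / (2 * Real.pi)) ^ 2 with hκ
  have hκ0 : 0 ≤ κ := sq_nonneg _
  have hπL : 0 < 2 * Real.pi / L := by positivity
  have hκinv : κ * (2 * Real.pi / L) ^ 2 = 1 := by rw [hκ]; field_simp
  have hr0 : 0 < r := by linarith
  have hr2 : r < 2 * r := by linarith
  -- the cut-off and the annulus
  set φ : EuclideanSpace ℝ (Fin 3) → ℝ := cylCutoff r (2 * r) with hφ
  have hφ1 : ContDiff ℝ 1 φ := contDiff_cylCutoff r (2 * r)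
  have hφc : Continuous φ := hφ1.continuous
  have hφm : Measurable φ := hφc.measurable
  have hφnn : ∀ x, 0 ≤ φ x := cylCutoff_nonneg r (2 * r)
  have hφle : ∀ x, φ x ≤ 1 := cylCutoff_le_one r (2 * r)
  have hφone : ∀ x, cylRadius x ≤ r → φ x = 1 := fun x hx => cylCutoff_eq_one hr0.le hr2 hx
  have hφzero : ∀ x, 2 * r ≤ cylRadius x → φ x = 0 := fun x hx => cylCutoff_eq_zero hr0.le hr2 hx
  have hφz : ∀ (x : EuclideanSpace ℝ (Fin 3)) (s : ℝ), φ (x + s • eZ) = φ x :=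
    fun x s => cylCutoff_add_smul_eZ r (2 * r) x s
  have hφper : IsAxiallyPeriodic L φ := isAxiallyPeriodic_cylCutoff L r (2 * r)
  have hDφn : ∀ x, ‖fderiv ℝ φ x‖ ≤ C₀ / r := fun x => by
    have := hC₀ r (2 * r) hr0.le hr2 x; rwa [show 2 * r - r = r by ring] at this
  set A : Set (EuclideanSpace ℝ (Fin 3)) := {x | r ≤ cylRadius x ∧ cylRadius x < 2 * r} with hA
  have hAm : MeasurableSet A :=
    (isClosed_le continuous_const continuous_cylRadius).measurableSet.inter
      (isOpen_lt continuous_cylRadius continuous_const).measurableSet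
  set χ : EuclideanSpace ℝ (Fin 3) → ℝ := A.indicator fun _ => (1 : ℝ) with hχ
  have hχm : Measurable χ := measurable_const.indicator hAm
  have hχnn : ∀ x, 0 ≤ χ x := fun x => Set.indicator_nonneg (fun _ _ => zero_le_one) x
  have hχle : ∀ x, χ x ≤ 1 := fun x => Set.indicator_le_self' (fun _ _ => zero_le_one) x
  have hcyl : ∀ (x : EuclideanSpace ℝ (Fin 3)) (s : ℝ), cylRadius (x + s • eZ) = cylRadius x :=
    fun x s => by simp [cylRadius, eZ]
  have hχz : ∀ (x : EuclideanSpace ℝ (Fin 3)) (s : ℝ), χ (x + s • eZ) = χ x := fun x s => by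
    simp only [hχ, Set.indicator_apply, hA, mem_setOf_eq, hcyl]
  have hχzero : ∀ x, 2 * r ≤ cylRadius x → χ x = 0 := fun x hx => by
    simp only [hχ, Set.indicator_apply, hA, mem_setOf_eq]
    rw [if_neg]; exact fun h => absurd h.2 (not_lt.2 hx)
  -- `|Dφ(x) v| ≤ (C₀/r) χ(x) ‖v‖`
  have hDφ : ∀ (x v : EuclideanSpace ℝ (Fin 3)), |fderiv ℝ φ x v| ≤ C₀ / r * χ x * ‖v‖ := by
    intro x v
    by_cases hx : x ∈ A
    · have hχ1 : χ x = 1 := by simp [hχ, hx]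
      rw [hχ1, mul_one, ← Real.norm_eq_abs]
      exact (ContinuousLinearMap.le_opNorm _ _).trans
        (mul_le_mul_of_nonneg_right (hDφn x) (norm_nonneg _))
    · have hD0 : fderiv ℝ φ x = 0 := by
        simp only [hA, mem_setOf_eq, not_and_or, not_le, not_lt] at hx
        rcases hx with hx | hx
        · have hmax : IsLocalMax φ x :=
            Eventually.of_forall fun y => by rw [hφone x hx.le]; exact hφle y
          exact hmax.fderiv_eq_zero
        · have hmin : IsLocalMin φ x :=
            Eventually.of_forall fun y => by rw [hφzero x hx]; exact hφnn y
          exact hmin.fderiv_eq_zero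
      rw [hD0]; simp only [zero_apply, abs_zero]
      exact mul_nonneg (mul_nonneg (div_nonneg hC₀0 hr0.le) (hχnn x)) (norm_nonneg _)
  have wi := window_identity hL hU1 hw2 hq hdivU hdivw hpde hUper hwper hqper hφ1 hφper hφnn hφzero
  set S : Set (EuclideanSpace ℝ (Fin 3)) := zSlab L 0 with hS
  set F : EuclideanSpace ℝ (Fin 3) → ℝ := fun x => frobeniusNormSq (fderiv ℝ w x) with hF
  set Iφ : ℝ := ∫ x in S, φ x * F x with hIφ
  set D : ℝ := ∫ x in S, χ x * F x with hD
  set Jφ : ℝ := ∫ x in S, φ x * ‖w x‖ ^ 2 with hJφ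
  set JA : ℝ := ∫ x in S, χ x * ‖w x‖ ^ 2 with hJA
  -- integrability on the slab: continuous × cut-off, and indicator × bounded
  have hint_c : ∀ {G : EuclideanSpace ℝ (Fin 3) → ℝ}, Continuous G →
      (∀ x, 2 * r ≤ cylRadius x → G x = 0) → IntegrableOn G S volume := fun hG hG0 =>
    integrableOn_zSlab_of_eq_zero_of_le_cylRadius hG hG0 L 0
  have hint_χ : ∀ {G : EuclideanSpace ℝ (Fin 3) → ℝ}, Continuous G → ∀ {B : ℝ}, (∀ x, |G x| ≤ B) →
      IntegrableOn (fun x => χ x * G x) S volume := by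
    intro G hG B hB
    refine integrableOn_zSlab_of_bound hL ((hχm.mul hG.measurable).aestronglyMeasurable)
      (ρ := 2 * r) (fun x hx => by rw [hχzero x hx, zero_mul]) (B := B) fun x _ => ?_
    rw [Real.norm_eq_abs, abs_mul, abs_of_nonneg (hχnn x)]
    exact (mul_le_mul_of_nonneg_right (hχle x) (abs_nonneg _)).trans (by rw [one_mul]; exact hB x)
  have hIφ_int : IntegrableOn (fun x => φ x * F x) S volume :=
    hint_c (hφc.mul hFc) fun x hx => by rw [hφzero x hx, zero_mul]
  have hJφ_int : IntegrableOn (fun x => φ x * ‖w x‖ ^ 2) S volume :=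
    hint_c (hφc.mul (hwc.norm.pow 2)) fun x hx => by rw [hφzero x hx, zero_mul]
  have hD_int : IntegrableOn (fun x => χ x * F x) S volume :=
    hint_χ hFc (B := 3 * K₂ ^ 2) fun x => by rw [abs_of_nonneg (hF0 x)]; exact hF_bd x
  have hJA_int : IntegrableOn (fun x => χ x * ‖w x‖ ^ 2) S volume :=
    hint_χ (hwc.norm.pow 2) (B := K₁ ^ 2) fun x => by
      rw [abs_of_nonneg (sq_nonneg _)]; exact pow_le_pow_left₀ (norm_nonneg _) (hw_bd x) 2
  have hIφ0 : 0 ≤ Iφ := setIntegral_nonneg (measurableSet_zSlab L 0) fun x _ =>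
    mul_nonneg (hφnn x) (hF0 x)
  have hD0' : 0 ≤ D := setIntegral_nonneg (measurableSet_zSlab L 0) fun x _ =>
    mul_nonneg (hχnn x) (hF0 x)
  have hJA0 : 0 ≤ JA := setIntegral_nonneg (measurableSet_zSlab L 0) fun x _ =>
    mul_nonneg (hχnn x) (sq_nonneg _)
  -- Wirtinger: `Jφ ≤ κ Iφ`, `JA ≤ κ D`
  have hWφ : Jφ ≤ κ * Iφ := by
    have h1 := slab_wirtinger hL hU2 hUper hφm hφnn hφz hφle (ρ := 2 * r) hφzero
    have h2 : ∫ x in S, φ x * ‖fderiv ℝ (fun y => fderiv ℝ U y eZ) x eZ‖ ^ 2 ≤ Iφ := by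
      refine setIntegral_mono_on ?_ hIφ_int (measurableSet_zSlab L 0) fun x _ =>
        mul_le_mul_of_nonneg_left (hd3 x) (hφnn x)
      exact hint_c (hφc.mul ((hDwc.clm_apply continuous_const).norm.pow 2))
        fun x hx => by rw [hφzero x hx, zero_mul]
    have h3 : (2 * Real.pi / L) ^ 2 * Jφ ≤ Iφ := h1.trans h2
    calc Jφ = κ * ((2 * Real.pi / L) ^ 2 * Jφ) := by rw [← mul_assoc, hκinv, one_mul]
      _ ≤ κ * Iφ := mul_le_mul_of_nonneg_left h3 hκ0
  have hWA : JA ≤ κ * D := by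
    have h1 := slab_wirtinger hL hU2 hUper hχm hχnn hχz hχle (ρ := 2 * r) hχzero
    have h2 : ∫ x in S, χ x * ‖fderiv ℝ (fun y => fderiv ℝ U y eZ) x eZ‖ ^ 2 ≤ D := by
      refine setIntegral_mono_on ?_ hD_int (measurableSet_zSlab L 0) fun x _ =>
        mul_le_mul_of_nonneg_left (hd3 x) (hχnn x)
      exact hint_χ ((hDwc.clm_apply continuous_const).norm.pow 2) (B := K₂ ^ 2) fun x => by
        rw [abs_of_nonneg (sq_nonneg _)]
        refine pow_le_pow_left₀ (norm_nonneg _) ?_ 2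
        calc ‖fderiv ℝ w x eZ‖ ≤ ‖fderiv ℝ w x‖ * ‖(eZ : EuclideanSpace ℝ (Fin 3))‖ :=
              ContinuousLinearMap.le_opNorm _ _
          _ ≤ K₂ := by rw [heZ, mul_one]; exact hDw_op x
    have h3 : (2 * Real.pi / L) ^ 2 * JA ≤ D := h1.trans h2
    calc JA = κ * ((2 * Real.pi / L) ^ 2 * JA) := by rw [← mul_assoc, hκinv, one_mul]
      _ ≤ κ * D := mul_le_mul_of_nonneg_left h3 hκ0
  -- T1: the Green terms
  have hT1 : ∀ i, |∫ x in S, fderiv ℝ φ x (b i) * ⟪fderiv ℝ w x (b i), w x⟫| ≤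
      C₀ / (2 * r) * (D + JA) := by
    intro i
    have hbi : ‖b i‖ = 1 := b.orthonormal.1 i
    have hg_int : IntegrableOn (fun x => C₀ / (2 * r) * (χ x * F x + χ x * ‖w x‖ ^ 2)) S volume :=
      (hD_int.add hJA_int).const_mul _
    have h1 := norm_integral_le_of_norm_le (μ := volume.restrict S) hg_int
      (Eventually.of_forall fun x => (?_ :
        ‖fderiv ℝ φ x (b i) * ⟪fderiv ℝ w x (b i), w x⟫‖ ≤
          C₀ / (2 * r) * (χ x * F x + χ x * ‖w x‖ ^ 2)))
    · rw [Real.norm_eq_abs] at h1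
      refine h1.trans (le_of_eq ?_)
      rw [integral_const_mul, integral_add hD_int hJA_int]
    · rw [norm_mul, Real.norm_eq_abs]
      have h2 : |fderiv ℝ φ x (b i)| ≤ C₀ / r * χ x := by
        have := hDφ x (b i); rwa [hbi, mul_one] at this
      have h3 : ‖⟪fderiv ℝ w x (b i), w x⟫‖ ≤ ‖fderiv ℝ w x (b i)‖ * ‖w x‖ := norm_inner_le_norm _ _
      have h4 : ‖fderiv ℝ w x (b i)‖ * ‖w x‖ ≤ (F x + ‖w x‖ ^ 2) / 2 := by
        have h6 := two_mul_le_add_sq ‖fderiv ℝ w x (b i)‖ ‖w x‖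
        have h7 := hdi x i
        linarith only [h6, h7]
      have h5 : 0 ≤ C₀ / r * χ x := mul_nonneg (div_nonneg hC₀0 hr0.le) (hχnn x)
      calc |fderiv ℝ φ x (b i)| * ‖⟪fderiv ℝ w x (b i), w x⟫‖
          ≤ (C₀ / r * χ x) * ((F x + ‖w x‖ ^ 2) / 2) :=
            mul_le_mul h2 (h3.trans h4) (norm_nonneg _) h5
        _ = C₀ / (2 * r) * (χ x * F x + χ x * ‖w x‖ ^ 2) := by ring
  have hT1s : |∑ i, ∫ x in S, fderiv ℝ φ x (b i) * ⟪fderiv ℝ w x (b i), w x⟫| ≤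
      3 * (C₀ / (2 * r) * (D + JA)) := by
    refine (Finset.abs_sum_le_sum_abs _ _).trans ?_
    calc ∑ i, |∫ x in S, fderiv ℝ φ x (b i) * ⟪fderiv ℝ w x (b i), w x⟫|
        ≤ ∑ _i : Fin 3, C₀ / (2 * r) * (D + JA) := Finset.sum_le_sum fun i _ => hT1 i
      _ = 3 * (C₀ / (2 * r) * (D + JA)) := by simp
  have hT2 : |∫ x in S, fderiv ℝ φ x (U x) * ‖w x‖ ^ 2| ≤ C₀ * M / r * JA := by
    have hg_int : IntegrableOn (fun x => C₀ * M / r * (χ x * ‖w x‖ ^ 2)) S volume :=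
      hJA_int.const_mul _
    have h1 := norm_integral_le_of_norm_le (μ := volume.restrict S) hg_int
      (Eventually.of_forall fun x => (?_ :
        ‖fderiv ℝ φ x (U x) * ‖w x‖ ^ 2‖ ≤ C₀ * M / r * (χ x * ‖w x‖ ^ 2)))
    · rw [Real.norm_eq_abs] at h1
      refine h1.trans (le_of_eq ?_)
      rw [integral_const_mul]
    · rw [norm_mul, Real.norm_eq_abs, Real.norm_eq_abs, abs_of_nonneg (sq_nonneg ‖w x‖)]
      have h2 : |fderiv ℝ φ x (U x)| ≤ C₀ / r * χ x * M :=
        (hDφ x (U x)).trans (mul_le_mul_of_nonneg_left (hM x)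
          (mul_nonneg (div_nonneg hC₀0 hr0.le) (hχnn x)))
      calc |fderiv ℝ φ x (U x)| * ‖w x‖ ^ 2 ≤ (C₀ / r * χ x * M) * ‖w x‖ ^ 2 :=
            mul_le_mul_of_nonneg_right h2 (sq_nonneg _)
        _ = C₀ * M / r * (χ x * ‖w x‖ ^ 2) := by ring
  have hT3 : |∫ x in S, fderiv ℝ φ x (w x) * ⟪U x, w x⟫| ≤ C₀ * M / r * JA := by
    have hg_int : IntegrableOn (fun x => C₀ * M / r * (χ x * ‖w x‖ ^ 2)) S volume :=
      hJA_int.const_mul _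
    have h1 := norm_integral_le_of_norm_le (μ := volume.restrict S) hg_int
      (Eventually.of_forall fun x => (?_ :
        ‖fderiv ℝ φ x (w x) * ⟪U x, w x⟫‖ ≤ C₀ * M / r * (χ x * ‖w x‖ ^ 2)))
    · rw [Real.norm_eq_abs] at h1
      refine h1.trans (le_of_eq ?_)
      rw [integral_const_mul]
    · rw [norm_mul, Real.norm_eq_abs]
      have h2 : |fderiv ℝ φ x (w x)| ≤ C₀ / r * χ x * ‖w x‖ := hDφ x (w x)
      have h3 : ‖⟪U x, w x⟫‖ ≤ M * ‖w x‖ :=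
        (norm_inner_le_norm _ _).trans (mul_le_mul_of_nonneg_right (hM x) (norm_nonneg _))
      have h5 : 0 ≤ C₀ / r * χ x * ‖w x‖ :=
        mul_nonneg (mul_nonneg (div_nonneg hC₀0 hr0.le) (hχnn x)) (norm_nonneg _)
      calc |fderiv ℝ φ x (w x)| * ‖⟪U x, w x⟫‖ ≤ (C₀ / r * χ x * ‖w x‖) * (M * ‖w x‖) :=
            mul_le_mul h2 h3 (norm_nonneg _) h5
        _ = C₀ * M / r * (χ x * ‖w x‖ ^ 2) := by ring
  -- T4: absorption by the sharp Wirtinger inequality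
  set t : ℝ := 2 * Real.pi / L with ht
  have ht0 : 0 < t := hπL
  have hT4 : ∫ x in S, φ x * ⟪U x, fderiv ℝ w x (w x)⟫ ≤ M * L / (2 * Real.pi) * Iφ := by
    have hg_int : IntegrableOn (fun x => M * t / 2 * (φ x * ‖w x‖ ^ 2) + M / (2 * t) * (φ x * F x))
        S volume := (hJφ_int.const_mul _).add (hIφ_int.const_mul _)
    have hf_int : IntegrableOn (fun x => φ x * ⟪U x, fderiv ℝ w x (w x)⟫) S volume :=
      hint_c (hφc.mul (hUc.inner (hDwc.clm_apply hwc))) fun x hx => by rw [hφzero x hx, zero_mul]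
    have h1 : ∫ x in S, φ x * ⟪U x, fderiv ℝ w x (w x)⟫ ≤
        ∫ x in S, (M * t / 2 * (φ x * ‖w x‖ ^ 2) + M / (2 * t) * (φ x * F x)) := by
      refine setIntegral_mono_on hf_int hg_int (measurableSet_zSlab L 0) fun x _ => ?_
      have h2 : ⟪U x, fderiv ℝ w x (w x)⟫ ≤ M * (‖fderiv ℝ w x‖ * ‖w x‖) :=
        (real_inner_le_norm _ _).trans (mul_le_mul (hM x) (ContinuousLinearMap.le_opNorm _ _)
          (norm_nonneg _) hM0)
      have h3 : ‖fderiv ℝ w x‖ * ‖w x‖ ≤ (t * ‖w x‖ ^ 2 + F x / t) / 2 := by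
        have h4 : ‖fderiv ℝ w x‖ * ‖w x‖ ≤ (t * ‖w x‖ ^ 2 + ‖fderiv ℝ w x‖ ^ 2 / t) / 2 := by
          have key : 0 ≤ (t * ‖w x‖ - ‖fderiv ℝ w x‖) ^ 2 / t := by positivity
          rw [alg_sq_div t ‖w x‖ ‖fderiv ℝ w x‖ ht0.ne'] at key
          linarith only [key]
        have h5 : ‖fderiv ℝ w x‖ ^ 2 / t ≤ F x / t := div_le_div_of_nonneg_right (hop x) ht0.le
        linarith only [h4, h5]
      calc φ x * ⟪U x, fderiv ℝ w x (w x)⟫ ≤ φ x * (M * ((t * ‖w x‖ ^ 2 + F x / t) / 2)) :=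
            mul_le_mul_of_nonneg_left (h2.trans (mul_le_mul_of_nonneg_left h3 hM0)) (hφnn x)
        _ = M * t / 2 * (φ x * ‖w x‖ ^ 2) + M / (2 * t) * (φ x * F x) := by ring
    have h6 : ∫ x in S, (M * t / 2 * (φ x * ‖w x‖ ^ 2) + M / (2 * t) * (φ x * F x)) =
        M * t / 2 * Jφ + M / (2 * t) * Iφ := by
      rw [integral_add (hJφ_int.const_mul _) (hIφ_int.const_mul _), integral_const_mul,
        integral_const_mul]
    rw [h6] at h1
    have h7 : M * t / 2 * Jφ ≤ M * t / 2 * (κ * Iφ) := mul_le_mul_of_nonneg_left hWφ (by positivity)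
    have h8 : M * t / 2 * (κ * Iφ) + M / (2 * t) * Iφ = M * L / (2 * Real.pi) * Iφ := by
      rw [ht, hκ]; exact alg_absorb M L Iφ hL.ne'
    linarith only [h1, h7, h8]
  -- T5: the pressure term
  set V : ℝ := ∫ x in S, χ x with hVdef
  have hV : V ≤ 32 * L * r ^ 2 := by
    have h1 : V = volume.real (S ∩ A) := by
      rw [hVdef, hχ, setIntegral_indicator hAm, setIntegral_const, smul_eq_mul, mul_one]
    rw [h1, measureReal_def]
    refine ENNReal.toReal_le_of_le_ofReal (by positivity) ?_
    calc volume (S ∩ A) ≤ volume (zSlab L 0 ∩ {x | cylRadius x < 2 * r}) :=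
          measure_mono fun x hx => ⟨hx.1, hx.2.2⟩
      _ ≤ ENNReal.ofReal (8 * L * (2 * r) ^ 2) := volume_zSlab_inter_cyl_le hL (by linarith)
      _ = ENNReal.ofReal (32 * L * r ^ 2) := by ring_nf
  have hχ_int : IntegrableOn χ S volume :=
    integrableOn_zSlab_of_bound hL hχm.aestronglyMeasurable (ρ := 2 * r) hχzero (B := 1)
      fun x _ => by rw [Real.norm_eq_abs, abs_of_nonneg (hχnn x)]; exact hχle x
  have hT5 : |∫ x in S, q x * fderiv ℝ φ x (w x)| ≤
      16 * C₀ * K₃ ^ 2 * L * lam * r + C₀ / (2 * lam * r) * JA := by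
    have hg_int : IntegrableOn
        (fun x => C₀ * K₃ ^ 2 * lam / (2 * r) * χ x + C₀ / (2 * lam * r) * (χ x * ‖w x‖ ^ 2))
        S volume := (hχ_int.const_mul _).add (hJA_int.const_mul _)
    have h1 := norm_integral_le_of_norm_le (μ := volume.restrict S) hg_int
      (Eventually.of_forall fun x => (?_ :
        ‖q x * fderiv ℝ φ x (w x)‖ ≤
          C₀ * K₃ ^ 2 * lam / (2 * r) * χ x + C₀ / (2 * lam * r) * (χ x * ‖w x‖ ^ 2)))
    · rw [Real.norm_eq_abs] at h1
      have h2 : ∫ x in S, (C₀ * K₃ ^ 2 * lam / (2 * r) * χ x + C₀ / (2 * lam * r) * (χ x * ‖w x‖ ^ 2)) =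
          C₀ * K₃ ^ 2 * lam / (2 * r) * V + C₀ / (2 * lam * r) * JA := by
        rw [integral_add (hχ_int.const_mul _) (hJA_int.const_mul _), integral_const_mul,
          integral_const_mul]
      rw [h2] at h1
      have hc0 : 0 ≤ C₀ * K₃ ^ 2 * lam / (2 * r) := by positivity
      have h3 : C₀ * K₃ ^ 2 * lam / (2 * r) * V ≤ C₀ * K₃ ^ 2 * lam / (2 * r) * (32 * L * r ^ 2) :=
        mul_le_mul_of_nonneg_left hV hc0
      have h4 : C₀ * K₃ ^ 2 * lam / (2 * r) * (32 * L * r ^ 2) = 16 * C₀ * K₃ ^ 2 * L * lam * r :=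
        alg_volume C₀ K₃ lam L r hr0.ne'
      linarith only [h1, h3, h4]
    · rw [norm_mul, Real.norm_eq_abs, Real.norm_eq_abs]
      have h2 : |fderiv ℝ φ x (w x)| ≤ C₀ / r * χ x * ‖w x‖ := hDφ x (w x)
      have h3 : |q x| * |fderiv ℝ φ x (w x)| ≤ K₃ * (C₀ / r * χ x * ‖w x‖) :=
        mul_le_mul (hK₃ x) h2 (abs_nonneg _) hK₃0
      have h4 : K₃ * ‖w x‖ ≤ (lam * K₃ ^ 2 + ‖w x‖ ^ 2 / lam) / 2 := by
        have key : 0 ≤ (lam * K₃ - ‖w x‖) ^ 2 / lam := by positivity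
        rw [alg_sq_div lam K₃ ‖w x‖ hlam.ne'] at key
        linarith only [key]
      have h5 : 0 ≤ C₀ / r * χ x := mul_nonneg (div_nonneg hC₀0 hr0.le) (hχnn x)
      calc |q x| * |fderiv ℝ φ x (w x)| ≤ K₃ * (C₀ / r * χ x * ‖w x‖) := h3
        _ = (C₀ / r * χ x) * (K₃ * ‖w x‖) := by ring
        _ ≤ (C₀ / r * χ x) * ((lam * K₃ ^ 2 + ‖w x‖ ^ 2 / lam) / 2) :=
            mul_le_mul_of_nonneg_left h4 h5
        _ = C₀ * K₃ ^ 2 * lam / (2 * r) * χ x + C₀ / (2 * lam * r) * (χ x * ‖w x‖ ^ 2) :=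
            alg_split C₀ r (χ x) lam K₃ ‖w x‖ hr0.ne' hlam.ne'
  have hν' : 0 ≤ ν - M * L / (2 * Real.pi) := sub_nonneg.2 hML
  have hmain : (ν - M * L / (2 * Real.pi)) * Iφ ≤
      C₀ * (3 * ν * (1 + κ) / 2 + 3 * M * κ / 2) * D / r + 16 * C₀ * K₃ ^ 2 * L * lam * r +
        C₀ * κ / 2 * D / (lam * r) := by
    have hwi : ν * Iφ = -(ν * ∑ i, ∫ x in S, fderiv ℝ φ x (b i) * ⟪fderiv ℝ w x (b i), w x⟫) +
        2⁻¹ * (∫ x in S, fderiv ℝ φ x (U x) * ‖w x‖ ^ 2) +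
        (∫ x in S, fderiv ℝ φ x (w x) * ⟪U x, w x⟫) +
        (∫ x in S, φ x * ⟪U x, fderiv ℝ w x (w x)⟫) +
        ∫ x in S, q x * fderiv ℝ φ x (w x) := wi
    have a1 := (abs_le.1 hT1s).1
    have a2 := (abs_le.1 hT2).2
    have a3 := (abs_le.1 hT3).2
    have a5 := (abs_le.1 hT5).2
    have hSum : -(∑ i, ∫ x in S, fderiv ℝ φ x (b i) * ⟪fderiv ℝ w x (b i), w x⟫) ≤
        3 * (C₀ / (2 * r) * (D + JA)) := by linarith only [a1]
    have b1 := mul_le_mul_of_nonneg_left hSum hν.le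
    have hDJ : D + JA ≤ D + κ * D := by linarith only [hWA]
    have b2 : ν * (3 * (C₀ / (2 * r) * (D + JA))) ≤ ν * (3 * (C₀ / (2 * r) * (D + κ * D))) :=
      mul_le_mul_of_nonneg_left (mul_le_mul_of_nonneg_left
        (mul_le_mul_of_nonneg_left hDJ (by positivity)) (by norm_num)) hν.le
    have b3 : C₀ * M / r * JA ≤ C₀ * M / r * (κ * D) := mul_le_mul_of_nonneg_left hWA (by positivity)
    have b4 : C₀ / (2 * lam * r) * JA ≤ C₀ / (2 * lam * r) * (κ * D) :=
      mul_le_mul_of_nonneg_left hWA (by positivity)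
    have e := alg_collect ν C₀ M κ D r lam hr0.ne' hlam.ne'
    linarith only [hwi, b1, b2, a2, a3, b3, hT4, a5, b4, e]
  exact hmain

end Literature.Analysis.SteadySlabLiouville.PeriodicSlab

end Part1

/-!
## Part 2 — port of `Summits/NavierStokesRegularity/NavierStokesRegularity/Theorems/ScenarioCensusPeriodicSlabEstimate.lean` (2 declarations kept)

# Census row S7 (bounded steady flows in the periodic slab, case (d)): the dyadic energy estimate
# for `E(r) = ∫_{period ∩ {ρ<r}} |D∂₃U|²`

Support file for the scenario census of `NavierStokesRegularity` (cell `pub/ns-census`, row S7 =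
Bang–Gui–Wang–Xie 2025, Thm 1.4 (d); tree FACT
`Literature.Analysis.FluidPDE.BangGuiWangXie2025_periodicSlab_liouville`, second conjunct). The
weighted inequality of `…PeriodicSlabTerms` (`dyadic_weighted_estimate`, cut-off
`φ = cylCutoff r (2r)`, annulus indicator `χ`) is rewritten in terms of the energy function of the
printed proof, `Z(R) = ∫ |∇∂_{x₃}u|² φ_R` (arXiv:2205.13259 §5 Step 4), here
`E(r) = ∫_{zSlab L 0 ∩ {ρ < r}} |D∂₃U|²`: since `φ = 1` on `{ρ ≤ r}` and `χ ≤ 𝟙{ρ < 2r} − 𝟙{ρ < r}`,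
`E(r) ≤ ∫ φ|Dw|²` and `∫ χ|Dw|² = E(2r) − E(r)`.

* `energy_dyadic_estimate` — `∃ γ a c ≥ 0`, for all `r ≥ 1`, `λ > 0`:
  `(ν − M L/(2π)) E(r) ≤ γ (E(2r) − E(r))/r + a λ r + c (E(2r) − E(r))/(λ r)`.

* `saintVenant_dyadic` — the elementary real-variable lemma: a nondecreasing `E ≥ 0` of at most
  quadratic growth satisfying such a dyadic inequality (with `ν − M L/(2π) > 0`) vanishes
  identically; this discrete form replaces the differential inequality
  `Z(R) ≤ C R^{1/2} Z'(R)^{1/2}` of the printed proof.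

The Liouville conclusion is the sequel file `…PeriodicSlabLiouville`. No summit statement and no
census row is proved in this file.

## References

* J. Bang, C. Gui, Y. Wang, C. Xie, J. Fluid Mech. 1005 (2025) A6 = arXiv:2205.13259, §5 Step 4.
  [BangGuiWangXie2025]
-/

section Part2

open _root_.MeasureTheory _root_.Set _root_.Function _root_.Filter _root_.InnerProductSpace
open scoped _root_.Topology _root_.ENNReal _root_.NNReal RealInnerProductSpace Laplacian _root_.ContDiff

namespace Literature.Analysis.SteadySlabLiouville.PeriodicSlab

open Literature.Analysis Literature.Analysis.FluidPDE

/-- **The dyadic energy estimate** (Bang–Gui–Wang–Xie, §5 Step 4, quantified on dyadic annuli).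
Let `U` be smooth, axially `L`-periodic, divergence free, with `‖U‖ ≤ M`, `‖DU‖ ≤ K₁`,
`‖D²U‖ ≤ K₂`; let `w = DU(·)e₃` be divergence free and solve `ν Δw = (w·∇)U + (U·∇)w + ∇q` with an
axially periodic `q ∈ C¹`, `|q| ≤ K₃`; assume `M L/(2π) ≤ ν`. Put
`E(r) = ∫_{zSlab L 0 ∩ {ρ < r}} |Dw|²`. Then there are `γ, a, c ≥ 0` with
`(ν − M L/(2π)) E(r) ≤ γ (E(2r) − E(r))/r + a λ r + c (E(2r) − E(r))/(λ r)`
for all `r ≥ 1` and `λ > 0`.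
[cite: BangGuiWangXie2025, Thm 1.4 (d), proof §5 (Poincaré inequality in the vertical period, localised energy identity, dyadic Saint-Venant estimate) (source of the ARGUMENT this module implements; this declaration is the cell’s own lemma or plumbing, NOT a printed statement)] -/
theorem energy_dyadic_estimate {ν L M K₁ K₂ K₃ : ℝ} (hν : 0 < ν) (hL : 0 < L)
    (hML : M * L / (2 * Real.pi) ≤ ν)
    {U : EuclideanSpace ℝ (Fin 3) → EuclideanSpace ℝ (Fin 3)} {q : EuclideanSpace ℝ (Fin 3) → ℝ}
    (hU : ContDiff ℝ (⊤ : ℕ∞) U) (hq : ContDiff ℝ 1 q) (hdivU : VectorCalculus.IsDivFree U)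
    (hdivw : VectorCalculus.IsDivFree (fun y => fderiv ℝ U y eZ))
    (hpde : ∀ x, ν • (Δ (fun y => fderiv ℝ U y eZ)) x =
      convect (fun y => fderiv ℝ U y eZ) U x + convect U (fun y => fderiv ℝ U y eZ) x +
        gradient q x)
    (hUper : IsAxiallyPeriodic L U) (hqper : IsAxiallyPeriodic L q)
    (hM : ∀ x, ‖U x‖ ≤ M) (hK₁ : ∀ x, ‖fderiv ℝ U x‖ ≤ K₁)
    (hK₂ : ∀ x, ‖iteratedFDeriv ℝ 2 U x‖ ≤ K₂) (hK₃ : ∀ x, |q x| ≤ K₃)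
    (E : ℝ → ℝ) (hE : ∀ r, E r = ∫ x in zSlab L 0 ∩ {x | cylRadius x < r},
      frobeniusNormSq (fderiv ℝ (fun y => fderiv ℝ U y eZ) x)) :
    ∃ γ a c : ℝ, 0 ≤ γ ∧ 0 ≤ a ∧ 0 ≤ c ∧ ∀ r : ℝ, 1 ≤ r → ∀ lam : ℝ, 0 < lam →
      (ν - M * L / (2 * Real.pi)) * E r ≤
        γ * (E (2 * r) - E r) / r + a * lam * r + c * (E (2 * r) - E r) / (lam * r) := by
  obtain ⟨C₀, hC₀0, hC₀⟩ := exists_norm_fderiv_cylCutoff_le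
  set w : EuclideanSpace ℝ (Fin 3) → EuclideanSpace ℝ (Fin 3) := fun y => fderiv ℝ U y eZ with hw
  set κ : ℝ := (L / (2 * Real.pi)) ^ 2 with hκ
  have hκ0 : 0 ≤ κ := sq_nonneg _
  have hM0 : 0 ≤ M := (norm_nonneg _).trans (hM 0)
  have hU2 : ContDiff ℝ 2 U := contDiff_infty.1 hU 2
  have hwS : ContDiff ℝ ∞ w := (hU.fderiv_right (m := ∞) le_rfl).clm_apply contDiff_const
  have hw1 : ContDiff ℝ 1 w := contDiff_infty.1 hwS 1
  have hFc : Continuous fun x => frobeniusNormSq (fderiv ℝ w x) :=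
    continuous_frobeniusNormSq_fderiv hw1 one_ne_zero
  have hF0 : ∀ x, 0 ≤ frobeniusNormSq (fderiv ℝ w x) := fun x => frobeniusNormSq_nonneg _
  have hF_bd : ∀ x, frobeniusNormSq (fderiv ℝ w x) ≤ 3 * K₂ ^ 2 := fun x =>
    (partial_bounds hU2 hK₂ x).2.1
  refine ⟨C₀ * (3 * ν * (1 + κ) / 2 + 3 * M * κ / 2), 16 * C₀ * K₃ ^ 2 * L, C₀ * κ / 2,
    by positivity, by positivity, by positivity, ?_⟩
  intro r hr lam hlam
  have hr0 : 0 < r := by linarith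
  have hr2 : r < 2 * r := by linarith
  have hA := dyadic_weighted_estimate hν hL hML hU hq hdivU hdivw hpde hUper hqper hM hK₁ hK₂ hK₃
    hC₀0 hC₀ hr hlam
  -- abbreviations matching the weighted inequality
  set S : Set (EuclideanSpace ℝ (Fin 3)) := zSlab L 0 with hS
  set F : EuclideanSpace ℝ (Fin 3) → ℝ := fun x => frobeniusNormSq (fderiv ℝ w x) with hF
  set φ : EuclideanSpace ℝ (Fin 3) → ℝ := cylCutoff r (2 * r) with hφ
  set A : Set (EuclideanSpace ℝ (Fin 3)) := {x | r ≤ cylRadius x ∧ cylRadius x < 2 * r} with hAdef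
  set χ : EuclideanSpace ℝ (Fin 3) → ℝ := A.indicator fun _ => (1 : ℝ) with hχ
  set Iφ : ℝ := ∫ x in S, φ x * F x with hIφ
  set D : ℝ := ∫ x in S, χ x * F x with hD
  -- cut-off facts
  have hφc : Continuous φ := (contDiff_cylCutoff r (2 * r) (n := 0)).continuous
  have hφnn : ∀ x, 0 ≤ φ x := cylCutoff_nonneg r (2 * r)
  have hφone : ∀ x, cylRadius x ≤ r → φ x = 1 := fun x hx => cylCutoff_eq_one hr0.le hr2 hx
  have hφzero : ∀ x, 2 * r ≤ cylRadius x → φ x = 0 := fun x hx => cylCutoff_eq_zero hr0.le hr2 hx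
  have hAm : MeasurableSet A :=
    (isClosed_le continuous_const continuous_cylRadius).measurableSet.inter
      (isOpen_lt continuous_cylRadius continuous_const).measurableSet
  -- integrability
  have hIφ_int : IntegrableOn (fun x => φ x * F x) S volume :=
    integrableOn_zSlab_of_eq_zero_of_le_cylRadius (Q := fun x => φ x * F x) (hφc.mul hFc)
      (fun x hx => by show φ x * F x = 0; rw [hφzero x hx, zero_mul]) L 0
  have hF_int2 : IntegrableOn F (S ∩ {x | cylRadius x < 2 * r}) volume :=
    integrableOn_zSlab_inter_cyl_of_bound hL (by linarith) hFc (B := 3 * K₂ ^ 2) fun x => by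
      rw [Real.norm_of_nonneg (hF0 x)]; exact hF_bd x
  have hmeas : MeasurableSet (S ∩ {x : EuclideanSpace ℝ (Fin 3) | cylRadius x < r}) :=
    (measurableSet_zSlab L 0).inter (isOpen_lt continuous_cylRadius continuous_const).measurableSet
  have hsub : S ∩ {x | cylRadius x < r} ⊆ S ∩ {x | cylRadius x < 2 * r} :=
    fun x hx => ⟨hx.1, lt_trans hx.2 hr2⟩
  -- `E(r) ≤ Iφ`
  have hEr : E r ≤ Iφ := by
    rw [hE r]
    calc ∫ x in S ∩ {x | cylRadius x < r}, F x
        = ∫ x in S, (S ∩ {x | cylRadius x < r}).indicator F x := by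
          rw [setIntegral_indicator hmeas, Set.inter_eq_self_of_subset_right inter_subset_left]
      _ ≤ Iφ := by
          refine setIntegral_mono_on ((hF_int2.mono_set hsub).integrable_indicator hmeas |>.integrableOn)
            hIφ_int (measurableSet_zSlab L 0) fun x _ => ?_
          by_cases hx : x ∈ S ∩ {x | cylRadius x < r}
          · rw [Set.indicator_of_mem hx, hφone x (le_of_lt hx.2), one_mul]
          · rw [Set.indicator_of_notMem hx]; exact mul_nonneg (hφnn x) (hF0 x)
  -- `E(2r) − E(r) = D`
  have hED : E (2 * r) - E r = D := by
    rw [hE (2 * r), hE r, hD]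
    have hdiff : (S ∩ {x | cylRadius x < 2 * r}) \ (S ∩ {x | cylRadius x < r}) = S ∩ A := by
      ext x
      constructor
      · rintro ⟨⟨hxS, hx2⟩, hnot⟩
        refine ⟨hxS, ?_, hx2⟩
        by_contra hlt
        exact hnot ⟨hxS, not_le.1 hlt⟩
      · rintro ⟨hxS, h1, h2⟩
        exact ⟨⟨hxS, h2⟩, fun h => (not_lt.2 h1) h.2⟩
    rw [← setIntegral_sdiff hmeas hF_int2 hsub, hdiff, ← setIntegral_indicator hAm]
    refine setIntegral_congr_fun (measurableSet_zSlab L 0) fun x _ => ?_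
    by_cases hx : x ∈ A
    · simp [hχ, hx]
    · simp [hχ, hx]
  -- conclude
  have hν' : 0 ≤ ν - M * L / (2 * Real.pi) := sub_nonneg.2 hML
  calc (ν - M * L / (2 * Real.pi)) * E r ≤ (ν - M * L / (2 * Real.pi)) * Iφ :=
        mul_le_mul_of_nonneg_left hEr hν'
    _ ≤ C₀ * (3 * ν * (1 + κ) / 2 + 3 * M * κ / 2) * D / r + 16 * C₀ * K₃ ^ 2 * L * lam * r +
          C₀ * κ / 2 * D / (lam * r) := hA
    _ = _ := by rw [← hED]

/-! ### The elementary dyadic lemma -/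

/-- **The dyadic Saint-Venant lemma** (elementary real analysis). Let `E` be nondecreasing and
nonnegative on `[1, ∞)` with at most quadratic growth, `E(r) ≤ A r²`, and suppose that for all
`r ≥ 1` and all `λ > 0`
`ν E(r) ≤ γ (E(2r) − E(r))/r + a λ r + b (E(2r) − E(r))/(λ r)` with `ν > 0`, `γ, a, b ≥ 0`.
Then `E ≡ 0` on `[1, ∞)`. (Optimising `λ` gives `ν E(r) ≤ γ D/r + (a + b)√D`, `D = E(2r) − E(r)`;
if `E(r₀) > 0` then `D` is bounded below along the doubling sequence, so `E → ∞`, and once `E`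
and `r` are large each doubling multiplies `E` by at least `5 > 2²`, contradicting quadratic
growth.) This discrete form replaces the differential inequality `Z(R) ≤ C R^{1/2} Z'(R)^{1/2}`
of Bang–Gui–Wang–Xie, §5 Step 4 ("the same argument as that for the proof of Theorem 1.3").
[cite: BangGuiWangXie2025, Thm 1.4 (d), proof §5 (Poincaré inequality in the vertical period, localised energy identity, dyadic Saint-Venant estimate) (source of the ARGUMENT this module implements; this declaration is the cell’s own lemma or plumbing, NOT a printed statement)] -/
theorem saintVenant_dyadic {E : ℝ → ℝ} {ν γ a b A : ℝ} (hν : 0 < ν) (hγ : 0 ≤ γ) (ha : 0 ≤ a)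
    (hb : 0 ≤ b) (hmono : ∀ r s, 1 ≤ r → r ≤ s → E r ≤ E s) (h0 : ∀ r, 1 ≤ r → 0 ≤ E r)
    (hA : ∀ r, 1 ≤ r → E r ≤ A * r ^ 2)
    (h : ∀ r, 1 ≤ r → ∀ lam : ℝ, 0 < lam →
      ν * E r ≤ γ * (E (2 * r) - E r) / r + a * lam * r + b * (E (2 * r) - E r) / (lam * r)) :
    ∀ r, 1 ≤ r → E r = 0 := by
  -- abbreviations
  set γ₁ : ℝ := γ + 1 with hγ₁
  set K₁ : ℝ := a + b + 1 with hK₁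
  have hγ₁0 : 0 < γ₁ := by rw [hγ₁]; linarith
  have hK₁0 : 0 < K₁ := by rw [hK₁]; linarith
  have hD0 : ∀ r, 1 ≤ r → 0 ≤ E (2 * r) - E r := fun r hr =>
    sub_nonneg.2 (hmono r (2 * r) hr (by linarith))
  -- (★) the optimised inequality `ν E(r) ≤ γ₁ D / r + K₁ √D` for `r ≥ 1`
  have star : ∀ r, 1 ≤ r →
      ν * E r ≤ γ₁ * (E (2 * r) - E r) / r + K₁ * Real.sqrt (E (2 * r) - E r) := by
    intro r hr
    have hr0 : 0 < r := by linarith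
    set D := E (2 * r) - E r with hD
    have hDnn : 0 ≤ D := hD0 r hr
    rcases hDnn.eq_or_lt with hDz | hDpos
    · -- `D = 0`: `ν E(r) ≤ a λ r` for every `λ > 0`, hence `E(r) ≤ 0`
      have hE0 : ν * E r ≤ 0 := by
        by_contra hpos
        rw [not_le] at hpos
        have hε : 0 < ν * E r / (2 * (a + 1) * r) := by positivity
        have h1 := h r hr _ hε
        rw [← hD, ← hDz] at h1
        simp only [mul_zero, zero_div, zero_add, add_zero] at h1
        have h2 : a * (ν * E r / (2 * (a + 1) * r)) * r = ν * E r * (a / (2 * (a + 1))) := by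
          field_simp
        rw [h2] at h1
        have h3 : a / (2 * (a + 1)) < 1 := by
          rw [div_lt_one (by positivity)]; linarith
        nlinarith
      rw [← hDz]
      simpa using hE0
    · -- `D > 0`: take `λ = √D / r`
      have hsq : 0 < Real.sqrt D := Real.sqrt_pos.2 hDpos
      have hlam : 0 < Real.sqrt D / r := div_pos hsq hr0
      have h1 := h r hr _ hlam
      have hDD : Real.sqrt D * Real.sqrt D = D := Real.mul_self_sqrt hDnn
      have e1 : a * (Real.sqrt D / r) * r = a * Real.sqrt D := by field_simp
      have e2 : b * D / (Real.sqrt D / r * r) = b * Real.sqrt D := by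
        rw [div_mul_cancel₀ _ hr0.ne', mul_div_assoc, Real.div_sqrt]
      rw [← hD, e1, e2] at h1
      have e3 : γ * D / r ≤ γ₁ * D / r :=
        div_le_div_of_nonneg_right (by rw [hγ₁]; nlinarith) hr0.le
      have e4 : a * Real.sqrt D + b * Real.sqrt D ≤ K₁ * Real.sqrt D := by rw [hK₁]; nlinarith
      linarith
  -- Lemma A: a positive lower bound on `D` where `E ≥ η > 0`
  have lemA : ∀ η : ℝ, 0 < η → ∀ r, 1 ≤ r → η ≤ E r →
      min (ν * η / (2 * γ₁)) ((ν * η / (2 * K₁)) ^ 2) ≤ E (2 * r) - E r := by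
    intro η hη r hr hEr
    have hr0 : 0 < r := by linarith
    set D := E (2 * r) - E r with hD
    have hDnn : 0 ≤ D := hD0 r hr
    have hs := star r hr
    rw [← hD] at hs
    by_contra hlt
    rw [not_le, lt_min_iff] at hlt
    obtain ⟨h1, h2⟩ := hlt
    have h3 : Real.sqrt D < ν * η / (2 * K₁) := by
      rw [← Real.sqrt_sq (by positivity : 0 ≤ ν * η / (2 * K₁))]
      exact Real.sqrt_lt_sqrt hDnn h2
    have h4 : γ₁ * D / r ≤ γ₁ * D := div_le_self (by positivity) hr
    have h5 : γ₁ * D < ν * η / 2 := by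
      calc γ₁ * D < γ₁ * (ν * η / (2 * γ₁)) := mul_lt_mul_of_pos_left h1 hγ₁0
        _ = ν * η / 2 := by field_simp
    have h6 : K₁ * Real.sqrt D < ν * η / 2 := by
      calc K₁ * Real.sqrt D < K₁ * (ν * η / (2 * K₁)) := mul_lt_mul_of_pos_left h3 hK₁0
        _ = ν * η / 2 := by field_simp
    have h7 : ν * η ≤ ν * E r := mul_le_mul_of_nonneg_left hEr hν.le
    linarith
  -- Lemma B: once `E` and `r` are large, doubling multiplies `E` by at least `5`
  set r₁ : ℝ := max 1 (8 * γ₁ / ν) with hr₁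
  set e₁ : ℝ := 16 * K₁ ^ 2 / ν ^ 2 with he₁
  have he₁0 : 0 < e₁ := by positivity
  have hr₁1 : 1 ≤ r₁ := le_max_left _ _
  have lemB : ∀ r, r₁ ≤ r → e₁ ≤ E r → 5 * E r ≤ E (2 * r) := by
    intro r hr hEr
    have hr1 : 1 ≤ r := le_trans hr₁1 hr
    have hr8 : 8 * γ₁ / ν ≤ r := le_trans (le_max_right _ _) hr
    have hr0 : 0 < r := by linarith
    set D := E (2 * r) - E r with hD
    have hDnn : 0 ≤ D := hD0 r hr1
    have hEpos : 0 < E r := lt_of_lt_of_le he₁0 hEr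
    have hs := star r hr1
    rw [← hD] at hs
    suffices h4D : 4 * E r ≤ D by linarith
    by_contra hlt
    rw [not_le] at hlt
    -- the linear term: `γ₁ D / r < 4 γ₁ E / r ≤ ν E / 2`
    have h1 : γ₁ * D / r < ν * E r / 2 := by
      have h1a : γ₁ * D / r < γ₁ * (4 * E r) / r :=
        div_lt_div_of_pos_right (mul_lt_mul_of_pos_left hlt hγ₁0) hr0
      have h1b : γ₁ * (4 * E r) / r ≤ γ₁ * (4 * E r) / (8 * γ₁ / ν) :=
        div_le_div_of_nonneg_left (by positivity) (by positivity) hr8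
      have h1c : γ₁ * (4 * E r) / (8 * γ₁ / ν) = ν * E r / 2 := by
        field_simp; ring
      linarith
    -- the square-root term: `K₁ √D < 2 K₁ √E ≤ ν E / 2`
    have h2 : K₁ * Real.sqrt D < ν * E r / 2 := by
      have h2a : Real.sqrt D < 2 * Real.sqrt (E r) := by
        calc Real.sqrt D < Real.sqrt (4 * E r) := Real.sqrt_lt_sqrt hDnn hlt
          _ = 2 * Real.sqrt (E r) := by
            rw [Real.sqrt_mul (by norm_num), show Real.sqrt 4 = 2 by
              rw [show (4 : ℝ) = 2 ^ 2 by norm_num, Real.sqrt_sq (by norm_num)]]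
      have h2b : 4 * K₁ ≤ ν * Real.sqrt (E r) := by
        have : Real.sqrt e₁ ≤ Real.sqrt (E r) := Real.sqrt_le_sqrt hEr
        rw [he₁, show 16 * K₁ ^ 2 / ν ^ 2 = (4 * K₁ / ν) ^ 2 by ring,
          Real.sqrt_sq (by positivity)] at this
        calc 4 * K₁ = ν * (4 * K₁ / ν) := by field_simp
          _ ≤ ν * Real.sqrt (E r) := mul_le_mul_of_nonneg_left this hν.le
      have hsE : Real.sqrt (E r) * Real.sqrt (E r) = E r := Real.mul_self_sqrt hEpos.le
      have hsE0 : 0 < Real.sqrt (E r) := Real.sqrt_pos.2 hEpos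
      calc K₁ * Real.sqrt D < K₁ * (2 * Real.sqrt (E r)) := mul_lt_mul_of_pos_left h2a hK₁0
        _ = (4 * K₁) * Real.sqrt (E r) / 2 := by ring
        _ ≤ (ν * Real.sqrt (E r)) * Real.sqrt (E r) / 2 :=
            div_le_div_of_nonneg_right (mul_le_mul_of_nonneg_right h2b hsE0.le) (by norm_num)
        _ = ν * E r / 2 := by rw [mul_assoc, hsE]
    linarith
  -- Main argument, by contradiction
  intro r₀ hr₀
  by_contra hne
  have hη : 0 < E r₀ := lt_of_le_of_ne (h0 r₀ hr₀) (Ne.symm hne)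
  set η := E r₀ with hηdef
  set δ : ℝ := min (ν * η / (2 * γ₁)) ((ν * η / (2 * K₁)) ^ 2) with hδ
  have hδ0 : 0 < δ := lt_min (by positivity) (by positivity)
  set R : ℝ := max r₀ r₁ with hR
  have hR1 : 1 ≤ R := le_trans hr₀ (le_max_left _ _)
  have hRr₁ : r₁ ≤ R := le_max_right _ _
  have hR0 : 0 < R := by linarith
  -- `E` grows at least linearly along the doubling sequence
  have claim1 : ∀ n : ℕ, η + n * δ ≤ E (2 ^ n * R) := by
    intro n
    induction n with
    | zero =>
      simp only [Nat.cast_zero, zero_mul, add_zero, pow_zero, one_mul]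
      exact hmono r₀ R hr₀ (le_max_left _ _)
    | succ n ih =>
      have hn1 : 1 ≤ (2 : ℝ) ^ n * R := by
        have : (1 : ℝ) ≤ 2 ^ n := one_le_pow₀ (by norm_num)
        nlinarith
      have hηE : η ≤ E (2 ^ n * R) := le_trans (by
        have : (0 : ℝ) ≤ n * δ := by positivity
        linarith) ih
      have hA := lemA η hη _ hn1 hηE
      rw [← hδ] at hA
      have e : (2 : ℝ) ^ (n + 1) * R = 2 * (2 ^ n * R) := by ring
      rw [e]
      push_cast
      linarith
  -- reach the threshold `e₁`
  obtain ⟨n, hn⟩ := exists_nat_ge (e₁ / δ)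
  set R₁ : ℝ := 2 ^ n * R with hR₁
  have h2n : (1 : ℝ) ≤ 2 ^ n := one_le_pow₀ (by norm_num)
  have hR₁r₁ : r₁ ≤ R₁ := le_trans hRr₁ (by rw [hR₁]; nlinarith)
  have hR₁0 : 0 < R₁ := by rw [hR₁]; positivity
  have hE₁ : e₁ ≤ E R₁ := by
    have h1 : e₁ ≤ n * δ := by
      have := (div_le_iff₀ hδ0).1 hn
      linarith
    have := claim1 n
    linarith
  have hER₁0 : 0 < E R₁ := lt_of_lt_of_le he₁0 hE₁
  -- geometric growth with ratio `5`
  have claim2 : ∀ m : ℕ, 5 ^ m * E R₁ ≤ E (2 ^ m * R₁) := by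
    intro m
    induction m with
    | zero => simp
    | succ m ih =>
      have h5m : (1 : ℝ) ≤ 5 ^ m := one_le_pow₀ (by norm_num)
      have h2m : (1 : ℝ) ≤ 2 ^ m := one_le_pow₀ (by norm_num)
      have hrm : r₁ ≤ 2 ^ m * R₁ := le_trans hR₁r₁ (by nlinarith)
      have hEm : e₁ ≤ E (2 ^ m * R₁) := le_trans hE₁ (le_trans (by nlinarith) ih)
      have hB := lemB _ hrm hEm
      have e : (2 : ℝ) ^ (m + 1) * R₁ = 2 * (2 ^ m * R₁) := by ring
      rw [e, pow_succ]
      nlinarith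
  -- versus quadratic growth
  have hquad : ∀ m : ℕ, (5 / 4 : ℝ) ^ m ≤ A * R₁ ^ 2 / E R₁ := by
    intro m
    have h2m : (1 : ℝ) ≤ 2 ^ m := one_le_pow₀ (by norm_num)
    have hm1 : 1 ≤ 2 ^ m * R₁ := by nlinarith [le_trans hr₁1 hR₁r₁]
    have h1 := (claim2 m).trans (hA _ hm1)
    rw [le_div_iff₀ hER₁0, div_pow, div_mul_eq_mul_div, div_le_iff₀ (by positivity)]
    calc 5 ^ m * E R₁ ≤ A * (2 ^ m * R₁) ^ 2 := h1
      _ = A * R₁ ^ 2 * 4 ^ m := by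
        rw [mul_pow, ← pow_mul, show (2 : ℝ) ^ (m * 2) = 4 ^ m by
          rw [mul_comm, pow_mul]; norm_num]
        ring
  obtain ⟨m, hm⟩ := pow_unbounded_of_one_lt (A * R₁ ^ 2 / E R₁) (by norm_num : (1 : ℝ) < 5 / 4)
  exact absurd (hquad m) (not_le.2 hm)

end Literature.Analysis.SteadySlabLiouville.PeriodicSlab

end Part2

/-!
## Part 3 — port of `Summits/NavierStokesRegularity/NavierStokesRegularity/Theorems/ScenarioCensusPeriodicSlabRegularity.lean` (6 declarations kept)

# Census row S7 (bounded steady flows in the periodic slab, case (d)): derivative bounds for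
# bounded steady flows and the differentiated steady system

Support file for the scenario census of `NavierStokesRegularity` (cell `pub/ns-census`, row S7 =
Bang–Gui–Wang–Xie 2025, Thm 1.4 (d); tree FACT
`Literature.Analysis.FluidPDE.BangGuiWangXie2025_periodicSlab_liouville`, second conjunct). Two
inputs of the printed proof (arXiv:2205.13259, §5 Step 4) are supplied here BY NAME from landed
tree theorems:

* **"Lemma (bounded-gradient)"** — a bounded smooth steady Navier–Stokes flow on `ℝ³` has bounded
  derivatives of every order (`steady_exists_norm_iteratedFDeriv_le`): the constant-in-time field is
  a bounded continuous Oseen-mild ancient field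
  (`Literature.Analysis.FluidPDE.IsSteadyClassicalNS.eq_heatExtension_sub_oseenDuhamel`, KNSS 2009
  §4 (ii) / Lemma 3.1 for steady fields), to which the uniform window bound
  `Literature.Analysis.FluidPDE.exists_norm_iteratedFDeriv_le_of_bounded_oseenMild` (KNSS 2009,
  Prop. 4.1 / (4.10)) applies; general viscosity by the scaling
  `Literature.Analysis.FluidPDE.IsSteadyClassicalNS.smul`. Consequences packaged for the census
  proof: `steady_derivative_bounds` (`‖DU‖`, `‖D²U‖`, `‖∇P‖` bounded).
* **"Taking the `x₃`-derivative of the momentum equation"** (`(6-1)` of the source) — for a smooth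
  steady solution `(U, P)` and any direction `e`, the pair `w = DU(·)e`, `q = DP(·)e` is smooth,
  divergence free and solves the linearised system
  `ν Δw = (w·∇)U + (U·∇)w + ∇q` (`steady_differentiated_system`; Schwarz's theorem via the tree's
  `fderiv_fderiv_apply_comm_of_contDiff_two`, `fderiv_laplacian_apply_of_contDiff_three`).

No summit statement and no census row is proved in this file.

## References

* J. Bang, C. Gui, Y. Wang, C. Xie, J. Fluid Mech. 1005 (2025) A6 = arXiv:2205.13259, §5 Step 4
  (Lemma "bounded-gradient" and (6-1)). [BangGuiWangXie2025]
* G. Koch, N. Nadirashvili, G. Seregin, V. Šverák, Acta Math. 203 (2009) = arXiv:0709.3599, §4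
  (Prop. 4.1, (4.10)). [KochNadirashviliSereginSverak2009]
-/

section Part3

open _root_.MeasureTheory _root_.Set _root_.Function _root_.Filter _root_.InnerProductSpace
open scoped _root_.Topology _root_.ENNReal _root_.NNReal RealInnerProductSpace Laplacian _root_.ContDiff

namespace Literature.Analysis.SteadySlabLiouville.PeriodicSlab

open Literature.Analysis Literature.Analysis.FluidPDE

/-! ### From the profile structure to the steady classical structure -/

/-- A smooth Leray profile at rate `a = 0` is a steady classical Navier–Stokes solution (the two
tree vocabularies `IsLerayProfile ν 0` / `IsSteadyClassicalNS ν 0` agree field by field; converse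
of `Literature.Analysis.FluidPDE.IsSteadyClassicalNS.isLerayProfile_zero`).
[cite: BangGuiWangXie2025, Thm 1.4 (d), proof §5 (Poincaré inequality in the vertical period, localised energy identity, dyadic Saint-Venant estimate) (source of the ARGUMENT this module implements; this declaration is the cell’s own lemma or plumbing, NOT a printed statement)] -/
theorem isSteadyClassicalNS_of_isLerayProfile {ν : ℝ}
    {U : EuclideanSpace ℝ (Fin 3) → EuclideanSpace ℝ (Fin 3)} {P : EuclideanSpace ℝ (Fin 3) → ℝ}
    (h : IsLerayProfile ν 0 U P) (hU : ContDiff ℝ (⊤ : ℕ∞) U) (hP : ContDiff ℝ (⊤ : ℕ∞) P) :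
    IsSteadyClassicalNS ν 0 U P where
  smooth_velocity := hU
  smooth_pressure := hP
  momentum x := by
    have h1 := h.profile_eq x
    simp only [zero_smul, add_zero] at h1
    rw [Pi.zero_apply, add_zero]
    -- `h1 : -(ν • Δ U x) + convect U U x + gradient P x = 0`
    have : convect U U x = ν • (Δ U) x - gradient P x := by
      rw [eq_sub_iff_add_eq]
      have h2 := congrArg (fun z => z + ν • (Δ U) x) h1
      simp only [zero_add] at h2
      rw [← h2]; abel
    exact this
  divFree := h.divFree

/-! ### Bounded steady flows have bounded derivatives of all orders -/

/-- A bounded steady classical flow at unit viscosity, viewed as the constant family `t ↦ W`, is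
a continuous Oseen-mild ancient field on `(A, 0)` for every `A`:
`W = e^{(t−s)Δ}W − B¹ₛ(W, W)(t)` for `A < s < t < 0` (tree:
`IsSteadyClassicalNS.eq_heatExtension_sub_oseenDuhamel` with `τ = t − s`, and the time translation
`oseenDuhamel_translate`).
[cite: BangGuiWangXie2025, Thm 1.4 (d), proof §5 (Poincaré inequality in the vertical period, localised energy identity, dyadic Saint-Venant estimate) (source of the ARGUMENT this module implements; this declaration is the cell’s own lemma or plumbing, NOT a printed statement)] -/
theorem steady_oseenMild_identity
    {W : EuclideanSpace ℝ (Fin 3) → EuclideanSpace ℝ (Fin 3)} {P : EuclideanSpace ℝ (Fin 3) → ℝ}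
    (h : IsSteadyClassicalNS 1 0 W P) {M : ℝ} (hM : ∀ x, ‖W x‖ ≤ M) (s t : ℝ) (hst : s < t)
    (x : EuclideanSpace ℝ (Fin 3)) :
    W x = UnboundedOperators.heatExtension W (t - s) x -
      oseenDuhamel 1 s (fun _ : ℝ => W) (fun _ : ℝ => W) t x := by
  rw [h.eq_heatExtension_sub_oseenDuhamel hM (sub_pos.2 hst) x]
  have h2 := oseenDuhamel_translate 1 0 s (fun _ : ℝ => W) (fun _ : ℝ => W) (t - s) x
  simp only [zero_add, sub_add_cancel] at h2
  rw [h2]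

/-- **Bounded steady flows have bounded derivatives of all orders** (unit viscosity): for a
steady classical solution `(W, P)` of unforced Navier–Stokes on `ℝ³` with `‖W‖ ≤ M` and every
`k`, `sup_x ‖DᵏW(x)‖ < ∞` (KNSS 2009, (4.10), through the tree's uniform window bound for bounded
Oseen-mild fields, applied to the constant-in-time field on the window `[−3/2, −1) ⊂ (−2, −1)`).
[cite: BangGuiWangXie2025, Thm 1.4 (d), proof §5 (Poincaré inequality in the vertical period, localised energy identity, dyadic Saint-Venant estimate) (source of the ARGUMENT this module implements; this declaration is the cell’s own lemma or plumbing, NOT a printed statement)] -/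
theorem steady_exists_norm_iteratedFDeriv_le_one
    {W : EuclideanSpace ℝ (Fin 3) → EuclideanSpace ℝ (Fin 3)} {P : EuclideanSpace ℝ (Fin 3) → ℝ}
    (h : IsSteadyClassicalNS 1 0 W P) {M : ℝ} (hM : ∀ x, ‖W x‖ ≤ M) (k : ℕ) :
    ∃ K : ℝ, ∀ x, ‖iteratedFDeriv ℝ k W x‖ ≤ K := by
  obtain ⟨K, hK⟩ := exists_norm_iteratedFDeriv_le_of_bounded_oseenMild M k (ℓ := 1) (δ := 2⁻¹)
    one_pos (by norm_num)
  refine ⟨K, fun x => ?_⟩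
  have hWc : Continuous W := h.smooth_velocity.continuous
  have h1 := hK (A := -3) (a := -2) (u := fun _ : ℝ => W) (by norm_num) (by norm_num)
    ((hWc.comp continuous_snd).continuousOn)
    (fun t _ => VectorCalculus.IsDivFree.isWeaklyDivFree_holds h.divFree
      (contDiff_infty.1 h.smooth_velocity 1))
    (fun s t _ hst _ y => steady_oseenMild_identity h hM s t hst y)
    (fun t _ y => hM y) (-3 / 2) ⟨by norm_num, by norm_num⟩ x
  exact h1

/-- **Bounded steady flows have bounded derivatives of all orders**, any viscosity `ν > 0`
(scaling `(W, P) ↦ (ν⁻¹W, ν⁻²P)` to unit viscosity, `IsSteadyClassicalNS.smul`).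
[cite: BangGuiWangXie2025, Thm 1.4 (d), proof §5 (Poincaré inequality in the vertical period, localised energy identity, dyadic Saint-Venant estimate) (source of the ARGUMENT this module implements; this declaration is the cell’s own lemma or plumbing, NOT a printed statement)] -/
theorem steady_exists_norm_iteratedFDeriv_le {ν : ℝ} (hν : 0 < ν)
    {W : EuclideanSpace ℝ (Fin 3) → EuclideanSpace ℝ (Fin 3)} {P : EuclideanSpace ℝ (Fin 3) → ℝ}
    (h : IsSteadyClassicalNS ν 0 W P) {M : ℝ} (hM : ∀ x, ‖W x‖ ≤ M) (k : ℕ) :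
    ∃ K : ℝ, ∀ x, ‖iteratedFDeriv ℝ k W x‖ ≤ K := by
  have h1 : IsSteadyClassicalNS 1 0 (ν⁻¹ • W) (ν⁻¹ ^ 2 • P) := by
    simpa [inv_mul_cancel₀ hν.ne'] using h.smul ν⁻¹
  have hb : ∀ x, ‖(ν⁻¹ • W) x‖ ≤ |ν⁻¹| * M := fun x => by
    rw [Pi.smul_apply, norm_smul, Real.norm_eq_abs]
    exact mul_le_mul_of_nonneg_left (hM x) (abs_nonneg _)
  obtain ⟨K, hK⟩ := steady_exists_norm_iteratedFDeriv_le_one h1 hb k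
  refine ⟨ν * K, fun x => ?_⟩
  have hW : W = ν • (ν⁻¹ • W) := by rw [smul_smul, mul_inv_cancel₀ hν.ne', one_smul]
  have hsm : ContDiff ℝ k (ν⁻¹ • W) := contDiff_infty.1 h1.smooth_velocity k
  have e : iteratedFDeriv ℝ k W x = ν • iteratedFDeriv ℝ k (ν⁻¹ • W) x := by
    conv_lhs => rw [hW]
    exact iteratedFDeriv_const_smul_apply hsm.contDiffAt
  rw [e, norm_smul, Real.norm_of_nonneg hν.le]
  exact mul_le_mul_of_nonneg_left (hK x) hν.le

/-! ### Pointwise consequences: `DU`, `D²U`, `ΔU`, `∇P` -/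

/-- **Derivative bounds for a bounded smooth steady flow** (`ν > 0`): there are constants with
`‖DU(x)‖ ≤ K₁`, `‖D²U(x)‖ ≤ K₂` and `‖∇P(x)‖ ≤ K₃` for all `x` (the pressure gradient through
the momentum equation `∇P = νΔU − (U·∇)U`).
[cite: BangGuiWangXie2025, Thm 1.4 (d), proof §5 (Poincaré inequality in the vertical period, localised energy identity, dyadic Saint-Venant estimate) (source of the ARGUMENT this module implements; this declaration is the cell’s own lemma or plumbing, NOT a printed statement)] -/
theorem steady_derivative_bounds {ν : ℝ} (hν : 0 < ν)
    {U : EuclideanSpace ℝ (Fin 3) → EuclideanSpace ℝ (Fin 3)} {P : EuclideanSpace ℝ (Fin 3) → ℝ}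
    (h : IsSteadyClassicalNS ν 0 U P) {M : ℝ} (hM : ∀ x, ‖U x‖ ≤ M) :
    ∃ K₁ K₂ K₃ : ℝ, 0 ≤ K₁ ∧ 0 ≤ K₂ ∧ 0 ≤ K₃ ∧ ∀ x,
      ‖fderiv ℝ U x‖ ≤ K₁ ∧ ‖iteratedFDeriv ℝ 2 U x‖ ≤ K₂ ∧ ‖gradient P x‖ ≤ K₃ := by
  obtain ⟨K₁, hK₁⟩ := steady_exists_norm_iteratedFDeriv_le hν h hM 1
  obtain ⟨K₂, hK₂⟩ := steady_exists_norm_iteratedFDeriv_le hν h hM 2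
  have hK₁0 : 0 ≤ K₁ := (norm_nonneg _).trans (hK₁ 0)
  have hK₂0 : 0 ≤ K₂ := (norm_nonneg _).trans (hK₂ 0)
  have hM0 : 0 ≤ M := (norm_nonneg _).trans (hM 0)
  -- `‖ΔU(x)‖ ≤ 3 ‖D²U(x)‖` (the Laplacian as a trace over an orthonormal frame; cf. the tree's
  -- `norm_laplacian_le_three_mul_iteratedFDeriv`, not imported to keep the closure small)
  have hlap : ∀ x, ‖(Δ U) x‖ ≤ 3 * K₂ := fun x => by
    set b := stdOrthonormalBasis ℝ (EuclideanSpace ℝ (Fin 3)) with hb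
    rw [InnerProductSpace.laplacian_eq_iteratedFDeriv_orthonormalBasis U b]
    calc ‖∑ i, iteratedFDeriv ℝ 2 U x ![b i, b i]‖ ≤ ∑ i, ‖iteratedFDeriv ℝ 2 U x ![b i, b i]‖ :=
          norm_sum_le _ _
      _ ≤ ∑ _i : Fin (Module.finrank ℝ (EuclideanSpace ℝ (Fin 3))), K₂ :=
          Finset.sum_le_sum fun i _ => by
            refine (ContinuousMultilinearMap.le_opNorm _ _).trans ?_
            rw [Fin.prod_univ_two]
            simp only [Matrix.cons_val_zero, Matrix.cons_val_one, b.orthonormal.1 i, mul_one]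
            exact hK₂ x
      _ = 3 * K₂ := by simp [Finset.sum_const, Finset.card_univ, finrank_euclideanSpace]
  have hD : ∀ x, ‖fderiv ℝ U x‖ ≤ K₁ := fun x => by
    rw [← norm_iteratedFDeriv_zero (𝕜 := ℝ) (f := fderiv ℝ U), norm_iteratedFDeriv_fderiv]
    exact hK₁ x
  refine ⟨K₁, K₂, ν * (3 * K₂) + K₁ * M, hK₁0, hK₂0, by positivity, fun x => ⟨hD x, hK₂ x, ?_⟩⟩
  have hm := h.momentum x
  rw [Pi.zero_apply, add_zero] at hm
  have hgrad : gradient P x = ν • (Δ U) x - convect U U x := by rw [hm]; abel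
  rw [hgrad]
  refine (norm_sub_le _ _).trans (add_le_add ?_ ?_)
  · rw [norm_smul, Real.norm_of_nonneg hν.le]
    exact mul_le_mul_of_nonneg_left (hlap x) hν.le
  · rw [convect_apply]
    exact (ContinuousLinearMap.le_opNorm _ _).trans (mul_le_mul (hD x) (hM x) (norm_nonneg _) hK₁0)

/-! ### The differentiated steady system -/

/-- **The differentiated steady system.** Let `(U, P)` be a steady classical solution of unforced
Navier–Stokes with viscosity `ν` on `ℝ³` and let `e` be a fixed vector. Then the directional
derivatives `w = DU(·)e`, `q = DP(·)e` are smooth, `w` is divergence free, and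
`ν Δw = (w·∇)U + (U·∇)w + ∇q` pointwise (differentiate `(U·∇)U = νΔU − ∇P` along `e`; all mixed
partials commute by Schwarz's theorem). This is equation (6-1) of Bang–Gui–Wang–Xie, §5 Step 4,
for `e = e₃`.
[cite: BangGuiWangXie2025, Thm 1.4 (d), proof §5 (Poincaré inequality in the vertical period, localised energy identity, dyadic Saint-Venant estimate) (source of the ARGUMENT this module implements; this declaration is the cell’s own lemma or plumbing, NOT a printed statement)] -/
theorem steady_differentiated_system {ν : ℝ}
    {U : EuclideanSpace ℝ (Fin 3) → EuclideanSpace ℝ (Fin 3)} {P : EuclideanSpace ℝ (Fin 3) → ℝ}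
    (h : IsSteadyClassicalNS ν 0 U P) (e : EuclideanSpace ℝ (Fin 3)) :
    ContDiff ℝ (⊤ : ℕ∞) (fun y => fderiv ℝ U y e) ∧ ContDiff ℝ (⊤ : ℕ∞) (fun y => fderiv ℝ P y e) ∧
      VectorCalculus.IsDivFree (fun y => fderiv ℝ U y e) ∧
      ∀ x, ν • (Δ (fun y => fderiv ℝ U y e)) x =
        convect (fun y => fderiv ℝ U y e) U x + convect U (fun y => fderiv ℝ U y e) x +
          gradient (fun y => fderiv ℝ P y e) x := by
  set w : EuclideanSpace ℝ (Fin 3) → EuclideanSpace ℝ (Fin 3) := fun y => fderiv ℝ U y e with hw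
  set q : EuclideanSpace ℝ (Fin 3) → ℝ := fun y => fderiv ℝ P y e with hq
  set b := EuclideanSpace.basisFun (Fin 3) ℝ with hb
  have hU : ContDiff ℝ ∞ U := h.smooth_velocity
  have hP : ContDiff ℝ ∞ P := h.smooth_pressure
  have hU2 : ContDiff ℝ 2 U := contDiff_infty.1 hU 2
  have hU3 : ContDiff ℝ 3 U := contDiff_infty.1 hU 3
  have hP2 : ContDiff ℝ 2 P := contDiff_infty.1 hP 2
  have hwS : ContDiff ℝ ∞ w := (hU.fderiv_right (m := ∞) le_rfl).clm_apply contDiff_const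
  have hqS : ContDiff ℝ ∞ q := (hP.fderiv_right (m := ∞) le_rfl).clm_apply contDiff_const
  have hUd : ∀ x, DifferentiableAt ℝ U x := fun x => (hU.differentiable (by simp)) x
  have hDUd : ∀ x, DifferentiableAt ℝ (fderiv ℝ U) x := fun x =>
    ((hU2.fderiv_right (m := 1) le_rfl).differentiable one_ne_zero) x
  have hpart : ∀ a : EuclideanSpace ℝ (Fin 3), ContDiff ℝ ∞ (fun y => fderiv ℝ U y a) := fun a =>
    (hU.fderiv_right (m := ∞) le_rfl).clm_apply contDiff_const
  have hpartd : ∀ (a x : EuclideanSpace ℝ (Fin 3)), DifferentiableAt ℝ (fun y => fderiv ℝ U y a) x :=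
    fun a x => ((hpart a).differentiable (by simp)) x
  -- Schwarz
  have hsymmU : ∀ (x v₁ v₂ : EuclideanSpace ℝ (Fin 3)),
      fderiv ℝ (fderiv ℝ U) x v₁ v₂ = fderiv ℝ (fderiv ℝ U) x v₂ v₁ := fun x v₁ v₂ =>
    (hU2.contDiffAt.isSymmSndFDerivAt (by simp)) v₁ v₂
  refine ⟨hwS, hqS, ?_, ?_⟩
  · -- `div w = 0`
    intro x
    have hdivU : (fun y => VectorCalculus.divergence U y) = fun _ => (0 : ℝ) := funext h.divFree
    have e1 : VectorCalculus.divergence w x = ∑ i, ⟪b i, fderiv ℝ (fun y => fderiv ℝ U y (b i)) x e⟫ := by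
      rw [divergence_eq_sum_inner_fderiv b w x]
      refine Finset.sum_congr rfl fun i _ => ?_
      rw [hw, fderiv_fderiv_apply_comm_of_contDiff_two hU2 x e (b i)]
    have e2 : fderiv ℝ (fun y => VectorCalculus.divergence U y) x e =
        ∑ i, ⟪b i, fderiv ℝ (fun y => fderiv ℝ U y (b i)) x e⟫ := by
      have hfun : (fun y => VectorCalculus.divergence U y) =
          fun y => ∑ i, ⟪b i, fderiv ℝ U y (b i)⟫ := funext fun y => divergence_eq_sum_inner_fderiv b U y
      have hterm : ∀ i, DifferentiableAt ℝ (fun y => ⟪b i, fderiv ℝ U y (b i)⟫) x := fun i =>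
        (differentiableAt_const _).inner ℝ (hpartd (b i) x)
      rw [hfun, fderiv_fun_sum fun i _ => hterm i, FunLike.coe_sum, Finset.sum_apply]
      refine Finset.sum_congr rfl fun i _ => ?_
      rw [fderiv_inner_apply ℝ (differentiableAt_const _) (hpartd (b i) x)]
      simp
    rw [e1, ← e2, hdivU]
    simp
  · -- the momentum equation differentiated along `e`
    intro x
    -- the three maps and their derivatives along `e`
    have hm : ∀ y, convect U U y = ν • (Δ U) y - gradient P y := fun y => by
      have := h.momentum y; rwa [Pi.zero_apply, add_zero] at this
    -- (1) convection: `D[(U·∇)U](x) e = (w·∇)U + D²U(x)(e)(U x)`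
    have hconv : fderiv ℝ (fun y => convect U U y) x e =
        convect w U x + fderiv ℝ (fderiv ℝ U) x e (U x) := by
      have : (fun y => convect U U y) = fun y => (fderiv ℝ U y) (U y) := funext fun y => convect_apply U U y
      rw [this, fderiv_clm_apply (hDUd x) (hUd x)]
      simp [convect_apply, hw]
    have hconv' : fderiv ℝ (fderiv ℝ U) x e (U x) = convect U w x := by
      rw [convect_apply, hw, fderiv_apply_const_apply (hDUd x) e (U x), hsymmU]
    -- (2) Laplacian: `D[ΔU](x) e = Δw(x)`
    have hΔfun : (Δ U) = fun y => ∑ i, fderiv ℝ (fun z => fderiv ℝ U z (b i)) y (b i) :=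
      funext fun y => laplacian_eq_sum_fderiv_fderiv b hU2 y
    have hΔd : DifferentiableAt ℝ (Δ U) x := by
      rw [hΔfun]
      refine DifferentiableAt.fun_sum fun i _ => ?_
      exact ((((hpart (b i)).fderiv_right (m := ∞) le_rfl).clm_apply contDiff_const).differentiable
        (by simp)) x
    have hlap : fderiv ℝ (Δ U) x e = (Δ w) x := fderiv_laplacian_apply_of_contDiff_three hU3 x e
    -- (3) pressure: `⟪D[∇P](x) e, v⟫ = ⟪∇q(x), v⟫` through the scalar `y ↦ DP(y) v`
    have hgradfun : (fun y => gradient P y) = fun y => ν • (Δ U) y - convect U U y :=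
      funext fun y => by rw [hm y]; abel
    have hconvd : DifferentiableAt ℝ (fun y => convect U U y) x := by
      have : (fun y => convect U U y) = fun y => (fderiv ℝ U y) (U y) := funext fun y => convect_apply U U y
      rw [this]; exact (hDUd x).clm_apply (hUd x)
    have hgradd : DifferentiableAt ℝ (fun y => gradient P y) x := by
      have hsd : DifferentiableAt ℝ (fun y => ν • (Δ U) y) x := hΔd.const_smul ν
      rw [hgradfun]; exact hsd.sub hconvd
    have hpress : ∀ v : EuclideanSpace ℝ (Fin 3),
        ⟪fderiv ℝ (fun y => gradient P y) x e, v⟫ = ⟪gradient q x, v⟫ := by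
      intro v
      -- `⟪∇P y, v⟫ = DP(y) v`
      have hs : (fun y => ⟪gradient P y, v⟫) = fun y => fderiv ℝ P y v := funext fun y => by
        rw [gradient, InnerProductSpace.toDual_symm_apply]
      have h1 : fderiv ℝ (fun y => ⟪gradient P y, v⟫) x e = ⟪fderiv ℝ (fun y => gradient P y) x e, v⟫ := by
        rw [fderiv_inner_apply ℝ hgradd (differentiableAt_const v)]
        simp
      have h2 : fderiv ℝ (fun y => fderiv ℝ P y v) x e = fderiv ℝ q x v := by
        rw [hq]
        exact fderiv_fderiv_apply_comm_of_contDiff_two hP2 x v e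
      rw [← h1, hs, h2, gradient, InnerProductSpace.toDual_symm_apply]
    -- assemble: differentiate `convect U U = ν • ΔU − ∇P` along `e` and test against `v`
    have hderiv : fderiv ℝ (fun y => convect U U y) x e =
        ν • fderiv ℝ (Δ U) x e - fderiv ℝ (fun y => gradient P y) x e := by
      have hfun : (fun y => convect U U y) = fun y => ν • (Δ U) y - gradient P y := funext hm
      have hsd : DifferentiableAt ℝ (fun y => ν • (Δ U) y) x := hΔd.const_smul ν
      rw [hfun, fderiv_fun_sub hsd hgradd, fderiv_fun_const_smul hΔd]
      rfl
    refine ext_inner_right ℝ fun v => ?_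
    have key := congrArg (fun z => ⟪z, v⟫) hderiv
    simp only [inner_sub_left, inner_add_left] at key ⊢
    rw [hconv, inner_add_left, hconv', hlap, inner_smul_left, hpress] at key
    simp only [RCLike.conj_to_real] at key
    rw [inner_smul_left]
    simp only [RCLike.conj_to_real]
    linarith

end Literature.Analysis.SteadySlabLiouville.PeriodicSlab

end Part3

/-!
## Part 4 — port of `Summits/NavierStokesRegularity/NavierStokesRegularity/Theorems/ScenarioCensusPeriodicSlabLiouville.lean` (4 declarations kept)

# Census row S7 (bounded steady flows in the periodic slab, case (d)): the Liouville theorem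

Support file for the scenario census of `NavierStokesRegularity` (cell `pub/ns-census`, row S7).
**Theorem** (Bang–Gui–Wang–Xie, J. Fluid Mech. 1005 (2025) A6 = arXiv:2205.13259, Thm 1.4 (d);
the second conjunct of the tree FACT
`Literature.Analysis.FluidPDE.BangGuiWangXie2025_periodicSlab_liouville`, verbatim under its
hypotheses): a smooth steady Navier–Stokes flow `(U, P)` on `ℝ³` with viscosity `ν > 0`
(`IsLerayProfile ν 0 U P`, `U, P ∈ C^∞`), axially `L`-periodic and bounded with
`sup ‖U‖ < 2πν/L`, is constant (`periodicSlab_liouville_small`). NO symmetry is assumed.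

Proof (the printed §5 Step 4, assembled from the sibling files): by `…Regularity`, all derivatives
of `U` and `∇P` are bounded and `w = ∂₃U`, `q = ∂₃P` solve the linearised system; by
`…Estimate`, the period energy `E(r) = ∫_{zSlab L 0 ∩ {ρ<r}} |Dw|²` satisfies the dyadic
inequality with `ν − M L/(2π) > 0` (sharp Wirtinger constant), hence `E ≡ 0`
(`saintVenant_dyadic`); so `Dw ≡ 0` (continuity + periodicity), `w` is constant, and the constant
is `0` because `∫₀ᴸ ∂₃U = U(x + L e₃) − U(x) = 0`; thus `U` is invariant under axial translations
(`2½`-dimensional) and, being a bounded steady flow, a bounded ancient mild solution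
(`steady_oseenMild_identity`), so it is constant by the tree's `2½`D Liouville theorem
`Literature.Analysis.FluidPDE.apply_eq_apply_zero_of_invariant_along` (KNSS 2009, Thm 5.1 road)
— exactly as the printed proof ends with "[KNSS]".

No summit statement is proved in this file; the census value of row S7 is the lead's call.

## References

* J. Bang, C. Gui, Y. Wang, C. Xie, J. Fluid Mech. 1005 (2025) A6 = arXiv:2205.13259, Thm 1.4 (d),
  proof §5 Step 4. [BangGuiWangXie2025]
* G. Koch, N. Nadirashvili, G. Seregin, V. Šverák, Acta Math. 203 (2009) = arXiv:0709.3599,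
  Thm 5.1 and §4. [KochNadirashviliSereginSverak2009]
-/

section Part4

open _root_.MeasureTheory _root_.Set _root_.Function _root_.Filter _root_.InnerProductSpace
open scoped _root_.Topology _root_.ENNReal _root_.NNReal RealInnerProductSpace Laplacian _root_.ContDiff

namespace Literature.Analysis.SteadySlabLiouville.PeriodicSlab

open Literature.Analysis Literature.Analysis.FluidPDE

/-! ### Periodicity and bounds of the differentiated pressure -/

/-- Iterated derivatives of an axially periodic function are axially periodic.
[cite: BangGuiWangXie2025, Thm 1.4 (d), proof §5 (Poincaré inequality in the vertical period, localised energy identity, dyadic Saint-Venant estimate) (source of the ARGUMENT this module implements; this declaration is the cell’s own lemma or plumbing, NOT a printed statement)] -/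
theorem isAxiallyPeriodic_iteratedFDeriv {F : Type*} [NormedAddCommGroup F] [NormedSpace ℝ F]
    {L : ℝ} {V : EuclideanSpace ℝ (Fin 3) → F} (hper : IsAxiallyPeriodic L V) (n : ℕ) :
    IsAxiallyPeriodic L (iteratedFDeriv ℝ n V) := by
  intro x
  have hfun : (fun y => V (y + L • EuclideanSpace.single 2 (1 : ℝ))) = V := funext fun y => hper y
  have h := iteratedFDeriv_comp_add_right (𝕜 := ℝ) (f := V) n (L • EuclideanSpace.single 2 (1 : ℝ)) x
  rw [hfun] at h
  exact h.symm

/-- For a steady classical flow with axially periodic velocity: the pressure GRADIENT is axially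
periodic (`∇P = νΔU − (U·∇)U`; the pressure itself need not be), hence so is `q = ∂₃P`, and
`|∂₃P| ≤ ‖∇P‖`.
[cite: BangGuiWangXie2025, Thm 1.4 (d), proof §5 (Poincaré inequality in the vertical period, localised energy identity, dyadic Saint-Venant estimate) (source of the ARGUMENT this module implements; this declaration is the cell’s own lemma or plumbing, NOT a printed statement)] -/
theorem steady_pressure_partial {ν L : ℝ}
    {U : EuclideanSpace ℝ (Fin 3) → EuclideanSpace ℝ (Fin 3)} {P : EuclideanSpace ℝ (Fin 3) → ℝ}
    (h : IsSteadyClassicalNS ν 0 U P) (hper : IsAxiallyPeriodic L U) :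
    IsAxiallyPeriodic L (fun y => fderiv ℝ P y eZ) ∧
      ∀ x, |fderiv ℝ P x eZ| ≤ ‖gradient P x‖ := by
  set b := stdOrthonormalBasis ℝ (EuclideanSpace ℝ (Fin 3)) with hb
  have hgrad : ∀ y, gradient P y = ν • (Δ U) y - convect U U y := fun y => by
    have hm := h.momentum y
    rw [Pi.zero_apply, add_zero] at hm
    rw [hm]; abel
  have hq : ∀ y, fderiv ℝ P y eZ = ⟪gradient P y, eZ⟫ := fun y => by
    rw [gradient, InnerProductSpace.toDual_symm_apply]
  have hΔper : IsAxiallyPeriodic L (Δ U) := fun x => by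
    rw [InnerProductSpace.laplacian_eq_iteratedFDeriv_orthonormalBasis U b]
    simp only [isAxiallyPeriodic_iteratedFDeriv hper 2 x]
  have hconvper : ∀ x, convect U U (x + L • EuclideanSpace.single 2 (1 : ℝ)) = convect U U x :=
    fun x => by simp only [convect_apply, isAxiallyPeriodic_fderiv hper x, hper x]
  refine ⟨fun x => ?_, fun x => ?_⟩
  · simp only [hq, hgrad]
    rw [hΔper x, hconvper x]
  · rw [hq, ← Real.norm_eq_abs]
    have heZ : ‖(eZ : EuclideanSpace ℝ (Fin 3))‖ = 1 := by simp [eZ]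
    calc ‖⟪gradient P x, eZ⟫‖ ≤ ‖gradient P x‖ * ‖(eZ : EuclideanSpace ℝ (Fin 3))‖ := norm_inner_le_norm _ _
      _ = ‖gradient P x‖ := by rw [heZ, mul_one]

/-! ### From vanishing period energies to a vanishing derivative -/

/-- A nonnegative continuous axially `L`-periodic function whose integrals over the period pieces
`zSlab L 0 ∩ {ρ < r}` vanish for all `r ≥ 1` vanishes identically.
[cite: BangGuiWangXie2025, Thm 1.4 (d), proof §5 (Poincaré inequality in the vertical period, localised energy identity, dyadic Saint-Venant estimate) (source of the ARGUMENT this module implements; this declaration is the cell’s own lemma or plumbing, NOT a printed statement)] -/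
theorem eq_zero_of_setIntegral_zSlab_eq_zero {L : ℝ} (hL : 0 < L) {F : EuclideanSpace ℝ (Fin 3) → ℝ}
    (hFc : Continuous F) (hF0 : ∀ x, 0 ≤ F x) (hFper : IsAxiallyPeriodic L F) {B : ℝ}
    (hFB : ∀ x, ‖F x‖ ≤ B)
    (hint : ∀ r, 1 ≤ r → ∫ x in zSlab L 0 ∩ {x | cylRadius x < r}, F x = 0) :
    ∀ x, F x = 0 := by
  -- (1) `F = 0` on the open period pieces `{0 < x₂ < L} ∩ {ρ < r}`
  have hopen : ∀ r, 1 ≤ r → ∀ x : EuclideanSpace ℝ (Fin 3), 0 < x 2 → x 2 < L → cylRadius x < r →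
      F x = 0 := by
    intro r hr x h0 h1 hxr
    set O : Set (EuclideanSpace ℝ (Fin 3)) := {y | 0 < y 2 ∧ y 2 < L} ∩ {y | cylRadius y < r} with hO
    have hOopen : IsOpen O := by
      have h2c : Continuous fun y : EuclideanSpace ℝ (Fin 3) => y 2 :=
        (EuclideanSpace.proj (2 : Fin 3) : EuclideanSpace ℝ (Fin 3) →L[ℝ] ℝ).continuous
      exact ((isOpen_lt continuous_const h2c).inter (isOpen_lt h2c continuous_const)).inter
        (isOpen_lt continuous_cylRadius continuous_const)
    have hOsub : O ⊆ zSlab L 0 ∩ {y | cylRadius y < r} := fun y hy => by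
      refine ⟨?_, hy.2⟩
      rw [mem_zSlab]; simp only [Int.cast_zero, zero_mul, zero_add, one_mul]
      exact ⟨hy.1.1.le, hy.1.2⟩
    have hI : IntegrableOn F (zSlab L 0 ∩ {y | cylRadius y < r}) volume :=
      integrableOn_zSlab_inter_cyl_of_bound hL (by linarith) hFc hFB
    have hae : F =ᵐ[volume.restrict (zSlab L 0 ∩ {y | cylRadius y < r})] 0 :=
      (setIntegral_eq_zero_iff_of_nonneg_ae (Eventually.of_forall hF0) hI).1 (hint r hr)
    have haeO : F =ᵐ[volume.restrict O] 0 := ae_restrict_of_ae_restrict_of_subset hOsub hae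
    have hEq : EqOn F 0 O :=
      Measure.eqOn_open_of_ae_eq haeO hOopen hFc.continuousOn continuousOn_const
    exact hEq ⟨⟨h0, h1⟩, hxr⟩
  -- (2) points with `x₂ = 0` by continuity
  have hbdry : ∀ x : EuclideanSpace ℝ (Fin 3), x 2 = 0 → F x = 0 := by
    intro x hx2
    set r : ℝ := cylRadius x + 1 with hr
    have hr1 : 1 ≤ r := by have := cylRadius_nonneg x; linarith
    -- the sequence `x + (L/(n+2)) e₃ → x` lies in the open piece
    have hlim : Tendsto (fun n : ℕ => x + (L / ((n : ℝ) + 2)) • eZ) atTop (𝓝 x) := by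
      have h1 : Tendsto (fun n : ℕ => L / ((n : ℝ) + 2)) atTop (𝓝 0) := by
        have := tendsto_const_div_atTop_nhds_zero_nat L |>.comp (tendsto_add_atTop_nat 2)
        refine this.congr fun n => ?_
        simp [Nat.cast_add]
      have h2 : Tendsto (fun n : ℕ => x + (L / ((n : ℝ) + 2)) • (eZ : EuclideanSpace ℝ (Fin 3)))
          atTop (𝓝 (x + (0 : ℝ) • eZ)) :=
        tendsto_const_nhds.add (h1.smul_const _)
      rwa [zero_smul, add_zero] at h2
    have hvals : ∀ n : ℕ, F (x + (L / ((n : ℝ) + 2)) • eZ) = 0 := fun n => by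
      have hn : (0 : ℝ) < (n : ℝ) + 2 := by positivity
      refine hopen r hr1 _ ?_ ?_ ?_
      · rw [apply_two_add_smul_eZ, hx2, zero_add]; positivity
      · rw [apply_two_add_smul_eZ, hx2, zero_add, div_lt_iff₀ hn]; nlinarith
      · have : cylRadius (x + (L / ((n : ℝ) + 2)) • eZ) = cylRadius x := by simp [cylRadius, eZ]
        rw [this, hr]; linarith
    have hFlim : Tendsto (fun n : ℕ => F (x + (L / ((n : ℝ) + 2)) • eZ)) atTop (𝓝 (F x)) :=
      (hFc.tendsto x).comp hlim
    have : Tendsto (fun _ : ℕ => (0 : ℝ)) atTop (𝓝 (F x)) := hFlim.congr hvals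
    exact tendsto_nhds_unique this tendsto_const_nhds
  -- (3) reduce a general point into the strip `0 ≤ x₂ < L` by an integer period
  intro x
  set k : ℤ := ⌊x 2 / L⌋ with hk
  set y : EuclideanSpace ℝ (Fin 3) := x + (-((k : ℝ) * L)) • eZ with hy
  have hyx : F x = F y := by
    have hp := hFper.periodic_int_mul_smul_eZ k
    have : y + ((k : ℝ) * L) • eZ = x := by rw [hy, add_assoc, ← add_smul]; simp
    rw [← this, hp y]
  have hy2 : y 2 = x 2 - (k : ℝ) * L := by rw [hy, apply_two_add_smul_eZ]; ring
  have hy0 : 0 ≤ y 2 := by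
    rw [hy2, sub_nonneg, hk]
    have := Int.floor_le (x 2 / L)
    rwa [le_div_iff₀ hL] at this
  have hyL : y 2 < L := by
    rw [hy2, hk]
    have := Int.lt_floor_add_one (x 2 / L)
    rw [div_lt_iff₀ hL] at this
    linarith
  rw [hyx]
  rcases hy0.eq_or_lt with h0 | h0
  · exact hbdry y h0.symm
  · exact hopen (cylRadius y + 1) (by have := cylRadius_nonneg y; linarith) y h0 hyL (by linarith)

/-! ### The Liouville theorem -/

/-- **Bang–Gui–Wang–Xie 2025, Thm 1.4 (d): bounded steady flows in the periodic slab with small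
period–Reynolds number are constant.** Let `ν > 0`, `L > 0`, and let `(U, P)` be a smooth steady
solution of the unforced Navier–Stokes system on `ℝ³` (`IsLerayProfile ν 0 U P`, `U, P ∈ C^∞`),
axially `L`-periodic (`IsAxiallyPeriodic L U`) and bounded with `sup ‖U‖ < 2πν/L`. Then `U` is a
constant vector. This is the second conjunct of the named fact
`Literature.Analysis.FluidPDE.BangGuiWangXie2025_periodicSlab_liouville` under its hypotheses,
now a theorem of the tree (no symmetry assumed; the constant `2π` is Wirtinger's).
[cite: BangGuiWangXie2025, Thm 1.4 (d), proof §5 (Poincaré inequality in the vertical period, localised energy identity, dyadic Saint-Venant estimate) (source of the ARGUMENT this module implements; this declaration is the cell’s own lemma or plumbing, NOT a printed statement)] -/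
theorem periodicSlab_liouville_small {ν L : ℝ} (hν : 0 < ν) (hL : 0 < L)
    {U : EuclideanSpace ℝ (Fin 3) → EuclideanSpace ℝ (Fin 3)} {P : EuclideanSpace ℝ (Fin 3) → ℝ}
    (hprof : IsLerayProfile ν 0 U P) (hU : ContDiff ℝ (⊤ : ℕ∞) U) (hP : ContDiff ℝ (⊤ : ℕ∞) P)
    (hbd : ∃ M : ℝ, M < 2 * Real.pi * ν / L ∧ ∀ x, ‖U x‖ ≤ M) (hper : IsAxiallyPeriodic L U) :
    ∃ C : EuclideanSpace ℝ (Fin 3), U = fun _ => C := by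
  obtain ⟨M, hMlt, hM⟩ := hbd
  have hst : IsSteadyClassicalNS ν 0 U P := isSteadyClassicalNS_of_isLerayProfile hprof hU hP
  -- derivative bounds and the differentiated system
  obtain ⟨K₁, K₂, K₃, -, -, -, hK⟩ := steady_derivative_bounds hν hst hM
  obtain ⟨hwS, hqS, hdivw, hpde⟩ := steady_differentiated_system hst eZ
  obtain ⟨hqper, hqbd⟩ := steady_pressure_partial hst hper
  set w : EuclideanSpace ℝ (Fin 3) → EuclideanSpace ℝ (Fin 3) := fun y => fderiv ℝ U y eZ with hw
  set q : EuclideanSpace ℝ (Fin 3) → ℝ := fun y => fderiv ℝ P y eZ with hq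
  have hq1 : ContDiff ℝ 1 q := contDiff_infty.1 hqS 1
  have hK₃ : ∀ x, |q x| ≤ K₃ := fun x => (hqbd x).trans (hK x).2.2
  have hML : M * L / (2 * Real.pi) ≤ ν := by
    rw [div_le_iff₀ (by positivity)]
    have := (lt_div_iff₀ hL).1 hMlt
    nlinarith [Real.pi_pos]
  have hν' : 0 < ν - M * L / (2 * Real.pi) := by
    rw [sub_pos, div_lt_iff₀ (by positivity)]
    have := (lt_div_iff₀ hL).1 hMlt
    nlinarith [Real.pi_pos]
  -- the period energies
  set F : EuclideanSpace ℝ (Fin 3) → ℝ := fun x => frobeniusNormSq (fderiv ℝ w x) with hF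
  set E : ℝ → ℝ := fun r => ∫ x in zSlab L 0 ∩ {x | cylRadius x < r}, F x with hE
  obtain ⟨γ, a, c, hγ, ha, hc, hineq⟩ := energy_dyadic_estimate hν hL hML hU hq1 hst.divFree hdivw
    hpde hper hqper hM (fun x => (hK x).1) (fun x => (hK x).2.1) hK₃ E (fun r => rfl)
  -- properties of `F` and `E`
  have hU2 : ContDiff ℝ 2 U := contDiff_infty.1 hU 2
  have hw1 : ContDiff ℝ 1 w := contDiff_infty.1 hwS 1
  have hFc : Continuous F := continuous_frobeniusNormSq_fderiv hw1 one_ne_zero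
  have hF0 : ∀ x, 0 ≤ F x := fun x => frobeniusNormSq_nonneg _
  have hFB : ∀ x, ‖F x‖ ≤ 3 * K₂ ^ 2 := fun x => by
    rw [Real.norm_of_nonneg (hF0 x)]; exact (partial_bounds hU2 (fun y => (hK y).2.1) x).2.1
  have hwper : IsAxiallyPeriodic L w := fun y => by
    show fderiv ℝ U (y + L • EuclideanSpace.single 2 1) eZ = fderiv ℝ U y eZ
    rw [isAxiallyPeriodic_fderiv hper y]
  have hFper : IsAxiallyPeriodic L F := fun x => by
    simp only [hF, isAxiallyPeriodic_fderiv hwper x]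
  have hEint : ∀ r, 0 < r → IntegrableOn F (zSlab L 0 ∩ {x | cylRadius x < r}) volume :=
    fun r hr => integrableOn_zSlab_inter_cyl_of_bound hL hr hFc hFB
  have hmono : ∀ r s, 1 ≤ r → r ≤ s → E r ≤ E s := fun r s hr hrs =>
    setIntegral_mono_set (hEint s (by linarith)) (Eventually.of_forall fun x => hF0 x)
      (Eventually.of_forall fun x hx => ⟨hx.1, lt_of_lt_of_le hx.2 hrs⟩)
  have hE0 : ∀ r, 1 ≤ r → 0 ≤ E r := fun r _ =>
    setIntegral_nonneg ((measurableSet_zSlab L 0).inter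
      (isOpen_lt continuous_cylRadius continuous_const).measurableSet) fun x _ => hF0 x
  have hEA : ∀ r, 1 ≤ r → E r ≤ 3 * K₂ ^ 2 * (8 * L) * r ^ 2 := by
    intro r hr
    have hr0 : 0 < r := by linarith
    have hvol := volume_zSlab_inter_cyl_le hL hr0
    have hfin : volume (zSlab L 0 ∩ {x | cylRadius x < r}) ≠ ⊤ :=
      (lt_of_le_of_lt hvol ENNReal.ofReal_lt_top).ne
    have hmeas : MeasurableSet (zSlab L 0 ∩ {x : EuclideanSpace ℝ (Fin 3) | cylRadius x < r}) :=
      (measurableSet_zSlab L 0).inter (isOpen_lt continuous_cylRadius continuous_const).measurableSet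
    calc E r ≤ ∫ x in zSlab L 0 ∩ {x | cylRadius x < r}, (3 * K₂ ^ 2 : ℝ) := by
          refine setIntegral_mono_on (hEint r hr0) ?_ hmeas fun x _ => ?_
          · exact integrableOn_const hfin
          · have := hFB x; rwa [Real.norm_of_nonneg (hF0 x)] at this
      _ = (volume (zSlab L 0 ∩ {x | cylRadius x < r})).toReal * (3 * K₂ ^ 2) := by
          rw [setIntegral_const, smul_eq_mul, measureReal_def]
      _ ≤ (8 * L * r ^ 2) * (3 * K₂ ^ 2) :=
          mul_le_mul_of_nonneg_right (ENNReal.toReal_le_of_le_ofReal (by positivity) hvol)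
            (by positivity)
      _ = 3 * K₂ ^ 2 * (8 * L) * r ^ 2 := by ring
  -- `E ≡ 0` by the dyadic lemma
  have hEzero : ∀ r, 1 ≤ r → E r = 0 :=
    saintVenant_dyadic hν' hγ ha hc hmono hE0 hEA hineq
  -- `Dw ≡ 0`
  have hFzero : ∀ x, F x = 0 :=
    eq_zero_of_setIntegral_zSlab_eq_zero hL hFc hF0 hFper hFB hEzero
  set b := EuclideanSpace.basisFun (Fin 3) ℝ with hb
  have hDw : ∀ x, fderiv ℝ w x = 0 := by
    intro x
    have hcoord : ∀ i, fderiv ℝ w x (b i) = 0 := fun i => by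
      have h1 := norm_apply_sq_le_frobeniusNormSq b (fderiv ℝ w x) i
      have h2 : frobeniusNormSq (fderiv ℝ w x) = 0 := hFzero x
      rw [h2] at h1
      have h3 : ‖fderiv ℝ w x (b i)‖ ^ 2 = 0 := le_antisymm h1 (sq_nonneg _)
      exact norm_eq_zero.1 (pow_eq_zero_iff two_ne_zero |>.1 h3)
    ext v
    -- expand `v` in the basis
    have hv : v = ∑ i, ⟪b i, v⟫ • b i := (b.sum_repr' v).symm
    rw [hv, map_sum]
    simp [map_smul, hcoord]
  -- `w` is constant, and the constant vanishes by periodicity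
  have hwd : Differentiable ℝ w := hw1.differentiable one_ne_zero
  have hwconst : ∀ x, w x = w 0 := fun x => is_const_of_fderiv_eq_zero hwd hDw x 0
  have hUd : Differentiable ℝ U := (contDiff_infty.1 hU 1).differentiable one_ne_zero
  have hw0 : w 0 = 0 := by
    have hftc : ∫ s in (0 : ℝ)..L, fderiv ℝ U ((0 : EuclideanSpace ℝ (Fin 3)) + s • eZ) eZ =
        U ((0 : EuclideanSpace ℝ (Fin 3)) + L • eZ) - U ((0 : EuclideanSpace ℝ (Fin 3)) + (0 : ℝ) • eZ) :=
      intervalIntegral.integral_eq_sub_of_hasDerivAt (fun s _ => hasDerivAt_comp_add_smul_eZ hUd 0 s)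
        ((hw1.continuous.comp (continuous_const.add (continuous_id.smul continuous_const))).intervalIntegrable _ _)
    have hrhs : U ((0 : EuclideanSpace ℝ (Fin 3)) + L • eZ) - U ((0 : EuclideanSpace ℝ (Fin 3)) + (0 : ℝ) • eZ) = 0 := by
      rw [zero_smul, add_zero, isAxiallyPeriodic_add_smul_eZ hper 0, sub_self]
    have hlhs : ∫ s in (0 : ℝ)..L, fderiv ℝ U ((0 : EuclideanSpace ℝ (Fin 3)) + s • eZ) eZ = L • w 0 := by
      have : (fun s : ℝ => fderiv ℝ U ((0 : EuclideanSpace ℝ (Fin 3)) + s • eZ) eZ) = fun _ => w 0 :=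
        funext fun s => hwconst _
      rw [this, intervalIntegral.integral_const, sub_zero]
    rw [hlhs, hrhs] at hftc
    exact (smul_eq_zero.1 hftc).resolve_left hL.ne'
  have hwzero : ∀ x, w x = 0 := fun x => by rw [hwconst x, hw0]
  -- `U` is invariant under axial translations
  have hinvU : ∀ (x : EuclideanSpace ℝ (Fin 3)) (δ : ℝ), U (x + δ • eZ) = U x := by
    intro x δ
    have hg : Differentiable ℝ fun s : ℝ => U (x + s • eZ) := fun s =>
      (hasDerivAt_comp_add_smul_eZ hUd x s).differentiableAt
    have hg' : ∀ s : ℝ, deriv (fun s : ℝ => U (x + s • eZ)) s = 0 := fun s => by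
      rw [(hasDerivAt_comp_add_smul_eZ hUd x s).deriv]; exact hwzero _
    have := is_const_of_deriv_eq_zero hg hg' δ 0
    simpa using this
  -- the `2½`-dimensional Liouville theorem for the rescaled flow `ν⁻¹ U`
  have h1 : IsSteadyClassicalNS 1 0 (ν⁻¹ • U) (ν⁻¹ ^ 2 • P) := by
    simpa [inv_mul_cancel₀ hν.ne'] using hst.smul ν⁻¹
  have hVbd : ∀ x, ‖(ν⁻¹ • U) x‖ ≤ |ν⁻¹| * M := fun x => by
    rw [Pi.smul_apply, norm_smul, Real.norm_eq_abs]
    exact mul_le_mul_of_nonneg_left (hM x) (abs_nonneg _)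
  have hVc : Continuous (ν⁻¹ • U) := h1.smooth_velocity.continuous
  have hanc : IsBoundedAncientMildSolution 1 (fun _ : ℝ => ν⁻¹ • U) := by
    refine isBoundedAncientMildSolution_of_oseen one_pos ((hVc.comp continuous_snd).continuousOn)
      ⟨|ν⁻¹| * M, fun _ _ x => hVbd x⟩ (fun t _ => ?_) (fun s t hst _ x => ?_)
    · exact VectorCalculus.IsDivFree.isWeaklyDivFree_holds h1.divFree
        (contDiff_infty.1 h1.smooth_velocity 1)
    · rw [one_mul]; exact steady_oseenMild_identity h1 hVbd s t hst x
  have he : (eZ : EuclideanSpace ℝ (Fin 3)) ≠ 0 := by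
    intro h0
    have : (eZ : EuclideanSpace ℝ (Fin 3)) 2 = 0 := by rw [h0]; rfl
    simp [eZ] at this
  have hinvV : ∀ t : ℝ, t < 0 → ∀ (x : EuclideanSpace ℝ (Fin 3)) (δ : ℝ),
      (fun _ : ℝ => ν⁻¹ • U) t (x + δ • eZ) = (fun _ : ℝ => ν⁻¹ • U) t x := fun t _ x δ => by
    simp only [Pi.smul_apply, hinvU x δ]
  have hconst := apply_eq_apply_zero_of_invariant_along he hanc ((hVc.comp continuous_snd).continuousOn)
    hinvV (-1) (by norm_num)
  refine ⟨U 0, funext fun x => ?_⟩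
  have hx : (ν⁻¹ • U) x = (ν⁻¹ • U) 0 := hconst x
  simp only [Pi.smul_apply] at hx
  have := congrArg (fun v => ν • v) hx
  simpa [smul_smul, mul_inv_cancel₀ hν.ne'] using this

end Literature.Analysis.SteadySlabLiouville.PeriodicSlab

end Part4

/-!
## Part 5 — port of `Summits/NavierStokesRegularity/NavierStokesRegularity/Theorems/ScenarioCensusHelicalSlabPressure.lean` (3 declarations kept)

# Census row S6 (bounded helical steady flows): the pressure of a bounded axially periodic
# steady flow is axially periodic

Support file for the scenario census of `NavierStokesRegularity` (cell `pub/ns-census`, block S,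
row S6 = Han–Wang–Xie, arXiv:2312.10382, Thm 1.1; tree FACT
`Literature.Analysis.FluidPDE.HanWangXie2023_helical_liouville`). The printed proof uses
Lemma 2.7 (= Bang–Gui–Wang–Xie 2025, Lemma "periodic pressure"): "Let `u` be a bounded smooth
solution to the Navier–Stokes system in `ℝ² × 𝕋`. The pressure `P` is also a periodic function
with respect to `z`" — it is what makes the energy identity on one period hold without pressure
boundary terms. Here (`steady_pressure_periodic`, viscosity normalised to `1`):

* the pressure GRADIENT is periodic (`∇P = ΔU − (U·∇)U`), so the period defect
  `P(x + L e₃) − P(x) = c₀` is a constant (`steady_pressure_defect`);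
* `c₀ ∫_{slab} φ = L ∫_{slab} φ ∂₃P` for every `z`-independent cut-off `φ` (FTC on vertical lines +
  signed vertical averaging, `…HelicalSlabTools`), and testing the `e₃`-component of the momentum
  equation against `φ ω_L²` (Green's identity and the trilinear identity of `WholeSpaceIBP`, window
  bookkeeping of `…PeriodicSlabWindow`) gives `|∫_{slab} φ_R ∂₃P| ≤ C R` for the cylindrical
  cut-offs `φ_R = cylCutoff R (2R)`, while `∫_{slab} φ_R ≥ L R²`; letting `R → ∞`, `c₀ = 0`.

No summit statement and no census row is proved in this file.

## References

* J. Han, Y. Wang, C. Xie, arXiv:2312.10382 (2023), Lemma 2.7. [HanWangXie2023]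
* J. Bang, C. Gui, Y. Wang, C. Xie, J. Fluid Mech. 1005 (2025) A6 = arXiv:2205.13259, §2
  (periodicity of the pressure for bounded flows in `ℝ² × 𝕋`). [BangGuiWangXie2025]
-/

section Part5

open _root_.MeasureTheory _root_.Set _root_.Function _root_.Filter _root_.InnerProductSpace
open scoped _root_.Topology _root_.ENNReal _root_.NNReal RealInnerProductSpace Laplacian _root_.ContDiff

namespace Literature.Analysis.SteadySlabLiouville.HelicalSlab

open Literature.Analysis Literature.Analysis.FluidPDE
open Literature.Analysis.SteadySlabLiouville.PeriodicSlab

/-! ### The period defect of the pressure is a constant -/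

/-- For a steady classical flow with axially `L`-periodic velocity, the pressure has a CONSTANT
period defect: `P(x + L e₃) − P(x) = P(L e₃) − P(0)` for all `x` (its gradient
`∇P = νΔU − (U·∇)U` is periodic).
[cite: HanWangXie2023, Thm 1.1, proof §§2–3 (periodic pressure, helical identities, Saint-Venant estimate) (source of the ARGUMENT this module implements; this declaration is the cell’s own lemma or plumbing, NOT a printed statement)] -/
theorem steady_pressure_defect {ν L : ℝ}
    {U : EuclideanSpace ℝ (Fin 3) → EuclideanSpace ℝ (Fin 3)} {P : EuclideanSpace ℝ (Fin 3) → ℝ}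
    (h : IsSteadyClassicalNS ν 0 U P) (hper : IsAxiallyPeriodic L U) (x : EuclideanSpace ℝ (Fin 3)) :
    P (x + L • eZ) - P x = P (L • eZ) - P 0 := by
  set b := stdOrthonormalBasis ℝ (EuclideanSpace ℝ (Fin 3)) with hb
  have hPd : Differentiable ℝ P := h.smooth_pressure.differentiable (by simp)
  have hgrad : ∀ y, gradient P y = ν • (Δ U) y - convect U U y := fun y => by
    have hm := h.momentum y
    rw [Pi.zero_apply, add_zero] at hm
    rw [hm]; abel
  have hΔper : IsAxiallyPeriodic L (Δ U) := fun y => by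
    rw [InnerProductSpace.laplacian_eq_iteratedFDeriv_orthonormalBasis U b]
    simp only [isAxiallyPeriodic_iteratedFDeriv hper 2 y]
  have hconvper : ∀ y, convect U U (y + L • EuclideanSpace.single 2 (1 : ℝ)) = convect U U y :=
    fun y => by simp only [convect_apply, isAxiallyPeriodic_fderiv hper y, hper y]
  have hgradper : ∀ y, gradient P (y + L • eZ) = gradient P y := fun y => by
    rw [hgrad, hgrad]
    show ν • (Δ U) (y + L • EuclideanSpace.single 2 (1 : ℝ)) -
        convect U U (y + L • EuclideanSpace.single 2 (1 : ℝ)) = _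
    rw [hΔper y, hconvper y]
  -- the defect has zero derivative
  set π : EuclideanSpace ℝ (Fin 3) → ℝ := fun y => P (y + L • eZ) - P y with hπ
  have hπd : Differentiable ℝ π := (hPd.comp (differentiable_id.add_const _)).sub hPd
  have hDπ : ∀ y, fderiv ℝ π y = 0 := fun y => by
    have h1 : fderiv ℝ (fun z => P (z + L • eZ)) y = fderiv ℝ P (y + L • eZ) :=
      fderiv_comp_add_right (L • eZ)
    have hf : DifferentiableAt ℝ (fun z => P (z + L • eZ)) y :=
      (hPd _).comp y (differentiableAt_id.add_const _)
    show fderiv ℝ (fun z => P (z + L • eZ) - P z) y = 0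
    rw [fderiv_fun_sub hf (hPd y), h1]
    have e : ∀ z, fderiv ℝ P z = (InnerProductSpace.toDual ℝ _ ) (gradient P z) := fun z => by
      rw [gradient, LinearIsometryEquiv.apply_symm_apply]
    rw [e, e, hgradper, sub_self]
  have := is_const_of_fderiv_eq_zero hπd hDπ x 0
  simpa [hπ] using this

/-- The vertical period integral of `∂₃P` is the period defect of `P` (FTC).
[cite: HanWangXie2023, Thm 1.1, proof §§2–3 (periodic pressure, helical identities, Saint-Venant estimate) (source of the ARGUMENT this module implements; this declaration is the cell’s own lemma or plumbing, NOT a printed statement)] -/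
theorem verticalIntegral_fderiv_eZ {L : ℝ} {P : EuclideanSpace ℝ (Fin 3) → ℝ} (hP : ContDiff ℝ 1 P)
    (x : EuclideanSpace ℝ (Fin 3)) :
    ∫ s in (0 : ℝ)..L, fderiv ℝ P (x + s • eZ) eZ = P (x + L • eZ) - P x := by
  have hPd : Differentiable ℝ P := hP.differentiable one_ne_zero
  have hc : Continuous fun s : ℝ => fderiv ℝ P (x + s • eZ) eZ :=
    ((hP.continuous_fderiv one_ne_zero).comp (continuous_const.add
      (continuous_id.smul continuous_const))).clm_apply continuous_const
  rw [intervalIntegral.integral_eq_sub_of_hasDerivAt (fun s _ => hasDerivAt_comp_add_smul_eZ hPd x s)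
    (hc.intervalIntegrable _ _), zero_smul, add_zero]

/-! ### The flux identity: the `e₃`-momentum equation tested against `φ ω_L²` -/

/-- **The pressure flux identity per period.** For a steady classical flow `(U, P)` at unit
viscosity with `U` axially `L`-periodic (`L > 0`) and an axially periodic `C¹` cut-off `φ ≥ 0`
vanishing off a cylinder:
`∫_S φ ∂₃P = −Σᵢ ∫_S (∂ᵢφ) ⟪∂ᵢU, e₃⟫ + ∫_S (Dφ·U) ⟪U, e₃⟫` (`S = zSlab L 0`), i.e. the
`e₃`-component of `∇P = ΔU − (U·∇)U` integrated by parts against `φ` over one period (through the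
window `ω_L²`; the window-derivative terms vanish by periodicity).
[cite: HanWangXie2023, Thm 1.1, proof §§2–3 (periodic pressure, helical identities, Saint-Venant estimate) (source of the ARGUMENT this module implements; this declaration is the cell’s own lemma or plumbing, NOT a printed statement)] -/
theorem pressure_flux_identity {L : ℝ} (hL : 0 < L)
    {U : EuclideanSpace ℝ (Fin 3) → EuclideanSpace ℝ (Fin 3)} {P : EuclideanSpace ℝ (Fin 3) → ℝ}
    (h : IsSteadyClassicalNS 1 0 U P) (hUper : IsAxiallyPeriodic L U)
    {φ : EuclideanSpace ℝ (Fin 3) → ℝ} (hφ : ContDiff ℝ 1 φ) (hφper : IsAxiallyPeriodic L φ)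
    (hφnn : ∀ x, 0 ≤ φ x) {ρ : ℝ} (hφ0 : ∀ x, ρ ≤ cylRadius x → φ x = 0) :
    ∫ x in zSlab L 0, φ x * fderiv ℝ P x eZ =
      -(∑ i, ∫ x in zSlab L 0, fderiv ℝ φ x (EuclideanSpace.basisFun (Fin 3) ℝ i) *
          ⟪fderiv ℝ U x (EuclideanSpace.basisFun (Fin 3) ℝ i), eZ⟫) +
        ∫ x in zSlab L 0, fderiv ℝ φ x (U x) * ⟪U x, eZ⟫ := by
  set b := EuclideanSpace.basisFun (Fin 3) ℝ with hb
  set ω2 : ℝ → ℝ := fun s => periodicWindow L s ^ 2 with hω2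
  set Φ : EuclideanSpace ℝ (Fin 3) → ℝ := fun x => φ x * ω2 (x 2) with hΦ
  set W : EuclideanSpace ℝ (Fin 3) → EuclideanSpace ℝ (Fin 3) := fun x => Φ x • eZ with hW
  -- regularity
  have hU : ContDiff ℝ ∞ U := h.smooth_velocity
  have hP : ContDiff ℝ ∞ P := h.smooth_pressure
  have hU1 : ContDiff ℝ 1 U := contDiff_infty.1 hU 1
  have hU2 : ContDiff ℝ 2 U := contDiff_infty.1 hU 2
  have hP1 : ContDiff ℝ 1 P := contDiff_infty.1 hP 1
  have hUc : Continuous U := hU1.continuous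
  have hDUc : Continuous (fderiv ℝ U) := hU1.continuous_fderiv one_ne_zero
  have hDPc : Continuous (fderiv ℝ P) := hP1.continuous_fderiv one_ne_zero
  have hφc : Continuous φ := hφ.continuous
  have hDφc : Continuous (fderiv ℝ φ) := hφ.continuous_fderiv one_ne_zero
  have hω2c : ContDiff ℝ 1 ω2 := contDiff_periodicWindow_sq L
  have hΦ1 : ContDiff ℝ 1 Φ := contDiff_mul_comp_apply_two hφ hω2c
  have hΦc : HasCompactSupport Φ :=
    hasCompactSupport_mul_comp_apply_two hφ0 (abs_le_of_periodicWindow_sq_ne_zero hL)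
  have hΦcn : Continuous Φ := hΦ1.continuous
  have hDΦc : Continuous (fderiv ℝ Φ) := hΦ1.continuous_fderiv one_ne_zero
  have hΦd : ∀ x, DifferentiableAt ℝ Φ x := fun x => hΦ1.differentiable one_ne_zero x
  have hW1 : ContDiff ℝ 1 W := hΦ1.smul contDiff_const
  have hWc : HasCompactSupport W := hΦc.smul_right
  have hDW : ∀ x v, fderiv ℝ W x v = fderiv ℝ Φ x v • eZ := fun x v => by
    rw [hW, ((hΦd x).hasFDerivAt.smul_const eZ).fderiv, ContinuousLinearMap.smulRight_apply]
  -- the derivative of the nonnegative cut-off vanishes where the cut-off vanishes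
  have hφD0 : ∀ x, ρ ≤ cylRadius x → fderiv ℝ φ x = 0 := fun x hx => by
    have hmin : IsLocalMin φ x := Eventually.of_forall fun y => by rw [hφ0 x hx]; exact hφnn y
    exact hmin.fderiv_eq_zero
  have hDΦ : ∀ (x v : EuclideanSpace ℝ (Fin 3)),
      fderiv ℝ Φ x v = ω2 (x 2) * fderiv ℝ φ x v + φ x * deriv ω2 (x 2) * v 2 := fun x v =>
    fderiv_mul_comp_apply_two (hφ.differentiable one_ne_zero x) (hω2c.differentiable one_ne_zero _) v
  -- periodicity
  have hDUper : IsAxiallyPeriodic L (fderiv ℝ U) := isAxiallyPeriodic_fderiv hUper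
  have hDφper : IsAxiallyPeriodic L (fderiv ℝ φ) := isAxiallyPeriodic_fderiv hφper
  obtain ⟨hqper, -⟩ := steady_pressure_partial h hUper
  -- the momentum equation, `e₃`-component, tested against `Φ`
  have hq : ∀ y, fderiv ℝ P y eZ = ⟪(Δ U) y, eZ⟫ - ⟪convect U U y, eZ⟫ := fun y => by
    have hm := h.momentum y
    rw [Pi.zero_apply, add_zero, one_smul] at hm
    have hg : gradient P y = (Δ U) y - convect U U y := by rw [hm]; abel
    rw [show fderiv ℝ P y eZ = ⟪gradient P y, eZ⟫ by
      rw [gradient, InnerProductSpace.toDual_symm_apply], hg, inner_sub_left]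
  -- (1) Green's identity with the test field `W = Φ e₃`
  have green := FluidPDE.integral_inner_laplacian_add_eq_zero b hU2 hW1 (Or.inr hWc)
  have hg1 : ∀ x, ⟪(Δ U) x, W x⟫ = Φ x * ⟪(Δ U) x, eZ⟫ := fun x => by
    rw [hW, real_inner_smul_right]
  have hg2 : ∀ x i, ⟪fderiv ℝ U x (b i), fderiv ℝ W x (b i)⟫ =
      fderiv ℝ Φ x (b i) * ⟪fderiv ℝ U x (b i), eZ⟫ := fun x i => by
    rw [hDW, real_inner_smul_right]
  -- (2) the trilinear identity with the test field `W`
  have conv := FluidPDE.integral_inner_convect_add_eq_zero (F' := EuclideanSpace ℝ (Fin 3)) hU1 hU1 hW1 hWc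
  have hc1 : ∀ x, ⟪convect U U x, W x⟫ = Φ x * ⟪convect U U x, eZ⟫ := fun x => by
    rw [hW, real_inner_smul_right]
  have hc2 : ∀ x, ⟪U x, convect U W x⟫ = fderiv ℝ Φ x (U x) * ⟪U x, eZ⟫ := fun x => by
    rw [convect_apply, hDW, real_inner_smul_right]
  have hc3 : ∫ x, VectorCalculus.divergence U x * ⟪U x, W x⟫ = 0 := by
    rw [← integral_zero (α := EuclideanSpace ℝ (Fin 3)) (G := ℝ)]
    refine integral_congr_ae (Eventually.of_forall fun x => ?_)
    show VectorCalculus.divergence U x * ⟪U x, W x⟫ = 0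
    rw [h.divFree x, zero_mul]
  -- integrability (continuous, compactly supported)
  have hcsΦ : ∀ f : EuclideanSpace ℝ (Fin 3) → ℝ, Continuous f →
      Integrable fun x => Φ x * f x := fun f hf =>
    (hΦcn.mul hf).integrable_of_hasCompactSupport hΦc.mul_right
  have hDΦcs : HasCompactSupport (fderiv ℝ Φ) := hΦc.fderiv (𝕜 := ℝ)
  have hcsD : ∀ (v : EuclideanSpace ℝ (Fin 3) → EuclideanSpace ℝ (Fin 3)) (f : EuclideanSpace ℝ (Fin 3) → ℝ),
      Continuous v → Continuous f → Integrable fun x => fderiv ℝ Φ x (v x) * f x := by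
    intro v f hv hf
    refine ((hDΦc.clm_apply hv).mul hf).integrable_of_hasCompactSupport (hDΦcs.mono fun x hx => ?_)
    rw [mem_support] at hx ⊢
    contrapose! hx
    simp [hx]
  have hconvc : Continuous fun x => ⟪convect U U x, eZ⟫ := by
    simp only [convect_apply]; exact (hDUc.clm_apply hUc).inner continuous_const
  have hΔc : Continuous fun x => ⟪(Δ U) x, eZ⟫ := by
    have e : (fun x => ⟪(Δ U) x, eZ⟫) = fun x => fderiv ℝ P x eZ + ⟪convect U U x, eZ⟫ :=
      funext fun x => by rw [hq x]; ring
    rw [e]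
    exact (hDPc.clm_apply continuous_const).add hconvc
  -- rewrite every pairing
  have e1 : ∫ x, ⟪(Δ U) x, W x⟫ = ∫ x, Φ x * ⟪(Δ U) x, eZ⟫ :=
    integral_congr_ae (Eventually.of_forall hg1)
  have e2 : ∑ i, ∫ x, ⟪fderiv ℝ U x (b i), fderiv ℝ W x (b i)⟫ =
      ∑ i, ∫ x, fderiv ℝ Φ x (b i) * ⟪fderiv ℝ U x (b i), eZ⟫ :=
    Finset.sum_congr rfl fun i _ => integral_congr_ae (Eventually.of_forall fun x => hg2 x i)
  have e3 : ∫ x, ⟪convect U U x, W x⟫ = ∫ x, Φ x * ⟪convect U U x, eZ⟫ :=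
    integral_congr_ae (Eventually.of_forall hc1)
  have e4 : ∫ x, ⟪U x, convect U W x⟫ = ∫ x, fderiv ℝ Φ x (U x) * ⟪U x, eZ⟫ :=
    integral_congr_ae (Eventually.of_forall hc2)
  rw [e1, e2] at green
  rw [e3, e4, hc3] at conv
  have e5 : ∫ x, Φ x * fderiv ℝ P x eZ =
      (∫ x, Φ x * ⟪(Δ U) x, eZ⟫) - ∫ x, Φ x * ⟪convect U U x, eZ⟫ := by
    rw [← integral_sub (hcsΦ _ hΔc) (hcsΦ _ hconvc)]
    refine integral_congr_ae (Eventually.of_forall fun x => ?_)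
    show Φ x * fderiv ℝ P x eZ = Φ x * ⟪(Δ U) x, eZ⟫ - Φ x * ⟪convect U U x, eZ⟫
    rw [hq x]; ring
  have whole : ∫ x, Φ x * fderiv ℝ P x eZ =
      -(∑ i, ∫ x, fderiv ℝ Φ x (b i) * ⟪fderiv ℝ U x (b i), eZ⟫) +
        ∫ x, fderiv ℝ Φ x (U x) * ⟪U x, eZ⟫ := by
    rw [e5]; linarith
  -- window bookkeeping: whole-space integrals against `Φ = φ ω²` are slab integrals
  have w0 : ∫ x, Φ x * fderiv ℝ P x eZ = ∫ x in zSlab L 0, φ x * fderiv ℝ P x eZ := by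
    obtain ⟨c0, -, -, -⟩ := window_bookkeeping hL (Q := fun x => φ x * fderiv ℝ P x eZ)
      (hφc.mul (hDPc.clm_apply continuous_const)) (fun x => by simp only [hφper x, hqper x]) (ρ := ρ)
      (fun x hx => by rw [hφ0 x hx, zero_mul])
    rw [← c0]; refine integral_congr_ae (Eventually.of_forall fun x => ?_)
    simp only [hΦ]; ring
  have w1 : ∀ i, ∫ x, fderiv ℝ Φ x (b i) * ⟪fderiv ℝ U x (b i), eZ⟫ =
      ∫ x in zSlab L 0, fderiv ℝ φ x (b i) * ⟪fderiv ℝ U x (b i), eZ⟫ := by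
    intro i
    obtain ⟨cA, -, iA, -⟩ := window_bookkeeping hL
      (Q := fun x => fderiv ℝ φ x (b i) * ⟪fderiv ℝ U x (b i), eZ⟫)
      ((hDφc.clm_apply continuous_const).mul ((hDUc.clm_apply continuous_const).inner continuous_const))
      (fun x => by simp only [hDφper x, hDUper x]) (ρ := ρ)
      (fun x hx => by rw [hφD0 x hx]; simp)
    obtain ⟨-, cB, -, iB⟩ := window_bookkeeping hL
      (Q := fun x => φ x * (b i) 2 * ⟪fderiv ℝ U x (b i), eZ⟫)
      ((hφc.mul continuous_const).mul ((hDUc.clm_apply continuous_const).inner continuous_const))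
      (fun x => by simp only [hφper x, hDUper x]) (ρ := ρ)
      (fun x hx => by rw [hφ0 x hx]; simp)
    rw [← cA, ← add_zero (∫ x, fderiv ℝ φ x (b i) * _ * _), ← cB, ← integral_add iA iB]
    refine integral_congr_ae (Eventually.of_forall fun x => ?_)
    simp only [hDΦ]; ring
  have w2 : ∫ x, fderiv ℝ Φ x (U x) * ⟪U x, eZ⟫ =
      ∫ x in zSlab L 0, fderiv ℝ φ x (U x) * ⟪U x, eZ⟫ := by
    obtain ⟨cA, -, iA, -⟩ := window_bookkeeping hL
      (Q := fun x => fderiv ℝ φ x (U x) * ⟪U x, eZ⟫)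
      ((hDφc.clm_apply hUc).mul (hUc.inner continuous_const))
      (fun x => by simp only [hDφper x, hUper x]) (ρ := ρ)
      (fun x hx => by rw [hφD0 x hx]; simp)
    obtain ⟨-, cB, -, iB⟩ := window_bookkeeping hL
      (Q := fun x => φ x * (U x) 2 * ⟪U x, eZ⟫)
      ((hφc.mul ((continuous_apply 2).comp ((PiLp.continuous_ofLp 2 _).comp hUc))).mul
        (hUc.inner continuous_const))
      (fun x => by simp only [hφper x, hUper x]) (ρ := ρ)
      (fun x hx => by rw [hφ0 x hx]; simp)
    rw [← cA, ← add_zero (∫ x, fderiv ℝ φ x (U x) * _ * _), ← cB, ← integral_add iA iB]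
    refine integral_congr_ae (Eventually.of_forall fun x => ?_)
    simp only [hDΦ]; ring
  rw [w0, w2] at whole
  simp_rw [w1] at whole
  exact whole

end Literature.Analysis.SteadySlabLiouville.HelicalSlab

end Part5

/-!
## Part 6 — port of `Summits/NavierStokesRegularity/NavierStokesRegularity/Theorems/ScenarioCensusHelicalSlabPeriodicPressure.lean` (3 declarations kept)

# Census row S6 (bounded helical steady flows): periodicity of the pressure — the flux bound and
# the conclusion

Support file for the scenario census of `NavierStokesRegularity` (cell `pub/ns-census`, block S,
row S6 = Han–Wang–Xie, arXiv:2312.10382, Thm 1.1, whose proof uses Lemma 2.7 = Bang–Gui–Wang–Xie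
2025, "the pressure `P` is also a periodic function with respect to `z`" for BOUNDED flows in
`ℝ² × 𝕋`). Sequel of `…HelicalSlabPressure` (`steady_pressure_defect`, `pressure_flux_identity`):

* `le_setIntegral_zSlab_cylCutoff` — `R² L ≤ ∫_{slab} φ_R` for `φ_R = cylCutoff R (2R)` (the cut-off
  is `1` on the box `(−R/2, R/2)² × (0, L)`);
* `pressure_flux_bound` — `|∫_{slab} φ_R ∂₃P| ≤ (96 C₀ K₁ L + 32 C₀ M² L) R` for a bounded steady
  flow with bounded gradient (`‖U‖ ≤ M`, `‖DU‖ ≤ K₁`; `C₀` the cut-off gradient constant);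
* `steady_pressure_periodic` — **the pressure of a bounded, axially `L`-periodic, smooth steady
  Navier–Stokes flow on `ℝ³` (unit viscosity) is axially `L`-periodic**: the constant period
  defect `c₀` satisfies `c₀ ∫_{slab} φ_R = L ∫_{slab} φ_R ∂₃P = O(R)` while `∫_{slab} φ_R ≥ R² L`.

No summit statement and no census row is proved in this file.

## References

* J. Han, Y. Wang, C. Xie, arXiv:2312.10382 (2023), Lemma 2.7. [HanWangXie2023]
* J. Bang, C. Gui, Y. Wang, C. Xie, J. Fluid Mech. 1005 (2025) A6 = arXiv:2205.13259, §2.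
  [BangGuiWangXie2025]
-/

section Part6

open _root_.MeasureTheory _root_.Set _root_.Function _root_.Filter _root_.InnerProductSpace
open scoped _root_.Topology _root_.ENNReal _root_.NNReal RealInnerProductSpace Laplacian _root_.ContDiff

namespace Literature.Analysis.SteadySlabLiouville.HelicalSlab

open Literature.Analysis Literature.Analysis.FluidPDE
open Literature.Analysis.SteadySlabLiouville.PeriodicSlab

/-! ### One period of the cut-off has mass at least `R² L` -/

/-- **`R² L ≤ ∫_{zSlab L 0} cylCutoff R (2R)`** (`L, R > 0`): the cut-off equals `1` on the box
`(−R/2, R/2)² × (0, L)`, which lies in the slab and inside the cylinder `{ρ < R}`.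
[cite: HanWangXie2023, Thm 1.1, proof §§2–3 (periodic pressure, helical identities, Saint-Venant estimate) (source of the ARGUMENT this module implements; this declaration is the cell’s own lemma or plumbing, NOT a printed statement)] -/
theorem le_setIntegral_zSlab_cylCutoff {L R : ℝ} (hL : 0 < L) (hR : 0 < R) :
    R ^ 2 * L ≤ ∫ x in zSlab L 0, cylCutoff R (2 * R) x := by
  set φ : EuclideanSpace ℝ (Fin 3) → ℝ := cylCutoff R (2 * R) with hφ
  have hr2 : R < 2 * R := by linarith
  have hφc : Continuous φ := (contDiff_cylCutoff R (2 * R) (n := 0)).continuous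
  have hφnn : ∀ x, 0 ≤ φ x := cylCutoff_nonneg R (2 * R)
  have hφone : ∀ x, cylRadius x ≤ R → φ x = 1 := fun x hx => cylCutoff_eq_one hR.le hr2 hx
  have hφzero : ∀ x, 2 * R ≤ cylRadius x → φ x = 0 := fun x hx => cylCutoff_eq_zero hR.le hr2 hx
  have hφint : IntegrableOn φ (zSlab L 0) volume :=
    integrableOn_zSlab_of_eq_zero_of_le_cylRadius hφc hφzero L 0
  -- the box
  set lo : Fin 3 → ℝ := ![-(R / 2), -(R / 2), 0] with hlo
  set hi : Fin 3 → ℝ := ![R / 2, R / 2, L] with hhi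
  set B : Set (EuclideanSpace ℝ (Fin 3)) :=
    (fun x : EuclideanSpace ℝ (Fin 3) => (WithLp.ofLp x : Fin 3 → ℝ)) ⁻¹'
      Set.pi univ (fun i => Ioo (lo i) (hi i)) with hB
  have hBm : MeasurableSet B :=
    (MeasurableSet.univ_pi fun i => measurableSet_Ioo).preimage (PiLp.continuous_ofLp 2 _).measurable
  have hmemB : ∀ x ∈ B, -(R / 2) < x 0 ∧ x 0 < R / 2 ∧ -(R / 2) < x 1 ∧ x 1 < R / 2 ∧
      0 < x 2 ∧ x 2 < L := by
    intro x hx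
    rw [hB, mem_preimage, mem_univ_pi] at hx
    have h0 := hx 0; have h1 := hx 1; have h2 := hx 2
    simp only [hlo, hhi, mem_Ioo, Matrix.cons_val_zero, Matrix.cons_val_one, Matrix.cons_val_two,
      Matrix.head_cons, Matrix.tail_cons] at h0 h1 h2
    exact ⟨h0.1, h0.2, h1.1, h1.2, h2.1, h2.2⟩
  have hBS : B ⊆ zSlab L 0 := fun x hx => by
    obtain ⟨-, -, -, -, h2a, h2b⟩ := hmemB x hx
    rw [mem_zSlab]; simp only [Int.cast_zero, zero_mul, zero_add, one_mul]
    exact ⟨h2a.le, h2b⟩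
  have hB1 : ∀ x ∈ B, φ x = 1 := fun x hx => by
    obtain ⟨h0a, h0b, h1a, h1b, -, -⟩ := hmemB x hx
    refine hφone x ?_
    have hsq : x 0 ^ 2 + x 1 ^ 2 ≤ R ^ 2 := by nlinarith
    calc cylRadius x = Real.sqrt (x 0 ^ 2 + x 1 ^ 2) := rfl
      _ ≤ Real.sqrt (R ^ 2) := Real.sqrt_le_sqrt hsq
      _ = R := Real.sqrt_sq hR.le
  -- volume of the box
  have hvol : volume B = ENNReal.ofReal (R ^ 2 * L) := by
    calc volume B = volume (Set.pi univ (fun i => Ioo (lo i) (hi i))) :=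
          (PiLp.volume_preserving_ofLp (Fin 3)).measure_preimage
            (MeasurableSet.univ_pi fun i => measurableSet_Ioo).nullMeasurableSet
      _ = ∏ i, ENNReal.ofReal (hi i - lo i) := Real.volume_pi_Ioo
      _ = ENNReal.ofReal (R ^ 2 * L) := by
          rw [Fin.prod_univ_three]
          simp only [hlo, hhi, Matrix.cons_val_zero, Matrix.cons_val_one, Matrix.cons_val_two,
            Matrix.head_cons, Matrix.tail_cons, sub_neg_eq_add, sub_zero]
          rw [← ENNReal.ofReal_mul (by linarith), ← ENNReal.ofReal_mul (by positivity)]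
          congr 1; ring
  calc R ^ 2 * L = (volume B).toReal := by rw [hvol, ENNReal.toReal_ofReal (by positivity)]
    _ = ∫ x in B, (1 : ℝ) := by rw [setIntegral_const, smul_eq_mul, mul_one, measureReal_def]
    _ = ∫ x in B, φ x := setIntegral_congr_fun hBm fun x hx => (hB1 x hx).symm
    _ ≤ ∫ x in zSlab L 0, φ x :=
        setIntegral_mono_set hφint (Eventually.of_forall hφnn) (Eventually.of_forall hBS)

/-! ### The flux bound -/

/-- **The pressure flux bound.** For a steady classical flow `(U, P)` at unit viscosity, axially
`L`-periodic (`L > 0`), with `‖U‖ ≤ M` and `‖DU‖ ≤ K₁`, and the cylindrical cut-offs with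
gradient constant `C₀`: `|∫_{zSlab L 0} φ_R ∂₃P| ≤ (96 C₀ K₁ L + 32 C₀ M² L) R` for `R ≥ 1`,
`φ_R = cylCutoff R (2R)`.
[cite: HanWangXie2023, Thm 1.1, proof §§2–3 (periodic pressure, helical identities, Saint-Venant estimate) (source of the ARGUMENT this module implements; this declaration is the cell’s own lemma or plumbing, NOT a printed statement)] -/
theorem pressure_flux_bound {L M K₁ C₀ : ℝ} (hL : 0 < L)
    {U : EuclideanSpace ℝ (Fin 3) → EuclideanSpace ℝ (Fin 3)} {P : EuclideanSpace ℝ (Fin 3) → ℝ}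
    (h : IsSteadyClassicalNS 1 0 U P) (hUper : IsAxiallyPeriodic L U)
    (hM : ∀ x, ‖U x‖ ≤ M) (hK₁ : ∀ x, ‖fderiv ℝ U x‖ ≤ K₁) (hC₀0 : 0 ≤ C₀)
    (hC₀ : ∀ (ρ₂ ρ₁ : ℝ), 0 ≤ ρ₂ → ρ₂ < ρ₁ → ∀ x : EuclideanSpace ℝ (Fin 3),
      ‖fderiv ℝ (cylCutoff ρ₂ ρ₁) x‖ ≤ C₀ / (ρ₁ - ρ₂))
    {R : ℝ} (hR : 1 ≤ R) :
    |∫ x in zSlab L 0, cylCutoff R (2 * R) x * fderiv ℝ P x eZ| ≤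
      (96 * C₀ * K₁ * L + 32 * C₀ * M ^ 2 * L) * R := by
  set b := EuclideanSpace.basisFun (Fin 3) ℝ with hb
  set S : Set (EuclideanSpace ℝ (Fin 3)) := zSlab L 0 with hS
  have hR0 : 0 < R := by linarith
  have hr2 : R < 2 * R := by linarith
  have hU1 : ContDiff ℝ 1 U := contDiff_infty.1 h.smooth_velocity 1
  have hUc : Continuous U := hU1.continuous
  have hDUc : Continuous (fderiv ℝ U) := hU1.continuous_fderiv one_ne_zero
  have hM0 : 0 ≤ M := (norm_nonneg _).trans (hM 0)
  have hK₁0 : 0 ≤ K₁ := (norm_nonneg _).trans (hK₁ 0)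
  have heZ : ‖(eZ : EuclideanSpace ℝ (Fin 3))‖ = 1 := by simp [eZ]
  -- the cut-off and the annulus
  set φ : EuclideanSpace ℝ (Fin 3) → ℝ := cylCutoff R (2 * R) with hφ
  have hφ1 : ContDiff ℝ 1 φ := contDiff_cylCutoff R (2 * R)
  have hφnn : ∀ x, 0 ≤ φ x := cylCutoff_nonneg R (2 * R)
  have hφle : ∀ x, φ x ≤ 1 := cylCutoff_le_one R (2 * R)
  have hφone : ∀ x, cylRadius x ≤ R → φ x = 1 := fun x hx => cylCutoff_eq_one hR0.le hr2 hx
  have hφzero : ∀ x, 2 * R ≤ cylRadius x → φ x = 0 := fun x hx => cylCutoff_eq_zero hR0.le hr2 hx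
  have hφper : IsAxiallyPeriodic L φ := isAxiallyPeriodic_cylCutoff L R (2 * R)
  have hDφn : ∀ x, ‖fderiv ℝ φ x‖ ≤ C₀ / R := fun x => by
    have := hC₀ R (2 * R) hR0.le hr2 x; rwa [show 2 * R - R = R by ring] at this
  set A : Set (EuclideanSpace ℝ (Fin 3)) := {x | R ≤ cylRadius x ∧ cylRadius x < 2 * R} with hA
  have hAm : MeasurableSet A :=
    (isClosed_le continuous_const continuous_cylRadius).measurableSet.inter
      (isOpen_lt continuous_cylRadius continuous_const).measurableSet
  set χ : EuclideanSpace ℝ (Fin 3) → ℝ := A.indicator fun _ => (1 : ℝ) with hχ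
  have hχm : Measurable χ := measurable_const.indicator hAm
  have hχnn : ∀ x, 0 ≤ χ x := fun x => Set.indicator_nonneg (fun _ _ => zero_le_one) x
  have hχle : ∀ x, χ x ≤ 1 := fun x => Set.indicator_le_self' (fun _ _ => zero_le_one) x
  have hχzero : ∀ x, 2 * R ≤ cylRadius x → χ x = 0 := fun x hx => by
    simp only [hχ, Set.indicator_apply, hA, mem_setOf_eq]
    rw [if_neg]; exact fun h' => absurd h'.2 (not_lt.2 hx)
  have hDφ : ∀ (x v : EuclideanSpace ℝ (Fin 3)), |fderiv ℝ φ x v| ≤ C₀ / R * χ x * ‖v‖ := by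
    intro x v
    by_cases hx : x ∈ A
    · have hχ1 : χ x = 1 := by simp [hχ, hx]
      rw [hχ1, mul_one, ← Real.norm_eq_abs]
      exact (ContinuousLinearMap.le_opNorm _ _).trans
        (mul_le_mul_of_nonneg_right (hDφn x) (norm_nonneg _))
    · have hD0 : fderiv ℝ φ x = 0 := by
        simp only [hA, mem_setOf_eq, not_and_or, not_le, not_lt] at hx
        rcases hx with hx | hx
        · have hmax : IsLocalMax φ x :=
            Eventually.of_forall fun y => by rw [hφone x hx.le]; exact hφle y
          exact hmax.fderiv_eq_zero
        · have hmin : IsLocalMin φ x :=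
            Eventually.of_forall fun y => by rw [hφzero x hx]; exact hφnn y
          exact hmin.fderiv_eq_zero
      rw [hD0]; simp only [zero_apply, abs_zero]
      exact mul_nonneg (mul_nonneg (div_nonneg hC₀0 hR0.le) (hχnn x)) (norm_nonneg _)
  -- the mass of the annulus period
  set V : ℝ := ∫ x in S, χ x with hVdef
  have hV : V ≤ 32 * L * R ^ 2 := by
    have h1 : V = volume.real (S ∩ A) := by
      rw [hVdef, hχ, setIntegral_indicator hAm, setIntegral_const, smul_eq_mul, mul_one]
    rw [h1, measureReal_def]
    refine ENNReal.toReal_le_of_le_ofReal (by positivity) ?_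
    calc volume (S ∩ A) ≤ volume (zSlab L 0 ∩ {x | cylRadius x < 2 * R}) :=
          measure_mono fun x hx => ⟨hx.1, hx.2.2⟩
      _ ≤ ENNReal.ofReal (8 * L * (2 * R) ^ 2) := volume_zSlab_inter_cyl_le hL (by linarith)
      _ = ENNReal.ofReal (32 * L * R ^ 2) := by ring_nf
  have hχ_int : IntegrableOn χ S volume :=
    integrableOn_zSlab_of_bound hL hχm.aestronglyMeasurable (ρ := 2 * R) hχzero (B := 1)
      fun x _ => by rw [Real.norm_eq_abs, abs_of_nonneg (hχnn x)]; exact hχle x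
  -- the identity
  have hid := pressure_flux_identity hL h hUper hφ1 hφper hφnn hφzero
  -- term bounds
  have hT1 : ∀ i, |∫ x in S, fderiv ℝ φ x (b i) * ⟪fderiv ℝ U x (b i), eZ⟫| ≤ C₀ * K₁ / R * V := by
    intro i
    have hbi : ‖b i‖ = 1 := b.orthonormal.1 i
    have hg_int : IntegrableOn (fun x => C₀ * K₁ / R * χ x) S volume := hχ_int.const_mul _
    have h1 := norm_integral_le_of_norm_le (μ := volume.restrict S) hg_int
      (Eventually.of_forall fun x => (?_ :
        ‖fderiv ℝ φ x (b i) * ⟪fderiv ℝ U x (b i), eZ⟫‖ ≤ C₀ * K₁ / R * χ x))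
    · rw [Real.norm_eq_abs] at h1
      refine h1.trans (le_of_eq ?_)
      rw [integral_const_mul]
    · rw [norm_mul, Real.norm_eq_abs]
      have h2 : |fderiv ℝ φ x (b i)| ≤ C₀ / R * χ x := by
        have := hDφ x (b i); rwa [hbi, mul_one] at this
      have h3 : ‖⟪fderiv ℝ U x (b i), eZ⟫‖ ≤ K₁ := by
        calc ‖⟪fderiv ℝ U x (b i), eZ⟫‖ ≤ ‖fderiv ℝ U x (b i)‖ * ‖(eZ : EuclideanSpace ℝ (Fin 3))‖ :=
              norm_inner_le_norm _ _
          _ ≤ ‖fderiv ℝ U x‖ * ‖b i‖ * 1 := by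
              rw [heZ]; exact mul_le_mul_of_nonneg_right (ContinuousLinearMap.le_opNorm _ _) zero_le_one
          _ ≤ K₁ := by rw [hbi, mul_one, mul_one]; exact hK₁ x
      have h5 : 0 ≤ C₀ / R * χ x := mul_nonneg (div_nonneg hC₀0 hR0.le) (hχnn x)
      calc |fderiv ℝ φ x (b i)| * ‖⟪fderiv ℝ U x (b i), eZ⟫‖ ≤ (C₀ / R * χ x) * K₁ :=
            mul_le_mul h2 h3 (norm_nonneg _) h5
        _ = C₀ * K₁ / R * χ x := by ring
  have hT1s : |∑ i, ∫ x in S, fderiv ℝ φ x (b i) * ⟪fderiv ℝ U x (b i), eZ⟫| ≤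
      3 * (C₀ * K₁ / R * V) := by
    refine (Finset.abs_sum_le_sum_abs _ _).trans ?_
    calc ∑ i, |∫ x in S, fderiv ℝ φ x (b i) * ⟪fderiv ℝ U x (b i), eZ⟫|
        ≤ ∑ _i : Fin 3, C₀ * K₁ / R * V := Finset.sum_le_sum fun i _ => hT1 i
      _ = 3 * (C₀ * K₁ / R * V) := by simp
  have hT2 : |∫ x in S, fderiv ℝ φ x (U x) * ⟪U x, eZ⟫| ≤ C₀ * M ^ 2 / R * V := by
    have hg_int : IntegrableOn (fun x => C₀ * M ^ 2 / R * χ x) S volume := hχ_int.const_mul _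
    have h1 := norm_integral_le_of_norm_le (μ := volume.restrict S) hg_int
      (Eventually.of_forall fun x => (?_ :
        ‖fderiv ℝ φ x (U x) * ⟪U x, eZ⟫‖ ≤ C₀ * M ^ 2 / R * χ x))
    · rw [Real.norm_eq_abs] at h1
      refine h1.trans (le_of_eq ?_)
      rw [integral_const_mul]
    · rw [norm_mul, Real.norm_eq_abs]
      have h2 : |fderiv ℝ φ x (U x)| ≤ C₀ / R * χ x * M :=
        (hDφ x (U x)).trans (mul_le_mul_of_nonneg_left (hM x)
          (mul_nonneg (div_nonneg hC₀0 hR0.le) (hχnn x)))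
      have h3 : ‖⟪U x, eZ⟫‖ ≤ M := by
        calc ‖⟪U x, eZ⟫‖ ≤ ‖U x‖ * ‖(eZ : EuclideanSpace ℝ (Fin 3))‖ := norm_inner_le_norm _ _
          _ ≤ M := by rw [heZ, mul_one]; exact hM x
      have h5 : 0 ≤ C₀ / R * χ x * M :=
        mul_nonneg (mul_nonneg (div_nonneg hC₀0 hR0.le) (hχnn x)) hM0
      calc |fderiv ℝ φ x (U x)| * ‖⟪U x, eZ⟫‖ ≤ (C₀ / R * χ x * M) * M :=
            mul_le_mul h2 h3 (norm_nonneg _) h5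
        _ = C₀ * M ^ 2 / R * χ x := by ring
  -- collect
  rw [hid]
  have a1 := abs_le.1 hT1s
  have a2 := abs_le.1 hT2
  have hV0 : 0 ≤ V := setIntegral_nonneg (measurableSet_zSlab L 0) fun x _ => hχnn x
  have e1 : 3 * (C₀ * K₁ / R * V) ≤ 96 * C₀ * K₁ * L * R := by
    have h1 : 3 * (C₀ * K₁ / R * V) ≤ 3 * (C₀ * K₁ / R * (32 * L * R ^ 2)) :=
      mul_le_mul_of_nonneg_left (mul_le_mul_of_nonneg_left hV (by positivity)) (by norm_num)
    have h2 : 3 * (C₀ * K₁ / R * (32 * L * R ^ 2)) = 96 * C₀ * K₁ * L * R := by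
      field_simp; ring
    linarith
  have e2 : C₀ * M ^ 2 / R * V ≤ 32 * C₀ * M ^ 2 * L * R := by
    have h1 : C₀ * M ^ 2 / R * V ≤ C₀ * M ^ 2 / R * (32 * L * R ^ 2) :=
      mul_le_mul_of_nonneg_left hV (by positivity)
    have h2 : C₀ * M ^ 2 / R * (32 * L * R ^ 2) = 32 * C₀ * M ^ 2 * L * R := by
      field_simp
    linarith
  rw [abs_le]
  constructor <;> nlinarith [a1.1, a1.2, a2.1, a2.2, e1, e2]

/-! ### Periodicity of the pressure -/

/-- **The pressure of a bounded axially periodic steady flow is axially periodic** (Han–Wang–Xie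
2023, Lemma 2.7; Bang–Gui–Wang–Xie 2025). Let `(U, P)` be a smooth steady solution of the
unforced Navier–Stokes system on `ℝ³` at unit viscosity (`IsSteadyClassicalNS 1 0 U P`) with
`U` bounded and axially `L`-periodic (`L > 0`). Then `P` is axially `L`-periodic.
[cite: HanWangXie2023, Thm 1.1, proof §§2–3 (periodic pressure, helical identities, Saint-Venant estimate) (source of the ARGUMENT this module implements; this declaration is the cell’s own lemma or plumbing, NOT a printed statement)] -/
theorem steady_pressure_periodic {L M : ℝ} (hL : 0 < L)
    {U : EuclideanSpace ℝ (Fin 3) → EuclideanSpace ℝ (Fin 3)} {P : EuclideanSpace ℝ (Fin 3) → ℝ}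
    (h : IsSteadyClassicalNS 1 0 U P) (hM : ∀ x, ‖U x‖ ≤ M) (hUper : IsAxiallyPeriodic L U) :
    IsAxiallyPeriodic L P := by
  obtain ⟨K₁, K₂, K₃, -, -, -, hK⟩ := steady_derivative_bounds one_pos h hM
  obtain ⟨C₀, hC₀0, hC₀⟩ := exists_norm_fderiv_cylCutoff_le
  obtain ⟨hqper, -⟩ := steady_pressure_partial h hUper
  have hP1 : ContDiff ℝ 1 P := contDiff_infty.1 h.smooth_pressure 1
  have hqc : Continuous fun y => fderiv ℝ P y eZ :=
    (hP1.continuous_fderiv one_ne_zero).clm_apply continuous_const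
  -- the constant period defect
  set c₀ : ℝ := P (L • eZ) - P 0 with hc₀
  have hdef : ∀ x, P (x + L • eZ) - P x = c₀ := fun x => steady_pressure_defect h hUper x
  -- `c₀ ∫_S φ_R = L ∫_S φ_R ∂₃P` for every `R ≥ 1`
  set C : ℝ := 96 * C₀ * K₁ * L + 32 * C₀ * M ^ 2 * L with hC
  have hkey : ∀ R : ℝ, 1 ≤ R → |c₀| * (R ^ 2 * L) ≤ L * (C * R) := by
    intro R hR
    have hR0 : 0 < R := by linarith
    have hr2 : R < 2 * R := by linarith
    set φ : EuclideanSpace ℝ (Fin 3) → ℝ := cylCutoff R (2 * R) with hφ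
    have hφc : Continuous φ := (contDiff_cylCutoff R (2 * R) (n := 0)).continuous
    have hφnn : ∀ x, 0 ≤ φ x := cylCutoff_nonneg R (2 * R)
    have hφle : ∀ x, φ x ≤ 1 := cylCutoff_le_one R (2 * R)
    have hφzero : ∀ x, 2 * R ≤ cylRadius x → φ x = 0 := fun x hx => cylCutoff_eq_zero hR0.le hr2 hx
    have hφz : ∀ (x : EuclideanSpace ℝ (Fin 3)) (s : ℝ), φ (x + s • eZ) = φ x :=
      fun x s => cylCutoff_add_smul_eZ R (2 * R) x s
    have havg := setIntegral_zSlab_mul_verticalIntegral_real hL hφc.measurable hφz (G := 1)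
      (fun x => by rw [abs_of_nonneg (hφnn x)]; exact hφle x) (ρ := 2 * R) hφzero hqc hqper
    have hmean : ∀ x, ∫ s in (0 : ℝ)..L, fderiv ℝ P (x + s • eZ) eZ = c₀ := fun x => by
      rw [verticalIntegral_fderiv_eZ hP1 x, hdef x]
    simp_rw [hmean] at havg
    rw [integral_mul_const] at havg
    -- `havg : (∫_S φ) * c₀ = L * ∫_S φ ∂₃P`
    have hflux := pressure_flux_bound hL h hUper hM (fun x => (hK x).1) hC₀0 hC₀ hR
    have hmass := le_setIntegral_zSlab_cylCutoff hL hR0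
    have hI0 : 0 ≤ ∫ x in zSlab L 0, φ x :=
      setIntegral_nonneg (measurableSet_zSlab L 0) fun x _ => hφnn x
    calc |c₀| * (R ^ 2 * L) ≤ |c₀| * ∫ x in zSlab L 0, φ x :=
          mul_le_mul_of_nonneg_left hmass (abs_nonneg _)
      _ = |(∫ x in zSlab L 0, φ x) * c₀| := by rw [abs_mul, abs_of_nonneg hI0, mul_comm]
      _ = L * |∫ x in zSlab L 0, φ x * fderiv ℝ P x eZ| := by
          rw [havg, abs_mul, abs_of_pos hL]
      _ ≤ L * (C * R) := mul_le_mul_of_nonneg_left hflux hL.le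
  -- hence `c₀ = 0`
  have hc0 : c₀ = 0 := by
    by_contra hne
    have hpos : 0 < |c₀| := abs_pos.2 hne
    have hC0 : 0 ≤ C := by
      have := hkey 1 le_rfl
      nlinarith
    set R : ℝ := C / |c₀| + 1 with hR
    have hR1 : 1 ≤ R := by rw [hR]; have := div_nonneg hC0 hpos.le; linarith
    have h1 := hkey R hR1
    -- `|c₀| R² L ≤ L C R` gives `|c₀| R ≤ C`, but `|c₀| R = C + |c₀| > C`
    have h2 : |c₀| * R ≤ C := by
      have hR0 : 0 < R := by linarith
      have : |c₀| * R * (R * L) ≤ C * (R * L) := by nlinarith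
      exact le_of_mul_le_mul_right this (by positivity)
    have h3 : |c₀| * R = C + |c₀| := by rw [hR]; field_simp
    linarith
  intro x
  have := hdef x
  rw [hc0, sub_eq_zero] at this
  exact this

end Literature.Analysis.SteadySlabLiouville.HelicalSlab

end Part6

/-!
## Part 7 — port of `Summits/NavierStokesRegularity/NavierStokesRegularity/Theorems/ScenarioCensusPeriodicSlabHelical.lean` (2 declarations kept)

# Census rows S6 / S7: the small period–Reynolds number case of the helical steady Liouville theorem

Support file for the scenario census of `NavierStokesRegularity` (cell `pub/ns-census`, block S). Row
S6 is the printed Liouville theorem of Han–Wang–Xie (arXiv:2312.10382 = Sci. China Math. 2025,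
Thm 1.1; tree FACT `Literature.Analysis.FluidPDE.HanWangXie2023_helical_liouville`, no `_holds`):
a bounded smooth helically symmetric steady flow on `ℝ³` is an axial constant `C e₃`. A helically
symmetric field of pitch `κ ≠ 0` is `2π|κ|`-periodic along the axis ("Hence any helically symmetric
flow is periodic in `x₃`-direction, with a period `2π|κ|`", loc. cit. §1), so the tree theorem
`PeriodicSlab.periodicSlab_liouville_small` (Bang–Gui–Wang–Xie 2025 Thm 1.4 (d), row S7d) settles the
SMALL period–Reynolds sub-cell of S6 unconditionally:

* `isAxiallyPeriodic_of_isHelicallySymmetric` — pitch `κ` ⇒ axial period `2πκ` (`isAxiallyPeriodic_neg`: and `−2πκ`);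
* `helical_liouville_small` — `ν > 0`, `κ ≠ 0`, `IsLerayProfile ν 0 U P`, `U, P ∈ C^∞`,
  `sup ‖U‖ < ν/|κ|` (`= 2πν/(2π|κ|)`), `IsHelicallySymmetric κ U` ⇒ `U ≡ C e₃` — the conclusion of
  the S6 fact on the sub-class `Re_P = 2π|κ|·sup‖U‖/ν < 2π`, with the same binders plus the bound.

No summit statement and no census row is proved in this file; S6 proper (any `Re_P`) stays PRINT.

## References

* J. Han, Y. Wang, C. Xie, arXiv:2312.10382 (2023), Thm 1.1 and §1 (periodicity of helical fields).
  [HanWangXie2023]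
* J. Bang, C. Gui, Y. Wang, C. Xie, J. Fluid Mech. 1005 (2025) A6 = arXiv:2205.13259, Thm 1.4 (d).
  [BangGuiWangXie2025]

Not carried from this source module (not needed by the declarations re-homed here; their consumers are Summits-side): `helical_liouville_small`.
-/

section Part7

open _root_.MeasureTheory _root_.Set _root_.Function _root_.Filter
open scoped _root_.Topology RealInnerProductSpace

namespace Literature.Analysis.SteadySlabLiouville.PeriodicSlab

open Literature.Analysis Literature.Analysis.FluidPDE

/-- **A helically symmetric field of pitch `κ` is axially periodic with period `2πκ`** (the screw
motion by the angle `2π` is the translation by `2πκ e₃`).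
[cite: HanWangXie2023, Thm 1.1, proof §3; BangGuiWangXie2025, Thm 1.4 (d), proof §5 (source of the ARGUMENT this module implements; this declaration is the cell’s own lemma or plumbing, NOT a printed statement)] -/
theorem isAxiallyPeriodic_of_isHelicallySymmetric {κ : ℝ}
    {U : EuclideanSpace ℝ (Fin 3) → EuclideanSpace ℝ (Fin 3)} (hU : IsHelicallySymmetric κ U) :
    IsAxiallyPeriodic (2 * Real.pi * κ) U := by
  intro x
  -- the full turn is the identity (cf. the tree's `rotZ_two_pi` lemmas; inlined to stay import-light)
  have hturn : ∀ y : EuclideanSpace ℝ (Fin 3), rotZ (2 * Real.pi) y = y := fun y => by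
    ext i
    fin_cases i <;> simp [rotZ, Real.cos_two_pi, Real.sin_two_pi]
  have h := hU (2 * Real.pi) x
  rw [hturn, hturn] at h
  have e : (κ * (2 * Real.pi)) • (eZ : EuclideanSpace ℝ (Fin 3)) =
      (2 * Real.pi * κ) • EuclideanSpace.single 2 (1 : ℝ) := by
    rw [mul_comm]; rfl
  rw [e] at h
  exact h

/-- Axial periodicity with period `p` implies axial periodicity with period `−p`.
[cite: HanWangXie2023, Thm 1.1, proof §3; BangGuiWangXie2025, Thm 1.4 (d), proof §5 (source of the ARGUMENT this module implements; this declaration is the cell’s own lemma or plumbing, NOT a printed statement)] -/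
theorem isAxiallyPeriodic_neg {α : Sort*} {p : ℝ} {U : EuclideanSpace ℝ (Fin 3) → α}
    (hU : IsAxiallyPeriodic p U) : IsAxiallyPeriodic (-p) U := by
  intro x
  have h := hU (x + (-p) • EuclideanSpace.single 2 (1 : ℝ))
  rw [add_assoc, ← add_smul, neg_add_cancel, zero_smul, add_zero] at h
  exact h.symm

end Literature.Analysis.SteadySlabLiouville.PeriodicSlab

end Part7

/-!
## Part 8 — port of `Summits/NavierStokesRegularity/NavierStokesRegularity/Theorems/ScenarioCensusHelicalSlabLiouville.lean` (4 declarations kept)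

# Census row S6: the Liouville theorem for bounded helically symmetric steady flows
# (Han–Wang–Xie 2023, Thm 1.1), any period–Reynolds number

Support file for the scenario census of `NavierStokesRegularity` (cell `pub/ns-census`, block S).
**Theorem** (J. Han, Y. Wang, C. Xie, arXiv:2312.10382 = Sci. China Math. 69 (2025), Thm 1.1; the
tree FACT `Literature.Analysis.FluidPDE.HanWangXie2023_helical_liouville`, verbatim): for every
`ν > 0` and pitch `κ ≠ 0`, a smooth steady Navier–Stokes flow `(U, P)` on `ℝ³`
(`IsLerayProfile ν 0 U P`, `U, P ∈ C^∞`), bounded and helically symmetric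
(`IsHelicallySymmetric κ U`), is an axial constant `U ≡ C e₃` (`helical_liouville`). The small
period–Reynolds sub-case (`sup ‖U‖ < ν/|κ|`) was `PeriodicSlab.helical_liouville_small`; here
NO smallness is assumed.

Proof (the printed §3, assembled from the sibling files, with the Bogovskiĭ corrector replaced by
the foot-point splitting of the pressure): normalise `ν = 1`
(`IsLerayProfile.inv_smul_viscosity`); the flow is `2π|κ|`-periodic along the axis
(`…PeriodicSlabHelical`), all derivatives and `∇P` are bounded (`…PeriodicSlabRegularity`), the
pressure is periodic (`steady_pressure_periodic`, HWX Lemma 2.7), the radial velocity `⟪x_h, U⟫`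
has zero vertical period means (`helical_radial_verticalMean_eq_zero`, HWX (A117)); hence the
dyadic energy inequality `E(r) ≤ a λ r + c (E(2r) − E(r))/(λ r)`
(`helical_dyadic_weighted_estimate`) for the period energy `E(r) = ∫_{zSlab ∩ {ρ<r}} |DU|²`, so
`E ≡ 0` by the dyadic Saint-Venant lemma (`saintVenant_dyadic`, `γ = 0`), `DU ≡ 0`, `U` is
constant, and a helically symmetric constant is axial (half turn).

No summit statement is proved in this file; the census value of row S6 is the lead's call
(the by-name closer `row_S6_excluded` is the leaf file `ScenarioCensusSteadyS6.lean`).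

## References

* J. Han, Y. Wang, C. Xie, arXiv:2312.10382 (2023) = Sci. China Math. 69 (2025), Thm 1.1, §3.
  [HanWangXie2023] [HanWangXie2025]
* J. Bang, C. Gui, Y. Wang, C. Xie, J. Fluid Mech. 1005 (2025) A6 = arXiv:2205.13259.
  [BangGuiWangXie2025]
-/

section Part8

open _root_.MeasureTheory _root_.Set _root_.Function _root_.Filter _root_.InnerProductSpace
open scoped _root_.Topology _root_.ENNReal _root_.NNReal RealInnerProductSpace Laplacian _root_.ContDiff

namespace Literature.Analysis.SteadySlabLiouville.HelicalSlab

open Literature.Analysis Literature.Analysis.FluidPDE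
open Literature.Analysis.SteadySlabLiouville.PeriodicSlab

/-! ### Pointwise bookkeeping -/

/-- A linear map on `ℝ³` with vanishing Frobenius norm vanishes.
[cite: HanWangXie2023, Thm 1.1, proof §§2–3 (periodic pressure, helical identities, Saint-Venant estimate) (source of the ARGUMENT this module implements; this declaration is the cell’s own lemma or plumbing, NOT a printed statement)] -/
theorem eq_zero_of_frobeniusNormSq_eq_zero {T : EuclideanSpace ℝ (Fin 3) →L[ℝ] EuclideanSpace ℝ (Fin 3)}
    (hT : frobeniusNormSq T = 0) : T = 0 := by
  set b := EuclideanSpace.basisFun (Fin 3) ℝ with hb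
  have hcoord : ∀ i, T (b i) = 0 := fun i => by
    have h1 := norm_apply_sq_le_frobeniusNormSq b T i
    rw [hT] at h1
    have h3 : ‖T (b i)‖ ^ 2 = 0 := le_antisymm h1 (sq_nonneg _)
    exact norm_eq_zero.1 (pow_eq_zero_iff two_ne_zero |>.1 h3)
  ext v
  have hv : v = ∑ i, ⟪b i, v⟫ • b i := (b.sum_repr' v).symm
  rw [hv, map_sum]
  simp [map_smul, hcoord]

/-! ### The dyadic estimate in energy form -/

/-- **The dyadic energy estimate** for a smooth steady flow at unit viscosity, axially periodic
with periodic pressure, bounded with bounded gradient and pressure gradient, and mean-free radial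
velocity on vertical periods (`‖U‖ ≤ M`, `|DU|² ≤ B`, `‖DP‖ ≤ K₃`): with
`E(r) = ∫_{zSlab L 0 ∩ {ρ<r}} |DU|²` there are `a, c ≥ 0` with
`E(r) ≤ a λ r + c (E(2r) − E(r))/(λ r)` for all `r ≥ 1`, `λ > 0`.
[cite: HanWangXie2023, Thm 1.1, proof §§2–3 (periodic pressure, helical identities, Saint-Venant estimate) (source of the ARGUMENT this module implements; this declaration is the cell’s own lemma or plumbing, NOT a printed statement)] -/
theorem helical_energy_dyadic_estimate {L M K₃ B : ℝ} (hL : 0 < L)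
    {U : EuclideanSpace ℝ (Fin 3) → EuclideanSpace ℝ (Fin 3)} {P : EuclideanSpace ℝ (Fin 3) → ℝ}
    (h : IsLerayProfile 1 0 U P) (hU : ContDiff ℝ (⊤ : ℕ∞) U) (hP : ContDiff ℝ (⊤ : ℕ∞) P)
    (hUper : IsAxiallyPeriodic L U) (hPper : IsAxiallyPeriodic L P)
    (hM : ∀ x, ‖U x‖ ≤ M) (hB : ∀ x, frobeniusNormSq (fderiv ℝ U x) ≤ B)
    (hK₃ : ∀ x, ‖fderiv ℝ P x‖ ≤ K₃)
    (hmean : ∀ x, ∫ s in (0 : ℝ)..L, ⟪horizPart x, U (x + s • eZ)⟫ = 0)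
    (E : ℝ → ℝ) (hE : ∀ r, E r = ∫ x in zSlab L 0 ∩ {x | cylRadius x < r},
      frobeniusNormSq (fderiv ℝ U x)) :
    ∃ a c : ℝ, 0 ≤ a ∧ 0 ≤ c ∧ ∀ r : ℝ, 1 ≤ r → ∀ lam : ℝ, 0 < lam →
      1 * E r ≤ 0 * (E (2 * r) - E r) / r + a * lam * r + c * (E (2 * r) - E r) / (lam * r) := by
  obtain ⟨C₀, hC₀0, hC₀⟩ := exists_norm_gradient_cylCutoff_le
  set κ : ℝ := (L / (2 * Real.pi)) ^ 2 with hκ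
  have hκ0 : 0 ≤ κ := sq_nonneg _
  have hM0 : 0 ≤ M := (norm_nonneg _).trans (hM 0)
  have hK₃0 : 0 ≤ K₃ := (norm_nonneg _).trans (hK₃ 0)
  have hU1 : ContDiff ℝ 1 U := contDiff_infty.1 hU 1
  set F : EuclideanSpace ℝ (Fin 3) → ℝ := fun x => frobeniusNormSq (fderiv ℝ U x) with hF
  have hFc : Continuous F := continuous_frobeniusNormSq_fderiv hU1 one_ne_zero
  have hF0 : ∀ x, 0 ≤ F x := fun x => frobeniusNormSq_nonneg _
  refine ⟨96 * C₀ * M * L + 8 * C₀ * M ^ 2 * L + 16 * C₀ * K₃ * L ^ 2,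
    3 * C₀ * M + C₀ * M ^ 2 * κ + 2 * C₀ * K₃ * L * κ, by positivity, by positivity, ?_⟩
  intro r hr lam hlam
  have hr0 : 0 < r := by linarith
  have hr2 : r < 2 * r := by linarith
  have hA := helical_dyadic_weighted_estimate hL h hU hP hUper hPper hM hK₃ hB hmean hC₀ hr hlam
  -- abbreviations
  set S : Set (EuclideanSpace ℝ (Fin 3)) := zSlab L 0 with hS
  set φ : EuclideanSpace ℝ (Fin 3) → ℝ := cylCutoff r (2 * r) with hφ
  set A : Set (EuclideanSpace ℝ (Fin 3)) := {x | r ≤ cylRadius x ∧ cylRadius x < 2 * r} with hAdef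
  set χ : EuclideanSpace ℝ (Fin 3) → ℝ := A.indicator fun _ => (1 : ℝ) with hχ
  set Iφ : ℝ := ∫ x in S, φ x * F x with hIφ
  set D : ℝ := ∫ x in S, χ x * F x with hD
  have hφc : Continuous φ := (contDiff_cylCutoff r (2 * r) (n := 0)).continuous
  have hφnn : ∀ x, 0 ≤ φ x := cylCutoff_nonneg r (2 * r)
  have hφone : ∀ x, cylRadius x ≤ r → φ x = 1 := fun x hx => cylCutoff_eq_one hr0.le hr2 hx
  have hφzero : ∀ x, 2 * r ≤ cylRadius x → φ x = 0 := fun x hx => cylCutoff_eq_zero hr0.le hr2 hx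
  have hAm : MeasurableSet A :=
    (isClosed_le continuous_const continuous_cylRadius).measurableSet.inter
      (isOpen_lt continuous_cylRadius continuous_const).measurableSet
  have hIφ_int : IntegrableOn (fun x => φ x * F x) S volume :=
    integrableOn_zSlab_of_eq_zero_of_le_cylRadius (Q := fun x => φ x * F x) (hφc.mul hFc)
      (fun x hx => by show φ x * F x = 0; rw [hφzero x hx, zero_mul]) L 0
  have hF_int2 : IntegrableOn F (S ∩ {x | cylRadius x < 2 * r}) volume :=
    integrableOn_zSlab_inter_cyl_of_bound hL (by linarith) hFc (B := B) fun x => by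
      rw [Real.norm_of_nonneg (hF0 x)]; exact hB x
  have hmeas : MeasurableSet (S ∩ {x : EuclideanSpace ℝ (Fin 3) | cylRadius x < r}) :=
    (measurableSet_zSlab L 0).inter (isOpen_lt continuous_cylRadius continuous_const).measurableSet
  have hsub : S ∩ {x | cylRadius x < r} ⊆ S ∩ {x | cylRadius x < 2 * r} :=
    fun x hx => ⟨hx.1, lt_trans hx.2 hr2⟩
  -- `E(r) ≤ Iφ`
  have hEr : E r ≤ Iφ := by
    rw [hE r]
    calc ∫ x in S ∩ {x | cylRadius x < r}, F x
        = ∫ x in S, (S ∩ {x | cylRadius x < r}).indicator F x := by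
          rw [setIntegral_indicator hmeas, Set.inter_eq_self_of_subset_right inter_subset_left]
      _ ≤ Iφ := by
          refine setIntegral_mono_on ((hF_int2.mono_set hsub).integrable_indicator hmeas |>.integrableOn)
            hIφ_int (measurableSet_zSlab L 0) fun x _ => ?_
          by_cases hx : x ∈ S ∩ {x | cylRadius x < r}
          · rw [Set.indicator_of_mem hx, hφone x (le_of_lt hx.2), one_mul]
          · rw [Set.indicator_of_notMem hx]; exact mul_nonneg (hφnn x) (hF0 x)
  -- `E(2r) − E(r) = D`
  have hED : E (2 * r) - E r = D := by
    rw [hE (2 * r), hE r, hD]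
    have hdiff : (S ∩ {x | cylRadius x < 2 * r}) \ (S ∩ {x | cylRadius x < r}) = S ∩ A := by
      ext x
      constructor
      · rintro ⟨⟨hxS, hx2⟩, hnot⟩
        refine ⟨hxS, ?_, hx2⟩
        by_contra hlt
        exact hnot ⟨hxS, not_le.1 hlt⟩
      · rintro ⟨hxS, h1, h2⟩
        exact ⟨⟨hxS, h2⟩, fun h' => (not_lt.2 h1) h'.2⟩
    rw [← setIntegral_sdiff hmeas hF_int2 hsub, hdiff, ← setIntegral_indicator hAm]
    refine setIntegral_congr_fun (measurableSet_zSlab L 0) fun x _ => ?_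
    by_cases hx : x ∈ A
    · simp [hχ, hx]
    · simp [hχ, hx]
  rw [one_mul, zero_mul, zero_div, zero_add, hED]
  exact hEr.trans hA

/-! ### The Liouville theorem -/

/-- **Han–Wang–Xie 2023, Thm 1.1, at unit viscosity.** A smooth steady Navier–Stokes flow on
`ℝ³` with `ν = 1` (`IsLerayProfile 1 0 U P`, `U, P ∈ C^∞`), bounded and helically symmetric of
pitch `κ ≠ 0`, is an axial constant.
[cite: HanWangXie2023, Thm 1.1, proof §§2–3 (periodic pressure, helical identities, Saint-Venant estimate) (source of the ARGUMENT this module implements; this declaration is the cell’s own lemma or plumbing, NOT a printed statement)] -/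
theorem helical_liouville_one {κ : ℝ} (hκ : κ ≠ 0)
    {U : EuclideanSpace ℝ (Fin 3) → EuclideanSpace ℝ (Fin 3)} {P : EuclideanSpace ℝ (Fin 3) → ℝ}
    (hprof : IsLerayProfile 1 0 U P) (hU : ContDiff ℝ (⊤ : ℕ∞) U) (hP : ContDiff ℝ (⊤ : ℕ∞) P)
    (hbd : ∃ M : ℝ, ∀ x, ‖U x‖ ≤ M) (hsym : IsHelicallySymmetric κ U) :
    ∃ C : ℝ, U = fun _ => C • eZ := by
  obtain ⟨M, hM⟩ := hbd
  have hst : IsSteadyClassicalNS 1 0 U P := isSteadyClassicalNS_of_isLerayProfile hprof hU hP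
  -- axial period `L = 2π|κ|`
  set L : ℝ := 2 * Real.pi * |κ| with hL
  have hL0 : 0 < L := by rw [hL]; positivity
  have hper : IsAxiallyPeriodic L U := by
    have h1 := isAxiallyPeriodic_of_isHelicallySymmetric hsym
    rcases le_or_gt 0 κ with hk | hk
    · rw [hL, abs_of_nonneg hk]; exact h1
    · rw [hL, abs_of_neg hk, show 2 * Real.pi * -κ = -(2 * Real.pi * κ) by ring]
      exact isAxiallyPeriodic_neg h1
  -- periodic pressure, derivative bounds
  have hPper : IsAxiallyPeriodic L P := steady_pressure_periodic hL0 hst hM hper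
  obtain ⟨K₁, K₂, K₃, -, -, -, hK⟩ := steady_derivative_bounds one_pos hst hM
  have hK₁ : ∀ x, ‖fderiv ℝ U x‖ ≤ K₁ := fun x => (hK x).1
  have hK₃ : ∀ x, ‖fderiv ℝ P x‖ ≤ K₃ := fun x => by
    have e : ‖fderiv ℝ P x‖ = ‖gradient P x‖ := by
      rw [gradient]; exact ((InnerProductSpace.toDual ℝ (EuclideanSpace ℝ (Fin 3))).symm.norm_map _).symm
    rw [e]; exact (hK x).2.2
  have hU1 : ContDiff ℝ 1 U := contDiff_infty.1 hU 1
  have hUd : Differentiable ℝ U := hU1.differentiable one_ne_zero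
  -- the helical flux lemma
  have hmean := helical_radial_verticalMean_eq_zero hU1 hK₁ hst.divFree hper hsym
  -- the period energies
  set F : EuclideanSpace ℝ (Fin 3) → ℝ := fun x => frobeniusNormSq (fderiv ℝ U x) with hF
  set E : ℝ → ℝ := fun r => ∫ x in zSlab L 0 ∩ {x | cylRadius x < r}, F x with hE
  have hFc : Continuous F := continuous_frobeniusNormSq_fderiv hU1 one_ne_zero
  have hF0 : ∀ x, 0 ≤ F x := fun x => frobeniusNormSq_nonneg _
  -- `|DU|² ≤ 3 ‖DU‖² ≤ 3 K₁²` (Frobenius versus operator norm; inlined)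
  set b := EuclideanSpace.basisFun (Fin 3) ℝ with hb
  have hFB' : ∀ x, F x ≤ 3 * K₁ ^ 2 := fun x => by
    show frobeniusNormSq (fderiv ℝ U x) ≤ 3 * K₁ ^ 2
    rw [frobeniusNormSq_eq_sum b]
    calc ∑ i, ‖fderiv ℝ U x (b i)‖ ^ 2 ≤ ∑ _i : Fin 3, K₁ ^ 2 := Finset.sum_le_sum fun i _ => by
          have h1 : ‖fderiv ℝ U x (b i)‖ ≤ K₁ := by
            calc ‖fderiv ℝ U x (b i)‖ ≤ ‖fderiv ℝ U x‖ * ‖b i‖ := ContinuousLinearMap.le_opNorm _ _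
              _ ≤ K₁ := by rw [b.orthonormal.1 i, mul_one]; exact hK₁ x
          exact pow_le_pow_left₀ (norm_nonneg _) h1 2
      _ = 3 * K₁ ^ 2 := by simp
  have hFB : ∀ x, ‖F x‖ ≤ 3 * K₁ ^ 2 := fun x => by
    rw [Real.norm_of_nonneg (hF0 x)]; exact hFB' x
  obtain ⟨a, c, ha, hc, hineq⟩ := helical_energy_dyadic_estimate hL0 hprof hU hP hper hPper hM hFB'
    hK₃ hmean E (fun r => rfl)
  have hFper : IsAxiallyPeriodic L F := fun x => by
    simp only [hF, isAxiallyPeriodic_fderiv hper x]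
  have hEint : ∀ r, 0 < r → IntegrableOn F (zSlab L 0 ∩ {x | cylRadius x < r}) volume :=
    fun r hr => integrableOn_zSlab_inter_cyl_of_bound hL0 hr hFc hFB
  have hmono : ∀ r s, 1 ≤ r → r ≤ s → E r ≤ E s := fun r s hr hrs =>
    setIntegral_mono_set (hEint s (by linarith)) (Eventually.of_forall fun x => hF0 x)
      (Eventually.of_forall fun x hx => ⟨hx.1, lt_of_lt_of_le hx.2 hrs⟩)
  have hE0 : ∀ r, 1 ≤ r → 0 ≤ E r := fun r _ =>
    setIntegral_nonneg ((measurableSet_zSlab L 0).inter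
      (isOpen_lt continuous_cylRadius continuous_const).measurableSet) fun x _ => hF0 x
  have hEA : ∀ r, 1 ≤ r → E r ≤ 3 * K₁ ^ 2 * (8 * L) * r ^ 2 := by
    intro r hr
    have hr0 : 0 < r := by linarith
    have hvol := volume_zSlab_inter_cyl_le hL0 hr0
    have hfin : volume (zSlab L 0 ∩ {x | cylRadius x < r}) ≠ ⊤ :=
      (lt_of_le_of_lt hvol ENNReal.ofReal_lt_top).ne
    have hmeas : MeasurableSet (zSlab L 0 ∩ {x : EuclideanSpace ℝ (Fin 3) | cylRadius x < r}) :=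
      (measurableSet_zSlab L 0).inter (isOpen_lt continuous_cylRadius continuous_const).measurableSet
    calc E r ≤ ∫ x in zSlab L 0 ∩ {x | cylRadius x < r}, (3 * K₁ ^ 2 : ℝ) := by
          refine setIntegral_mono_on (hEint r hr0) ?_ hmeas fun x _ => ?_
          · exact integrableOn_const hfin
          · have := hFB x; rwa [Real.norm_of_nonneg (hF0 x)] at this
      _ = (volume (zSlab L 0 ∩ {x | cylRadius x < r})).toReal * (3 * K₁ ^ 2) := by
          rw [setIntegral_const, smul_eq_mul, measureReal_def]
      _ ≤ (8 * L * r ^ 2) * (3 * K₁ ^ 2) :=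
          mul_le_mul_of_nonneg_right (ENNReal.toReal_le_of_le_ofReal (by positivity) hvol)
            (by positivity)
      _ = 3 * K₁ ^ 2 * (8 * L) * r ^ 2 := by ring
  -- `E ≡ 0` by the dyadic lemma (`γ = 0`)
  have hEzero : ∀ r, 1 ≤ r → E r = 0 :=
    saintVenant_dyadic one_pos le_rfl ha hc hmono hE0 hEA hineq
  -- `DU ≡ 0`, `U` constant
  have hFzero : ∀ x, F x = 0 :=
    eq_zero_of_setIntegral_zSlab_eq_zero hL0 hFc hF0 hFper hFB hEzero
  have hDU : ∀ x, fderiv ℝ U x = 0 := fun x => eq_zero_of_frobeniusNormSq_eq_zero (hFzero x)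
  have hconst : ∀ x, U x = U 0 := fun x => is_const_of_fderiv_eq_zero hUd hDU x 0
  -- a helically symmetric constant field is axial (half turn)
  set C : EuclideanSpace ℝ (Fin 3) := U 0 with hC
  have hrot : rotZ Real.pi C = C := by
    have h := hsym Real.pi 0
    rw [hconst (rotZ Real.pi 0 + (κ * Real.pi) • eZ)] at h
    exact h.symm
  have hC0 : C 0 = 0 := by
    have h0 := congrArg (fun v : EuclideanSpace ℝ (Fin 3) => v 0) hrot
    simp only [rotZ_apply_zero, Real.cos_pi, Real.sin_pi] at h0
    linarith
  have hC1 : C 1 = 0 := by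
    have h1 := congrArg (fun v : EuclideanSpace ℝ (Fin 3) => v 1) hrot
    simp only [rotZ_apply_one, Real.cos_pi, Real.sin_pi] at h1
    linarith
  refine ⟨C 2, funext fun x => ?_⟩
  rw [hconst x]
  ext i
  fin_cases i <;> simp [eZ, hC0, hC1]

/-- **The Liouville theorem for bounded helically symmetric steady flows (Han–Wang–Xie 2023,
Thm 1.1), any viscosity `ν > 0`, any period–Reynolds number.** For `ν > 0` and `κ ≠ 0`, a smooth
steady solution `(U, P)` of the unforced Navier–Stokes system on `ℝ³` (`IsLerayProfile ν 0 U P`,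
`U, P ∈ C^∞`) with `U` bounded and helically symmetric (`IsHelicallySymmetric κ U`) is an axial
constant `U ≡ C e₃`. This is the statement of the named fact
`Literature.Analysis.FluidPDE.HanWangXie2023_helical_liouville` under its hypotheses.
[cite: HanWangXie2023, Thm 1.1, proof §§2–3 (periodic pressure, helical identities, Saint-Venant estimate) (source of the ARGUMENT this module implements; this declaration is the cell’s own lemma or plumbing, NOT a printed statement)] -/
theorem helical_liouville {ν κ : ℝ} (hν : 0 < ν) (hκ : κ ≠ 0)
    {U : EuclideanSpace ℝ (Fin 3) → EuclideanSpace ℝ (Fin 3)} {P : EuclideanSpace ℝ (Fin 3) → ℝ}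
    (hprof : IsLerayProfile ν 0 U P) (hU : ContDiff ℝ (⊤ : ℕ∞) U) (hP : ContDiff ℝ (⊤ : ℕ∞) P)
    (hbd : ∃ M : ℝ, ∀ x, ‖U x‖ ≤ M) (hsym : IsHelicallySymmetric κ U) :
    ∃ C : ℝ, U = fun _ => C • eZ := by
  obtain ⟨M, hM⟩ := hbd
  -- normalise the viscosity
  set V : EuclideanSpace ℝ (Fin 3) → EuclideanSpace ℝ (Fin 3) := fun x => ν⁻¹ • U x with hV
  set Q : EuclideanSpace ℝ (Fin 3) → ℝ := fun x => ν⁻¹ ^ 2 • P x with hQ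
  have hprof1 : IsLerayProfile 1 0 V Q := hprof.inv_smul_viscosity hν.ne'
  have hVs : ContDiff ℝ (⊤ : ℕ∞) V := hU.const_smul ν⁻¹
  have hQs : ContDiff ℝ (⊤ : ℕ∞) Q := hP.const_smul (ν⁻¹ ^ 2)
  have hVbd : ∃ M' : ℝ, ∀ x, ‖V x‖ ≤ M' := ⟨|ν⁻¹| * M, fun x => by
    show ‖ν⁻¹ • U x‖ ≤ |ν⁻¹| * M
    rw [norm_smul, Real.norm_eq_abs]
    exact mul_le_mul_of_nonneg_left (hM x) (abs_nonneg _)⟩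
  have hVsym : IsHelicallySymmetric κ V := fun ρ x => by
    show ν⁻¹ • U (rotZ ρ x + (κ * ρ) • eZ) = rotZ ρ (ν⁻¹ • U x)
    rw [hsym ρ x]
    exact ((rotZL ρ).map_smul ν⁻¹ (U x)).symm
  obtain ⟨C, hC⟩ := helical_liouville_one hκ hprof1 hVs hQs hVbd hVsym
  refine ⟨ν * C, funext fun x => ?_⟩
  have hx : ν⁻¹ • U x = C • eZ := congrFun hC x
  have := congrArg (fun v => ν • v) hx
  simpa [smul_smul, mul_inv_cancel₀ hν.ne'] using this

end Literature.Analysis.SteadySlabLiouville.HelicalSlab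

end Part8

/-! ## Part 9 — the EXACT discharge -/

namespace Literature.Analysis.FluidPDE

/-- **The named fact `HanWangXie2023_helical_liouville` HOLDS** (`SteadyHelicalLiouville.lean`; Han–Wang–Xie 2023, Thm 1.1: for
every `ν > 0` and pitch `κ ≠ 0`, a bounded smooth helically symmetric steady Navier–Stokes flow on `ℝ³` is an axial constant
`C e₃`, with NO smallness of the period–Reynolds number).  Proof term of `SteadySlabLiouville.HelicalSlab.helical_liouville`
(this file), Literature-side twin of
`Summit.NavierStokesRegularity.NavierStokesRegularity.Theorems.ScenarioCensus.hanWangXie2023_helical_liouville_holds`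
(`ScenarioCensusSteadyS6.lean`, same term through the census alias `row_S6_excluded : Row_S6`, not carried).
[cite: HanWangXie2023, Theorem 1.1 (proof: §3, with the preliminaries of §2)] -/
theorem HanWangXie2023_helical_liouville_holds : HanWangXie2023_helical_liouville :=
  fun _ν hν _κ hκ _U _P hUP hU hP hbdd hsym =>
    SteadySlabLiouville.HelicalSlab.helical_liouville hν hκ hUP hU hP hbdd hsym

end Literature.Analysis.FluidPDE

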